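import Literature.Geometry.Kaehler.CyclotomicThirtyTwoHodgeConjecture
import Literature.AlgebraicGeometry.ComplexMultiplication.CyclotomicCMTypeCensusForty
import HarnessLib

/-!
# `ℚ(ζ₄₀) = ℚ(ζ₈, ζ₅)` (`φ = 16`): the RANK TABLE `9 ∕ 7 ∕ 5 ∕ 3 ∕ 2` of its `256` CM types, the Hodge conjecture for all powers of the abelian
# varieties of the `192` types OFF the 4 degenerate primitive families, SIMPLE CM `8`-FOLDS WITH `B⁴ ≠ D⁴` or `B² ≠ D²` for the `64` types ON them,
# and the complex `8`-tori with an endomorphism of characteristic polynomial `Φ₄₀`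

Layer `Literature/Geometry/Kaehler`, namespace `Literature.Geometry.Kaehler.ComplexTorus`; lane `lit-hodgefound` (Track 2 foundations
library), prover seat `lit-hodgefound-p10`, generation 34 (addendum), row «A2-26 (ℚ(ζ₄₀) Hodge)» (self-proposed 2026-08-28).  Theorems only; no
`def`, no instance, no named fact (net Literature debt 0).  The cyclotomic fields of degree `16` (`d ∈ {17, 32, 34, 40, 48, 60}`) all have a
`2`-GROUP as Galois group; `ℚ(ζ₁₇) = ℚ(ζ₃₄)` (cyclic: every type nondegenerate) is the tree's `CyclicTwoPowerCMTypesFermat`; this file treats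
`ℚ(ζ₄₀)`, `(ℤ/40)ˣ ≅ C₂ × C₂ × C₄`, where degenerate PRIMITIVE types occur (`{1, 3, 7, 9, 11, 13, 21, 23}`: rank `7`; `{1, 3, 7, 9, 11, 17, 21, 27}`: rank `7`; `{1, 3, 7, 11, 13, 19, 23, 31}`: rank `7`; `{1, 3, 7, 11, 17, 19, 27, 31}`: rank `7`).

INPUT: the census `CyclotomicCMTypeCensusForty` (24 families sorted «not coset-balanced ∕ free & balanced ∕ not free»; the maximal
`(−1)`-free subgroups; the balance of the representatives), `Pohlmann1968/CyclotomicCosetBalancedCMTypes` (Yanai at full strength on residues: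
`cmTypeRank_add_le_of_cosetBalanced`; Mumford–Pohlmann: `exists_exceptional_of_cosetBalanced`) and explicit rank certificates.

* §1 RANKS: lower bounds by explicit invertible minors of the `16 × 16` translate matrix `([u·c ∈ S])` (`9 × 9` for the eight not
  coset-balanced representatives, `7 × 7`, `7 × 7`, `7 × 7`, `7 × 7` for the degenerate primitive ones, `5 × 5` for the
  representatives with stabiliser of order `2`), upper bounds by Kubota (`≤ 9`), Yanai (`rank + m ≤ 9` when balanced for `W`, `|W|·2m = 16`)
  and the induced-type bound; **`cmTypeRank_eq_nine_of_not_cosetBalanced_forty`**, **`cmTypeRank_of_isPrimitive_of_cosetBalanced_forty`**,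
  **`cmTypeRank_of_not_isPrimitive_forty`** (`5 ∕ 3 ∕ 2` by stabiliser order `2 ∕ 4 ∕ 8`), `cmTypeRank_mem_forty`, **`isNondegenerate_iff_not_cosetBalanced_forty`**,
  `isPrimitive_iff_seven_le_cmTypeRank_forty`, `ncard_isNondegenerate_forty` (`128`).
* §2 VARIETIES of type `(ℚ(ζ₄₀); Φ)` (all of dimension `8`): **`hodgeClassSpan_pow_eq_divisorClassesSpan_of_forty`** and
  **`hodgeConjectureFor_pow_of_forty`** — `B•(Aⁿ) ⊗ ℂ = D•(Aⁿ) ⊗ ℂ` and the Hodge conjecture for ALL powers whenever `Φ` is not a primitive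
  coset-balanced type (`192` types: the `128` nondegenerate ones and the `64` imprimitive ones, which are induced from NONDEGENERATE types);
  **`exists_exceptional_four_of_cosetBalanced_forty`** (primitive, balanced for a maximal `(−1)`-free subgroup of order `8` ⟹ `A` simple,
  rational `(4,4)`-classes outside `D⁴(A) ⊗ ℂ`, `dim B⁴ − dim D⁴ ≥ 2`: Weil type `(4,4)` over an imaginary quadratic subfield),
  **`exists_exceptional_two_of_cosetBalanced_forty`** (balanced for a `(−1)`-free subgroup of order `4` ⟹ rational `(2,2)`-classes outside
  `D²(A) ⊗ ℂ`); the DICHOTOMY **`hodgeConjectureFor_pow_or_exceptional_forty`**; non-vacuity `exists_isSimple_exceptional_forty`.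
* §3 TORI with an endomorphism `u` of characteristic polynomial `Φ₄₀`: `mtRank_hodgeStructure_mem_forty`, `isSimple_iff_seven_le_mtRank_forty`,
  **`forall_divisorClasses_powPeriod_eq_hodgeClasses_iff_forty`** (`Hdg = Div` on ALL powers ⟺ (`X` simple → `rank MT(X) = 9`)),
  `exists_isSimple_mtRank_eq_forty` (simple abelian `8`-folds `ℂ⁸/Φ(𝔞)` with `u = ζ₄₀` of each primitive rank).

HONEST SCOPE.  For the `64` primitive coset-balanced types the Hodge conjecture for `A` itself (algebraicity of the Weil-type classes) is NOT
asserted; what is proved is `B⁴ ≠ D⁴` resp. `B² ≠ D²` and the failure of «`Hdg = Div` on all powers».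

## References

* [Gordon1999HodgeAVSurvey] B. B. Gordon, *A survey of the Hodge conjecture for abelian varieties* (1999), 5.13 (ii), Thm. 6.4, 7.5, 9.2.2, §9.3,
  §9.4.1 (Prop. 9.4.1, Kubota rank), §9.4.2 (Lenstra's `ℚ(ζ₃₂)` types), 9.4.3 (Theorem [B.140], Yanai).
* [GreenGriffithsKerr2012] M. Green, P. Griffiths, M. Kerr, *Mumford–Tate Groups and Domains* (2012), (V.A.6)(i), (V.A.7)–(V.A.8), (V.D.8).
* [Shimura1998] G. Shimura, *Abelian Varieties with Complex Multiplication and Modular Functions* (1998), §6.2 Thm. 3, §8.2 Prop. 26, §8.4.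
* [Kubota1965] T. Kubota, Trans. AMS 118 (1965), §2 p. 115, §4 Lemma 2.
* [KoblitzRohrlich1978] N. Koblitz, D. Rohrlich, Canad. J. Math. 30 (1978), §1 p. 1184 (`[L : K₁] = |W|`).
* [vanGeemen1994HodgeAV] B. van Geemen, LNM 1594 (1994), Thm. 4.5, 4.7.
* [Pohlmann1968] H. Pohlmann, Ann. of Math. 88 (1968), Thm. 1, §3.
* [MoonenZarhin1999LowDim] B. Moonen, Yu. Zarhin, Math. Ann. 315 (1999), §2 (2.7).
-/

noncomputable section

open scoped Classical nonZeroDivisors NumberField Manifold ContDiff MatrixGroups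
open NumberField Module Polynomial CategoryTheory CategoryTheory.Limits

namespace Literature.Geometry.Kaehler

namespace ComplexTorus

-- `open scoped`: the tree's action of `Aut(ℂ)` on `Hom(K, ℂ)` by composition (`ringEquivCompAction`) is a scoped instance
open scoped Literature.NumberTheory.ComplexMultiplication
open Literature.NumberTheory.Automorphic (IsTorusSubgroup)
open Literature.AlgebraicGeometry.Motives (CMType AbelianVariety HodgeTensorFacts hodgeTensorFacts_holds)
open Literature.AlgebraicGeometry.HodgeTheory (HodgeConjectureFor complexBetti IsRationalClass IsOfHodgeType)
open Literature.AlgebraicGeometry.VanGeemen1994 (hodgeClassSpan)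
open Literature.Barriers.HodgeConjecture (divisorClassesSpan)
open Literature.NumberTheory.ComplexMultiplication (IsPrimitive inducedCMType translateInd translateInd_of_mem translateInd_of_not_mem
  isPrimitive_iff_forall_eq exists_primitive_inducedCMType_eq_of_isCMField)
open Literature.NumberTheory.ComplexMultiplication.CMTypeLattice (periodIso basisIndex card_basisIndex_eq_finrank
  isSimple_periodIso_iff_isPrimitive isAbelianVariety_periodIso isIsogenous_powPeriod_periodIso_of_basis)
open Literature.AlgebraicGeometry.Pohlmann1968 (cmTypeRank cmTypeRank_le IsNondegenerate isNondegenerate_iff cmTypeRank_inducedCMType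
  isPretransitive_ringEquiv_complex)
open Literature.AlgebraicGeometry.Pohlmann1968.Cyclotomic (autExp expOf exists_autExp_eq exists_expOf_eq finrank_eq_totient
  not_isNondegenerate_of_cosetBalanced cmTypeRank_le_of_cosetBalanced cmTypeRank_add_le_of_cosetBalanced exists_exceptional_of_cosetBalanced
  two_le_finrank_hodgeClassSpan_sub_finrank_divisorClassesSpan_of_cosetBalanced cosetBalanced_of_isAutTransform)
open Literature.AlgebraicGeometry.ComplexMultiplication (IsCMTypeRealisation isSimple_iff_isPrimitive isPrimitive_ringEquiv_complex_iff
  isSimple_of_isCMTypeRealisation_of_isPrimitive finrank_eq_card_filter_of_primitive)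
open Literature.AlgebraicGeometry.ComplexMultiplication.CMTorus (mtRank_hodgeStructure_periodIso_eq_cmTypeRank)
open Literature.AlgebraicGeometry.ComplexMultiplication.CyclotomicCMTypeResidueSets (IsAutTransform IsAutTransform.symm IsAutTransform.refl
  unitResidues residueSet HasTrivialStabilizer allCMResidueSets expOf_smul expOf_mem_residueSet_iff IsAutTransform.isPrimitive_iff
  isPrimitive_iff_hasTrivialStabilizer coprime_iff_mem_unitResidues isCMResidueSet_residueSet card_filter_allCMResidueSets_eq
  ncard_setOf_eq_card_filter_powerset_half)
open Literature.AlgebraicGeometry.ComplexMultiplication.CyclotomicCMTypeCensusForty (isCMResidueSet_half_forty isCMResidueSet_reps_forty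
  hasTrivialStabilizer_reps_forty stabilizer_reps_forty subgroups_forty cosetBalanced_reps_forty not_cosetBalanced_reps_forty exists_isAutTransform_forty
  isPrimitive_of_not_cosetBalanced_forty card_stabilizer_of_not_isPrimitive_forty filter_stabilizer_eq_of_isAutTransform_forty residueSet_mem_forty
  exists_residueSet_eq_forty ncard_not_cosetBalanced_forty)

/-! ### §1 The ranks of the CM types of `ℚ(ζ₄₀)` -/

section Types

variable {K : Type} [Field K] [NumberField K]

variable [IsCyclotomicExtension {40} ℚ K]

variable (K) in
/-- `ℚ(ζ₄₀)` is a CM field (Mathlib). No instance is registered. [folklore] -/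
private theorem isCMField₈ : IsCMField K :=
  IsCyclotomicExtension.Rat.isCMField K (S := ({40} : Set ℕ)) ⟨40, rfl, by norm_num⟩

variable (K) in
/-- `[ℚ(ζ₄₀) : ℚ] = 16`. [folklore] -/
private theorem finrank_eq_sixteen₈ : finrank ℚ K = 16 := by
  rw [finrank_eq_totient 40 K]; decide +kernel

/-- The indicator of a translate of `Φ`, read on exponents. [cite: Shimura1998, §8.4 Example (1)] -/
private theorem translateInd_eq_ite₈ (Φ : CMType K) (τ : ℂ ≃+* ℂ) (σ : K →+* ℂ) :
    translateInd Φ.1 τ σ = if autExp 40 τ * expOf 40 K σ ∈ residueSet 40 Φ then (1 : ℚ) else 0 := by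
  have h : τ • σ ∈ Φ.1 ↔ autExp 40 τ * expOf 40 K σ ∈ residueSet 40 Φ := by
    rw [← expOf_mem_residueSet_iff 40 Φ, expOf_smul]
  by_cases hm : autExp 40 τ * expOf 40 K σ ∈ residueSet 40 Φ
  · rw [translateInd_of_mem (h.2 hm), if_pos hm]
  · rw [translateInd_of_not_mem (fun h' => hm (h.1 h')), if_neg hm]

/-- **`Rank(Φ) ≥ 9` for the type with residue set `{1, 3, 7, 9, 11, 13, 17, 21}`** (`N1`): the translates by the automorphisms of `ℂ` with cyclotomic characters
`1, 3, 7, 9, 11, 13, 17, 19, 21`, read at the embeddings with exponents `1, 3, 7, 9, 11, 13, 17, 19, 21`, are linearly independent (the `9 × 9` minor of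
`([u·c ∈ S])` has determinant `10`). [cite: Kubota1965, §2 (p. 115)] [cite: GreenGriffithsKerr2012, (V.A.7)–(V.A.8)] -/
private theorem nine_le_cmTypeRank_of_residueSet_eq_N1_forty (Φ : CMType K) (hΦ : residueSet 40 Φ = {1, 3, 7, 9, 11, 13, 17, 21}) :
    9 ≤ cmTypeRank Φ := by
  classical
  have hu : ∀ i : Fin 9, ((![1, 3, 7, 9, 11, 13, 17, 19, 21] : Fin 9 → ZMod 40) i).val.Coprime 40 := by decide
  have hc : ∀ j : Fin 9, ((![1, 3, 7, 9, 11, 13, 17, 19, 21] : Fin 9 → ZMod 40) j).val.Coprime 40 := by decide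
  choose τ hτ using fun i : Fin 9 => exists_autExp_eq 40 _ (hu i)
  choose σ hσ using fun j : Fin 9 => exists_expOf_eq 40 K _ (hc j)
  let f : Fin 9 → (K →+* ℂ) → ℚ := fun i => translateInd Φ.1 (τ i)
  have hval : ∀ i j : Fin 9, f i (σ j) =
      if (![1, 3, 7, 9, 11, 13, 17, 19, 21] : Fin 9 → ZMod 40) i * (![1, 3, 7, 9, 11, 13, 17, 19, 21] : Fin 9 → ZMod 40) j ∈
        ({1, 3, 7, 9, 11, 13, 17, 21} : Finset (ZMod 40)) then (1 : ℚ) else 0 := by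
    intro i j
    show translateInd Φ.1 (τ i) (σ j) = _
    rw [translateInd_eq_ite₈, hτ, hσ, hΦ]
  have hli : LinearIndependent ℚ f := by
    rw [Fintype.linearIndependent_iff]
    intro g hg
    have heval : ∀ j : Fin 9, ∑ i, g i * f i (σ j) = 0 := fun j => by
      have := congrFun hg (σ j)
      simpa only [Finset.sum_apply, Pi.smul_apply, smul_eq_mul, Pi.zero_apply] using this
    have e0 := heval 0
    have e1 := heval 1
    have e2 := heval 2
    have e3 := heval 3
    have e4 := heval 4
    have e5 := heval 5
    have e6 := heval 6
    have e7 := heval 7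
    have e8 := heval 8
    simp (config := { decide := true }) [Fin.sum_univ_succ, hval] at e0 e1 e2 e3 e4 e5 e6 e7 e8
    intro i
    fin_cases i <;> simp <;> linarith
  have h1 : Module.finrank ℚ (Submodule.span ℚ (Set.range f)) = 9 := by
    rw [finrank_span_eq_card hli, Fintype.card_fin]
  have h2 : Submodule.span ℚ (Set.range f) ≤
      Submodule.span ℚ (Set.range fun g : ℂ ≃+* ℂ => translateInd Φ.1 g) :=
    Submodule.span_mono (by rintro _ ⟨i, rfl⟩; exact ⟨τ i, rfl⟩)
  have h3 := Submodule.finrank_mono h2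
  rw [h1] at h3
  exact h3

/-- **`Rank(Φ) ≥ 9` for the type with residue set `{1, 3, 7, 9, 11, 13, 19, 23}`** (`N2`): the translates by the automorphisms of `ℂ` with cyclotomic characters
`1, 3, 7, 9, 11, 13, 17, 19, 21`, read at the embeddings with exponents `1, 3, 7, 9, 11, 13, 17, 19, 21`, are linearly independent (the `9 × 9` minor of
`([u·c ∈ S])` has determinant `-6`). [cite: Kubota1965, §2 (p. 115)] [cite: GreenGriffithsKerr2012, (V.A.7)–(V.A.8)] -/
private theorem nine_le_cmTypeRank_of_residueSet_eq_N2_forty (Φ : CMType K) (hΦ : residueSet 40 Φ = {1, 3, 7, 9, 11, 13, 19, 23}) :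
    9 ≤ cmTypeRank Φ := by
  classical
  have hu : ∀ i : Fin 9, ((![1, 3, 7, 9, 11, 13, 17, 19, 21] : Fin 9 → ZMod 40) i).val.Coprime 40 := by decide
  have hc : ∀ j : Fin 9, ((![1, 3, 7, 9, 11, 13, 17, 19, 21] : Fin 9 → ZMod 40) j).val.Coprime 40 := by decide
  choose τ hτ using fun i : Fin 9 => exists_autExp_eq 40 _ (hu i)
  choose σ hσ using fun j : Fin 9 => exists_expOf_eq 40 K _ (hc j)
  let f : Fin 9 → (K →+* ℂ) → ℚ := fun i => translateInd Φ.1 (τ i)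
  have hval : ∀ i j : Fin 9, f i (σ j) =
      if (![1, 3, 7, 9, 11, 13, 17, 19, 21] : Fin 9 → ZMod 40) i * (![1, 3, 7, 9, 11, 13, 17, 19, 21] : Fin 9 → ZMod 40) j ∈
        ({1, 3, 7, 9, 11, 13, 19, 23} : Finset (ZMod 40)) then (1 : ℚ) else 0 := by
    intro i j
    show translateInd Φ.1 (τ i) (σ j) = _
    rw [translateInd_eq_ite₈, hτ, hσ, hΦ]
  have hli : LinearIndependent ℚ f := by
    rw [Fintype.linearIndependent_iff]
    intro g hg
    have heval : ∀ j : Fin 9, ∑ i, g i * f i (σ j) = 0 := fun j => by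
      have := congrFun hg (σ j)
      simpa only [Finset.sum_apply, Pi.smul_apply, smul_eq_mul, Pi.zero_apply] using this
    have e0 := heval 0
    have e1 := heval 1
    have e2 := heval 2
    have e3 := heval 3
    have e4 := heval 4
    have e5 := heval 5
    have e6 := heval 6
    have e7 := heval 7
    have e8 := heval 8
    simp (config := { decide := true }) [Fin.sum_univ_succ, hval] at e0 e1 e2 e3 e4 e5 e6 e7 e8
    intro i
    fin_cases i <;> simp <;> linarith
  have h1 : Module.finrank ℚ (Submodule.span ℚ (Set.range f)) = 9 := by
    rw [finrank_span_eq_card hli, Fintype.card_fin]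
  have h2 : Submodule.span ℚ (Set.range f) ≤
      Submodule.span ℚ (Set.range fun g : ℂ ≃+* ℂ => translateInd Φ.1 g) :=
    Submodule.span_mono (by rintro _ ⟨i, rfl⟩; exact ⟨τ i, rfl⟩)
  have h3 := Submodule.finrank_mono h2
  rw [h1] at h3
  exact h3

/-- **`Rank(Φ) ≥ 9` for the type with residue set `{1, 3, 7, 9, 11, 17, 19, 27}`** (`N3`): the translates by the automorphisms of `ℂ` with cyclotomic characters
`1, 3, 7, 9, 11, 13, 17, 19, 21`, read at the embeddings with exponents `1, 3, 7, 9, 11, 13, 17, 19, 21`, are linearly independent (the `9 × 9` minor of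
`([u·c ∈ S])` has determinant `-6`). [cite: Kubota1965, §2 (p. 115)] [cite: GreenGriffithsKerr2012, (V.A.7)–(V.A.8)] -/
private theorem nine_le_cmTypeRank_of_residueSet_eq_N3_forty (Φ : CMType K) (hΦ : residueSet 40 Φ = {1, 3, 7, 9, 11, 17, 19, 27}) :
    9 ≤ cmTypeRank Φ := by
  classical
  have hu : ∀ i : Fin 9, ((![1, 3, 7, 9, 11, 13, 17, 19, 21] : Fin 9 → ZMod 40) i).val.Coprime 40 := by decide
  have hc : ∀ j : Fin 9, ((![1, 3, 7, 9, 11, 13, 17, 19, 21] : Fin 9 → ZMod 40) j).val.Coprime 40 := by decide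
  choose τ hτ using fun i : Fin 9 => exists_autExp_eq 40 _ (hu i)
  choose σ hσ using fun j : Fin 9 => exists_expOf_eq 40 K _ (hc j)
  let f : Fin 9 → (K →+* ℂ) → ℚ := fun i => translateInd Φ.1 (τ i)
  have hval : ∀ i j : Fin 9, f i (σ j) =
      if (![1, 3, 7, 9, 11, 13, 17, 19, 21] : Fin 9 → ZMod 40) i * (![1, 3, 7, 9, 11, 13, 17, 19, 21] : Fin 9 → ZMod 40) j ∈
        ({1, 3, 7, 9, 11, 17, 19, 27} : Finset (ZMod 40)) then (1 : ℚ) else 0 := by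
    intro i j
    show translateInd Φ.1 (τ i) (σ j) = _
    rw [translateInd_eq_ite₈, hτ, hσ, hΦ]
  have hli : LinearIndependent ℚ f := by
    rw [Fintype.linearIndependent_iff]
    intro g hg
    have heval : ∀ j : Fin 9, ∑ i, g i * f i (σ j) = 0 := fun j => by
      have := congrFun hg (σ j)
      simpa only [Finset.sum_apply, Pi.smul_apply, smul_eq_mul, Pi.zero_apply] using this
    have e0 := heval 0
    have e1 := heval 1
    have e2 := heval 2
    have e3 := heval 3
    have e4 := heval 4
    have e5 := heval 5
    have e6 := heval 6
    have e7 := heval 7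
    have e8 := heval 8
    simp (config := { decide := true }) [Fin.sum_univ_succ, hval] at e0 e1 e2 e3 e4 e5 e6 e7 e8
    intro i
    fin_cases i <;> simp <;> linarith
  have h1 : Module.finrank ℚ (Submodule.span ℚ (Set.range f)) = 9 := by
    rw [finrank_span_eq_card hli, Fintype.card_fin]
  have h2 : Submodule.span ℚ (Set.range f) ≤
      Submodule.span ℚ (Set.range fun g : ℂ ≃+* ℂ => translateInd Φ.1 g) :=
    Submodule.span_mono (by rintro _ ⟨i, rfl⟩; exact ⟨τ i, rfl⟩)
  have h3 := Submodule.finrank_mono h2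
  rw [h1] at h3
  exact h3

/-- **`Rank(Φ) ≥ 9` for the type with residue set `{1, 3, 7, 9, 11, 21, 23, 27}`** (`N4`): the translates by the automorphisms of `ℂ` with cyclotomic characters
`1, 3, 7, 9, 11, 13, 17, 19, 21`, read at the embeddings with exponents `1, 3, 7, 9, 11, 13, 17, 19, 21`, are linearly independent (the `9 × 9` minor of
`([u·c ∈ S])` has determinant `-6`). [cite: Kubota1965, §2 (p. 115)] [cite: GreenGriffithsKerr2012, (V.A.7)–(V.A.8)] -/
private theorem nine_le_cmTypeRank_of_residueSet_eq_N4_forty (Φ : CMType K) (hΦ : residueSet 40 Φ = {1, 3, 7, 9, 11, 21, 23, 27}) :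
    9 ≤ cmTypeRank Φ := by
  classical
  have hu : ∀ i : Fin 9, ((![1, 3, 7, 9, 11, 13, 17, 19, 21] : Fin 9 → ZMod 40) i).val.Coprime 40 := by decide
  have hc : ∀ j : Fin 9, ((![1, 3, 7, 9, 11, 13, 17, 19, 21] : Fin 9 → ZMod 40) j).val.Coprime 40 := by decide
  choose τ hτ using fun i : Fin 9 => exists_autExp_eq 40 _ (hu i)
  choose σ hσ using fun j : Fin 9 => exists_expOf_eq 40 K _ (hc j)
  let f : Fin 9 → (K →+* ℂ) → ℚ := fun i => translateInd Φ.1 (τ i)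
  have hval : ∀ i j : Fin 9, f i (σ j) =
      if (![1, 3, 7, 9, 11, 13, 17, 19, 21] : Fin 9 → ZMod 40) i * (![1, 3, 7, 9, 11, 13, 17, 19, 21] : Fin 9 → ZMod 40) j ∈
        ({1, 3, 7, 9, 11, 21, 23, 27} : Finset (ZMod 40)) then (1 : ℚ) else 0 := by
    intro i j
    show translateInd Φ.1 (τ i) (σ j) = _
    rw [translateInd_eq_ite₈, hτ, hσ, hΦ]
  have hli : LinearIndependent ℚ f := by
    rw [Fintype.linearIndependent_iff]
    intro g hg
    have heval : ∀ j : Fin 9, ∑ i, g i * f i (σ j) = 0 := fun j => by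
      have := congrFun hg (σ j)
      simpa only [Finset.sum_apply, Pi.smul_apply, smul_eq_mul, Pi.zero_apply] using this
    have e0 := heval 0
    have e1 := heval 1
    have e2 := heval 2
    have e3 := heval 3
    have e4 := heval 4
    have e5 := heval 5
    have e6 := heval 6
    have e7 := heval 7
    have e8 := heval 8
    simp (config := { decide := true }) [Fin.sum_univ_succ, hval] at e0 e1 e2 e3 e4 e5 e6 e7 e8
    intro i
    fin_cases i <;> simp <;> linarith
  have h1 : Module.finrank ℚ (Submodule.span ℚ (Set.range f)) = 9 := by
    rw [finrank_span_eq_card hli, Fintype.card_fin]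
  have h2 : Submodule.span ℚ (Set.range f) ≤
      Submodule.span ℚ (Set.range fun g : ℂ ≃+* ℂ => translateInd Φ.1 g) :=
    Submodule.span_mono (by rintro _ ⟨i, rfl⟩; exact ⟨τ i, rfl⟩)
  have h3 := Submodule.finrank_mono h2
  rw [h1] at h3
  exact h3

/-- **`Rank(Φ) ≥ 9` for the type with residue set `{1, 3, 7, 9, 13, 17, 19, 29}`** (`N5`): the translates by the automorphisms of `ℂ` with cyclotomic characters
`1, 3, 7, 9, 11, 13, 17, 19, 21`, read at the embeddings with exponents `1, 3, 7, 9, 11, 13, 17, 19, 21`, are linearly independent (the `9 × 9` minor of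
`([u·c ∈ S])` has determinant `10`). [cite: Kubota1965, §2 (p. 115)] [cite: GreenGriffithsKerr2012, (V.A.7)–(V.A.8)] -/
private theorem nine_le_cmTypeRank_of_residueSet_eq_N5_forty (Φ : CMType K) (hΦ : residueSet 40 Φ = {1, 3, 7, 9, 13, 17, 19, 29}) :
    9 ≤ cmTypeRank Φ := by
  classical
  have hu : ∀ i : Fin 9, ((![1, 3, 7, 9, 11, 13, 17, 19, 21] : Fin 9 → ZMod 40) i).val.Coprime 40 := by decide
  have hc : ∀ j : Fin 9, ((![1, 3, 7, 9, 11, 13, 17, 19, 21] : Fin 9 → ZMod 40) j).val.Coprime 40 := by decide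
  choose τ hτ using fun i : Fin 9 => exists_autExp_eq 40 _ (hu i)
  choose σ hσ using fun j : Fin 9 => exists_expOf_eq 40 K _ (hc j)
  let f : Fin 9 → (K →+* ℂ) → ℚ := fun i => translateInd Φ.1 (τ i)
  have hval : ∀ i j : Fin 9, f i (σ j) =
      if (![1, 3, 7, 9, 11, 13, 17, 19, 21] : Fin 9 → ZMod 40) i * (![1, 3, 7, 9, 11, 13, 17, 19, 21] : Fin 9 → ZMod 40) j ∈
        ({1, 3, 7, 9, 13, 17, 19, 29} : Finset (ZMod 40)) then (1 : ℚ) else 0 := by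
    intro i j
    show translateInd Φ.1 (τ i) (σ j) = _
    rw [translateInd_eq_ite₈, hτ, hσ, hΦ]
  have hli : LinearIndependent ℚ f := by
    rw [Fintype.linearIndependent_iff]
    intro g hg
    have heval : ∀ j : Fin 9, ∑ i, g i * f i (σ j) = 0 := fun j => by
      have := congrFun hg (σ j)
      simpa only [Finset.sum_apply, Pi.smul_apply, smul_eq_mul, Pi.zero_apply] using this
    have e0 := heval 0
    have e1 := heval 1
    have e2 := heval 2
    have e3 := heval 3
    have e4 := heval 4
    have e5 := heval 5
    have e6 := heval 6
    have e7 := heval 7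
    have e8 := heval 8
    simp (config := { decide := true }) [Fin.sum_univ_succ, hval] at e0 e1 e2 e3 e4 e5 e6 e7 e8
    intro i
    fin_cases i <;> simp <;> linarith
  have h1 : Module.finrank ℚ (Submodule.span ℚ (Set.range f)) = 9 := by
    rw [finrank_span_eq_card hli, Fintype.card_fin]
  have h2 : Submodule.span ℚ (Set.range f) ≤
      Submodule.span ℚ (Set.range fun g : ℂ ≃+* ℂ => translateInd Φ.1 g) :=
    Submodule.span_mono (by rintro _ ⟨i, rfl⟩; exact ⟨τ i, rfl⟩)
  have h3 := Submodule.finrank_mono h2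
  rw [h1] at h3
  exact h3

/-- **`Rank(Φ) ≥ 9` for the type with residue set `{1, 3, 7, 11, 13, 21, 23, 31}`** (`N6`): the translates by the automorphisms of `ℂ` with cyclotomic characters
`1, 3, 7, 9, 11, 13, 17, 19, 21`, read at the embeddings with exponents `1, 3, 7, 9, 11, 13, 17, 19, 21`, are linearly independent (the `9 × 9` minor of
`([u·c ∈ S])` has determinant `10`). [cite: Kubota1965, §2 (p. 115)] [cite: GreenGriffithsKerr2012, (V.A.7)–(V.A.8)] -/
private theorem nine_le_cmTypeRank_of_residueSet_eq_N6_forty (Φ : CMType K) (hΦ : residueSet 40 Φ = {1, 3, 7, 11, 13, 21, 23, 31}) :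
    9 ≤ cmTypeRank Φ := by
  classical
  have hu : ∀ i : Fin 9, ((![1, 3, 7, 9, 11, 13, 17, 19, 21] : Fin 9 → ZMod 40) i).val.Coprime 40 := by decide
  have hc : ∀ j : Fin 9, ((![1, 3, 7, 9, 11, 13, 17, 19, 21] : Fin 9 → ZMod 40) j).val.Coprime 40 := by decide
  choose τ hτ using fun i : Fin 9 => exists_autExp_eq 40 _ (hu i)
  choose σ hσ using fun j : Fin 9 => exists_expOf_eq 40 K _ (hc j)
  let f : Fin 9 → (K →+* ℂ) → ℚ := fun i => translateInd Φ.1 (τ i)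
  have hval : ∀ i j : Fin 9, f i (σ j) =
      if (![1, 3, 7, 9, 11, 13, 17, 19, 21] : Fin 9 → ZMod 40) i * (![1, 3, 7, 9, 11, 13, 17, 19, 21] : Fin 9 → ZMod 40) j ∈
        ({1, 3, 7, 11, 13, 21, 23, 31} : Finset (ZMod 40)) then (1 : ℚ) else 0 := by
    intro i j
    show translateInd Φ.1 (τ i) (σ j) = _
    rw [translateInd_eq_ite₈, hτ, hσ, hΦ]
  have hli : LinearIndependent ℚ f := by
    rw [Fintype.linearIndependent_iff]
    intro g hg
    have heval : ∀ j : Fin 9, ∑ i, g i * f i (σ j) = 0 := fun j => by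
      have := congrFun hg (σ j)
      simpa only [Finset.sum_apply, Pi.smul_apply, smul_eq_mul, Pi.zero_apply] using this
    have e0 := heval 0
    have e1 := heval 1
    have e2 := heval 2
    have e3 := heval 3
    have e4 := heval 4
    have e5 := heval 5
    have e6 := heval 6
    have e7 := heval 7
    have e8 := heval 8
    simp (config := { decide := true }) [Fin.sum_univ_succ, hval] at e0 e1 e2 e3 e4 e5 e6 e7 e8
    intro i
    fin_cases i <;> simp <;> linarith
  have h1 : Module.finrank ℚ (Submodule.span ℚ (Set.range f)) = 9 := by
    rw [finrank_span_eq_card hli, Fintype.card_fin]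
  have h2 : Submodule.span ℚ (Set.range f) ≤
      Submodule.span ℚ (Set.range fun g : ℂ ≃+* ℂ => translateInd Φ.1 g) :=
    Submodule.span_mono (by rintro _ ⟨i, rfl⟩; exact ⟨τ i, rfl⟩)
  have h3 := Submodule.finrank_mono h2
  rw [h1] at h3
  exact h3

/-- **`Rank(Φ) ≥ 9` for the type with residue set `{1, 3, 7, 11, 17, 21, 27, 31}`** (`N7`): the translates by the automorphisms of `ℂ` with cyclotomic characters
`1, 3, 7, 9, 11, 13, 17, 19, 21`, read at the embeddings with exponents `1, 3, 7, 9, 11, 13, 17, 19, 21`, are linearly independent (the `9 × 9` minor of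
`([u·c ∈ S])` has determinant `10`). [cite: Kubota1965, §2 (p. 115)] [cite: GreenGriffithsKerr2012, (V.A.7)–(V.A.8)] -/
private theorem nine_le_cmTypeRank_of_residueSet_eq_N7_forty (Φ : CMType K) (hΦ : residueSet 40 Φ = {1, 3, 7, 11, 17, 21, 27, 31}) :
    9 ≤ cmTypeRank Φ := by
  classical
  have hu : ∀ i : Fin 9, ((![1, 3, 7, 9, 11, 13, 17, 19, 21] : Fin 9 → ZMod 40) i).val.Coprime 40 := by decide
  have hc : ∀ j : Fin 9, ((![1, 3, 7, 9, 11, 13, 17, 19, 21] : Fin 9 → ZMod 40) j).val.Coprime 40 := by decide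
  choose τ hτ using fun i : Fin 9 => exists_autExp_eq 40 _ (hu i)
  choose σ hσ using fun j : Fin 9 => exists_expOf_eq 40 K _ (hc j)
  let f : Fin 9 → (K →+* ℂ) → ℚ := fun i => translateInd Φ.1 (τ i)
  have hval : ∀ i j : Fin 9, f i (σ j) =
      if (![1, 3, 7, 9, 11, 13, 17, 19, 21] : Fin 9 → ZMod 40) i * (![1, 3, 7, 9, 11, 13, 17, 19, 21] : Fin 9 → ZMod 40) j ∈
        ({1, 3, 7, 11, 17, 21, 27, 31} : Finset (ZMod 40)) then (1 : ℚ) else 0 := by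
    intro i j
    show translateInd Φ.1 (τ i) (σ j) = _
    rw [translateInd_eq_ite₈, hτ, hσ, hΦ]
  have hli : LinearIndependent ℚ f := by
    rw [Fintype.linearIndependent_iff]
    intro g hg
    have heval : ∀ j : Fin 9, ∑ i, g i * f i (σ j) = 0 := fun j => by
      have := congrFun hg (σ j)
      simpa only [Finset.sum_apply, Pi.smul_apply, smul_eq_mul, Pi.zero_apply] using this
    have e0 := heval 0
    have e1 := heval 1
    have e2 := heval 2
    have e3 := heval 3
    have e4 := heval 4
    have e5 := heval 5
    have e6 := heval 6
    have e7 := heval 7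
    have e8 := heval 8
    simp (config := { decide := true }) [Fin.sum_univ_succ, hval] at e0 e1 e2 e3 e4 e5 e6 e7 e8
    intro i
    fin_cases i <;> simp <;> linarith
  have h1 : Module.finrank ℚ (Submodule.span ℚ (Set.range f)) = 9 := by
    rw [finrank_span_eq_card hli, Fintype.card_fin]
  have h2 : Submodule.span ℚ (Set.range f) ≤
      Submodule.span ℚ (Set.range fun g : ℂ ≃+* ℂ => translateInd Φ.1 g) :=
    Submodule.span_mono (by rintro _ ⟨i, rfl⟩; exact ⟨τ i, rfl⟩)
  have h3 := Submodule.finrank_mono h2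
  rw [h1] at h3
  exact h3

/-- **`Rank(Φ) ≥ 9` for the type with residue set `{1, 3, 7, 11, 19, 23, 27, 31}`** (`N8`): the translates by the automorphisms of `ℂ` with cyclotomic characters
`1, 3, 7, 9, 11, 13, 17, 19, 21`, read at the embeddings with exponents `1, 3, 7, 9, 11, 13, 17, 19, 21`, are linearly independent (the `9 × 9` minor of
`([u·c ∈ S])` has determinant `-6`). [cite: Kubota1965, §2 (p. 115)] [cite: GreenGriffithsKerr2012, (V.A.7)–(V.A.8)] -/
private theorem nine_le_cmTypeRank_of_residueSet_eq_N8_forty (Φ : CMType K) (hΦ : residueSet 40 Φ = {1, 3, 7, 11, 19, 23, 27, 31}) :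
    9 ≤ cmTypeRank Φ := by
  classical
  have hu : ∀ i : Fin 9, ((![1, 3, 7, 9, 11, 13, 17, 19, 21] : Fin 9 → ZMod 40) i).val.Coprime 40 := by decide
  have hc : ∀ j : Fin 9, ((![1, 3, 7, 9, 11, 13, 17, 19, 21] : Fin 9 → ZMod 40) j).val.Coprime 40 := by decide
  choose τ hτ using fun i : Fin 9 => exists_autExp_eq 40 _ (hu i)
  choose σ hσ using fun j : Fin 9 => exists_expOf_eq 40 K _ (hc j)
  let f : Fin 9 → (K →+* ℂ) → ℚ := fun i => translateInd Φ.1 (τ i)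
  have hval : ∀ i j : Fin 9, f i (σ j) =
      if (![1, 3, 7, 9, 11, 13, 17, 19, 21] : Fin 9 → ZMod 40) i * (![1, 3, 7, 9, 11, 13, 17, 19, 21] : Fin 9 → ZMod 40) j ∈
        ({1, 3, 7, 11, 19, 23, 27, 31} : Finset (ZMod 40)) then (1 : ℚ) else 0 := by
    intro i j
    show translateInd Φ.1 (τ i) (σ j) = _
    rw [translateInd_eq_ite₈, hτ, hσ, hΦ]
  have hli : LinearIndependent ℚ f := by
    rw [Fintype.linearIndependent_iff]
    intro g hg
    have heval : ∀ j : Fin 9, ∑ i, g i * f i (σ j) = 0 := fun j => by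
      have := congrFun hg (σ j)
      simpa only [Finset.sum_apply, Pi.smul_apply, smul_eq_mul, Pi.zero_apply] using this
    have e0 := heval 0
    have e1 := heval 1
    have e2 := heval 2
    have e3 := heval 3
    have e4 := heval 4
    have e5 := heval 5
    have e6 := heval 6
    have e7 := heval 7
    have e8 := heval 8
    simp (config := { decide := true }) [Fin.sum_univ_succ, hval] at e0 e1 e2 e3 e4 e5 e6 e7 e8
    intro i
    fin_cases i <;> simp <;> linarith
  have h1 : Module.finrank ℚ (Submodule.span ℚ (Set.range f)) = 9 := by
    rw [finrank_span_eq_card hli, Fintype.card_fin]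
  have h2 : Submodule.span ℚ (Set.range f) ≤
      Submodule.span ℚ (Set.range fun g : ℂ ≃+* ℂ => translateInd Φ.1 g) :=
    Submodule.span_mono (by rintro _ ⟨i, rfl⟩; exact ⟨τ i, rfl⟩)
  have h3 := Submodule.finrank_mono h2
  rw [h1] at h3
  exact h3

/-- **`Rank(Φ) ≥ 7` for the type with residue set `{1, 3, 7, 9, 11, 13, 21, 23}`** (`D1`): the translates by the automorphisms of `ℂ` with cyclotomic characters
`1, 3, 7, 9, 11, 13, 17`, read at the embeddings with exponents `1, 3, 7, 9, 11, 13, 17`, are linearly independent (the `7 × 7` minor of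
`([u·c ∈ S])` has determinant `2`). [cite: Kubota1965, §2 (p. 115)] [cite: GreenGriffithsKerr2012, (V.A.7)–(V.A.8)] -/
private theorem seven_le_cmTypeRank_of_residueSet_eq_D1_forty (Φ : CMType K) (hΦ : residueSet 40 Φ = {1, 3, 7, 9, 11, 13, 21, 23}) :
    7 ≤ cmTypeRank Φ := by
  classical
  have hu : ∀ i : Fin 7, ((![1, 3, 7, 9, 11, 13, 17] : Fin 7 → ZMod 40) i).val.Coprime 40 := by decide
  have hc : ∀ j : Fin 7, ((![1, 3, 7, 9, 11, 13, 17] : Fin 7 → ZMod 40) j).val.Coprime 40 := by decide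
  choose τ hτ using fun i : Fin 7 => exists_autExp_eq 40 _ (hu i)
  choose σ hσ using fun j : Fin 7 => exists_expOf_eq 40 K _ (hc j)
  let f : Fin 7 → (K →+* ℂ) → ℚ := fun i => translateInd Φ.1 (τ i)
  have hval : ∀ i j : Fin 7, f i (σ j) =
      if (![1, 3, 7, 9, 11, 13, 17] : Fin 7 → ZMod 40) i * (![1, 3, 7, 9, 11, 13, 17] : Fin 7 → ZMod 40) j ∈
        ({1, 3, 7, 9, 11, 13, 21, 23} : Finset (ZMod 40)) then (1 : ℚ) else 0 := by
    intro i j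
    show translateInd Φ.1 (τ i) (σ j) = _
    rw [translateInd_eq_ite₈, hτ, hσ, hΦ]
  have hli : LinearIndependent ℚ f := by
    rw [Fintype.linearIndependent_iff]
    intro g hg
    have heval : ∀ j : Fin 7, ∑ i, g i * f i (σ j) = 0 := fun j => by
      have := congrFun hg (σ j)
      simpa only [Finset.sum_apply, Pi.smul_apply, smul_eq_mul, Pi.zero_apply] using this
    have e0 := heval 0
    have e1 := heval 1
    have e2 := heval 2
    have e3 := heval 3
    have e4 := heval 4
    have e5 := heval 5
    have e6 := heval 6
    simp (config := { decide := true }) [Fin.sum_univ_succ, hval] at e0 e1 e2 e3 e4 e5 e6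
    intro i
    fin_cases i <;> simp <;> linarith
  have h1 : Module.finrank ℚ (Submodule.span ℚ (Set.range f)) = 7 := by
    rw [finrank_span_eq_card hli, Fintype.card_fin]
  have h2 : Submodule.span ℚ (Set.range f) ≤
      Submodule.span ℚ (Set.range fun g : ℂ ≃+* ℂ => translateInd Φ.1 g) :=
    Submodule.span_mono (by rintro _ ⟨i, rfl⟩; exact ⟨τ i, rfl⟩)
  have h3 := Submodule.finrank_mono h2
  rw [h1] at h3
  exact h3

/-- **`Rank(Φ) ≥ 7` for the type with residue set `{1, 3, 7, 9, 11, 17, 21, 27}`** (`D2`): the translates by the automorphisms of `ℂ` with cyclotomic characters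
`1, 3, 7, 9, 11, 13, 17`, read at the embeddings with exponents `1, 3, 7, 9, 11, 13, 17`, are linearly independent (the `7 × 7` minor of
`([u·c ∈ S])` has determinant `2`). [cite: Kubota1965, §2 (p. 115)] [cite: GreenGriffithsKerr2012, (V.A.7)–(V.A.8)] -/
private theorem seven_le_cmTypeRank_of_residueSet_eq_D2_forty (Φ : CMType K) (hΦ : residueSet 40 Φ = {1, 3, 7, 9, 11, 17, 21, 27}) :
    7 ≤ cmTypeRank Φ := by
  classical
  have hu : ∀ i : Fin 7, ((![1, 3, 7, 9, 11, 13, 17] : Fin 7 → ZMod 40) i).val.Coprime 40 := by decide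
  have hc : ∀ j : Fin 7, ((![1, 3, 7, 9, 11, 13, 17] : Fin 7 → ZMod 40) j).val.Coprime 40 := by decide
  choose τ hτ using fun i : Fin 7 => exists_autExp_eq 40 _ (hu i)
  choose σ hσ using fun j : Fin 7 => exists_expOf_eq 40 K _ (hc j)
  let f : Fin 7 → (K →+* ℂ) → ℚ := fun i => translateInd Φ.1 (τ i)
  have hval : ∀ i j : Fin 7, f i (σ j) =
      if (![1, 3, 7, 9, 11, 13, 17] : Fin 7 → ZMod 40) i * (![1, 3, 7, 9, 11, 13, 17] : Fin 7 → ZMod 40) j ∈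
        ({1, 3, 7, 9, 11, 17, 21, 27} : Finset (ZMod 40)) then (1 : ℚ) else 0 := by
    intro i j
    show translateInd Φ.1 (τ i) (σ j) = _
    rw [translateInd_eq_ite₈, hτ, hσ, hΦ]
  have hli : LinearIndependent ℚ f := by
    rw [Fintype.linearIndependent_iff]
    intro g hg
    have heval : ∀ j : Fin 7, ∑ i, g i * f i (σ j) = 0 := fun j => by
      have := congrFun hg (σ j)
      simpa only [Finset.sum_apply, Pi.smul_apply, smul_eq_mul, Pi.zero_apply] using this
    have e0 := heval 0
    have e1 := heval 1
    have e2 := heval 2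
    have e3 := heval 3
    have e4 := heval 4
    have e5 := heval 5
    have e6 := heval 6
    simp (config := { decide := true }) [Fin.sum_univ_succ, hval] at e0 e1 e2 e3 e4 e5 e6
    intro i
    fin_cases i <;> simp <;> linarith
  have h1 : Module.finrank ℚ (Submodule.span ℚ (Set.range f)) = 7 := by
    rw [finrank_span_eq_card hli, Fintype.card_fin]
  have h2 : Submodule.span ℚ (Set.range f) ≤
      Submodule.span ℚ (Set.range fun g : ℂ ≃+* ℂ => translateInd Φ.1 g) :=
    Submodule.span_mono (by rintro _ ⟨i, rfl⟩; exact ⟨τ i, rfl⟩)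
  have h3 := Submodule.finrank_mono h2
  rw [h1] at h3
  exact h3

/-- **`Rank(Φ) ≥ 7` for the type with residue set `{1, 3, 7, 11, 13, 19, 23, 31}`** (`D3`): the translates by the automorphisms of `ℂ` with cyclotomic characters
`1, 3, 7, 9, 11, 13, 17`, read at the embeddings with exponents `1, 3, 7, 9, 11, 13, 17`, are linearly independent (the `7 × 7` minor of
`([u·c ∈ S])` has determinant `-2`). [cite: Kubota1965, §2 (p. 115)] [cite: GreenGriffithsKerr2012, (V.A.7)–(V.A.8)] -/
private theorem seven_le_cmTypeRank_of_residueSet_eq_D3_forty (Φ : CMType K) (hΦ : residueSet 40 Φ = {1, 3, 7, 11, 13, 19, 23, 31}) :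
    7 ≤ cmTypeRank Φ := by
  classical
  have hu : ∀ i : Fin 7, ((![1, 3, 7, 9, 11, 13, 17] : Fin 7 → ZMod 40) i).val.Coprime 40 := by decide
  have hc : ∀ j : Fin 7, ((![1, 3, 7, 9, 11, 13, 17] : Fin 7 → ZMod 40) j).val.Coprime 40 := by decide
  choose τ hτ using fun i : Fin 7 => exists_autExp_eq 40 _ (hu i)
  choose σ hσ using fun j : Fin 7 => exists_expOf_eq 40 K _ (hc j)
  let f : Fin 7 → (K →+* ℂ) → ℚ := fun i => translateInd Φ.1 (τ i)
  have hval : ∀ i j : Fin 7, f i (σ j) =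
      if (![1, 3, 7, 9, 11, 13, 17] : Fin 7 → ZMod 40) i * (![1, 3, 7, 9, 11, 13, 17] : Fin 7 → ZMod 40) j ∈
        ({1, 3, 7, 11, 13, 19, 23, 31} : Finset (ZMod 40)) then (1 : ℚ) else 0 := by
    intro i j
    show translateInd Φ.1 (τ i) (σ j) = _
    rw [translateInd_eq_ite₈, hτ, hσ, hΦ]
  have hli : LinearIndependent ℚ f := by
    rw [Fintype.linearIndependent_iff]
    intro g hg
    have heval : ∀ j : Fin 7, ∑ i, g i * f i (σ j) = 0 := fun j => by
      have := congrFun hg (σ j)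
      simpa only [Finset.sum_apply, Pi.smul_apply, smul_eq_mul, Pi.zero_apply] using this
    have e0 := heval 0
    have e1 := heval 1
    have e2 := heval 2
    have e3 := heval 3
    have e4 := heval 4
    have e5 := heval 5
    have e6 := heval 6
    simp (config := { decide := true }) [Fin.sum_univ_succ, hval] at e0 e1 e2 e3 e4 e5 e6
    intro i
    fin_cases i <;> simp <;> linarith
  have h1 : Module.finrank ℚ (Submodule.span ℚ (Set.range f)) = 7 := by
    rw [finrank_span_eq_card hli, Fintype.card_fin]
  have h2 : Submodule.span ℚ (Set.range f) ≤
      Submodule.span ℚ (Set.range fun g : ℂ ≃+* ℂ => translateInd Φ.1 g) :=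
    Submodule.span_mono (by rintro _ ⟨i, rfl⟩; exact ⟨τ i, rfl⟩)
  have h3 := Submodule.finrank_mono h2
  rw [h1] at h3
  exact h3

/-- **`Rank(Φ) ≥ 7` for the type with residue set `{1, 3, 7, 11, 17, 19, 27, 31}`** (`D4`): the translates by the automorphisms of `ℂ` with cyclotomic characters
`1, 3, 7, 9, 11, 13, 17`, read at the embeddings with exponents `1, 3, 7, 9, 11, 13, 17`, are linearly independent (the `7 × 7` minor of
`([u·c ∈ S])` has determinant `-2`). [cite: Kubota1965, §2 (p. 115)] [cite: GreenGriffithsKerr2012, (V.A.7)–(V.A.8)] -/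
private theorem seven_le_cmTypeRank_of_residueSet_eq_D4_forty (Φ : CMType K) (hΦ : residueSet 40 Φ = {1, 3, 7, 11, 17, 19, 27, 31}) :
    7 ≤ cmTypeRank Φ := by
  classical
  have hu : ∀ i : Fin 7, ((![1, 3, 7, 9, 11, 13, 17] : Fin 7 → ZMod 40) i).val.Coprime 40 := by decide
  have hc : ∀ j : Fin 7, ((![1, 3, 7, 9, 11, 13, 17] : Fin 7 → ZMod 40) j).val.Coprime 40 := by decide
  choose τ hτ using fun i : Fin 7 => exists_autExp_eq 40 _ (hu i)
  choose σ hσ using fun j : Fin 7 => exists_expOf_eq 40 K _ (hc j)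
  let f : Fin 7 → (K →+* ℂ) → ℚ := fun i => translateInd Φ.1 (τ i)
  have hval : ∀ i j : Fin 7, f i (σ j) =
      if (![1, 3, 7, 9, 11, 13, 17] : Fin 7 → ZMod 40) i * (![1, 3, 7, 9, 11, 13, 17] : Fin 7 → ZMod 40) j ∈
        ({1, 3, 7, 11, 17, 19, 27, 31} : Finset (ZMod 40)) then (1 : ℚ) else 0 := by
    intro i j
    show translateInd Φ.1 (τ i) (σ j) = _
    rw [translateInd_eq_ite₈, hτ, hσ, hΦ]
  have hli : LinearIndependent ℚ f := by
    rw [Fintype.linearIndependent_iff]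
    intro g hg
    have heval : ∀ j : Fin 7, ∑ i, g i * f i (σ j) = 0 := fun j => by
      have := congrFun hg (σ j)
      simpa only [Finset.sum_apply, Pi.smul_apply, smul_eq_mul, Pi.zero_apply] using this
    have e0 := heval 0
    have e1 := heval 1
    have e2 := heval 2
    have e3 := heval 3
    have e4 := heval 4
    have e5 := heval 5
    have e6 := heval 6
    simp (config := { decide := true }) [Fin.sum_univ_succ, hval] at e0 e1 e2 e3 e4 e5 e6
    intro i
    fin_cases i <;> simp <;> linarith
  have h1 : Module.finrank ℚ (Submodule.span ℚ (Set.range f)) = 7 := by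
    rw [finrank_span_eq_card hli, Fintype.card_fin]
  have h2 : Submodule.span ℚ (Set.range f) ≤
      Submodule.span ℚ (Set.range fun g : ℂ ≃+* ℂ => translateInd Φ.1 g) :=
    Submodule.span_mono (by rintro _ ⟨i, rfl⟩; exact ⟨τ i, rfl⟩)
  have h3 := Submodule.finrank_mono h2
  rw [h1] at h3
  exact h3

/-- **`Rank(Φ) ≥ 5` for the type with residue set `{1, 3, 7, 9, 11, 13, 17, 19}`** (`I1`): the translates by the automorphisms of `ℂ` with cyclotomic characters
`1, 3, 7, 9, 21`, read at the embeddings with exponents `1, 3, 7, 9, 21`, are linearly independent (the `5 × 5` minor of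
`([u·c ∈ S])` has determinant `-2`). [cite: Kubota1965, §2 (p. 115)] [cite: GreenGriffithsKerr2012, (V.A.7)–(V.A.8)] -/
private theorem five_le_cmTypeRank_of_residueSet_eq_I1_forty (Φ : CMType K) (hΦ : residueSet 40 Φ = {1, 3, 7, 9, 11, 13, 17, 19}) :
    5 ≤ cmTypeRank Φ := by
  classical
  have hu : ∀ i : Fin 5, ((![1, 3, 7, 9, 21] : Fin 5 → ZMod 40) i).val.Coprime 40 := by decide
  have hc : ∀ j : Fin 5, ((![1, 3, 7, 9, 21] : Fin 5 → ZMod 40) j).val.Coprime 40 := by decide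
  choose τ hτ using fun i : Fin 5 => exists_autExp_eq 40 _ (hu i)
  choose σ hσ using fun j : Fin 5 => exists_expOf_eq 40 K _ (hc j)
  let f : Fin 5 → (K →+* ℂ) → ℚ := fun i => translateInd Φ.1 (τ i)
  have hval : ∀ i j : Fin 5, f i (σ j) =
      if (![1, 3, 7, 9, 21] : Fin 5 → ZMod 40) i * (![1, 3, 7, 9, 21] : Fin 5 → ZMod 40) j ∈
        ({1, 3, 7, 9, 11, 13, 17, 19} : Finset (ZMod 40)) then (1 : ℚ) else 0 := by
    intro i j
    show translateInd Φ.1 (τ i) (σ j) = _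
    rw [translateInd_eq_ite₈, hτ, hσ, hΦ]
  have hli : LinearIndependent ℚ f := by
    rw [Fintype.linearIndependent_iff]
    intro g hg
    have heval : ∀ j : Fin 5, ∑ i, g i * f i (σ j) = 0 := fun j => by
      have := congrFun hg (σ j)
      simpa only [Finset.sum_apply, Pi.smul_apply, smul_eq_mul, Pi.zero_apply] using this
    have e0 := heval 0
    have e1 := heval 1
    have e2 := heval 2
    have e3 := heval 3
    have e4 := heval 4
    simp (config := { decide := true }) [Fin.sum_univ_succ, hval] at e0 e1 e2 e3 e4
    intro i
    fin_cases i <;> simp <;> linarith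
  have h1 : Module.finrank ℚ (Submodule.span ℚ (Set.range f)) = 5 := by
    rw [finrank_span_eq_card hli, Fintype.card_fin]
  have h2 : Submodule.span ℚ (Set.range f) ≤
      Submodule.span ℚ (Set.range fun g : ℂ ≃+* ℂ => translateInd Φ.1 g) :=
    Submodule.span_mono (by rintro _ ⟨i, rfl⟩; exact ⟨τ i, rfl⟩)
  have h3 := Submodule.finrank_mono h2
  rw [h1] at h3
  exact h3

/-- **`Rank(Φ) ≥ 5` for the type with residue set `{1, 3, 7, 9, 11, 19, 23, 27}`** (`I2`): the translates by the automorphisms of `ℂ` with cyclotomic characters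
`1, 3, 7, 11, 13`, read at the embeddings with exponents `1, 3, 7, 11, 13`, are linearly independent (the `5 × 5` minor of
`([u·c ∈ S])` has determinant `-2`). [cite: Kubota1965, §2 (p. 115)] [cite: GreenGriffithsKerr2012, (V.A.7)–(V.A.8)] -/
private theorem five_le_cmTypeRank_of_residueSet_eq_I2_forty (Φ : CMType K) (hΦ : residueSet 40 Φ = {1, 3, 7, 9, 11, 19, 23, 27}) :
    5 ≤ cmTypeRank Φ := by
  classical
  have hu : ∀ i : Fin 5, ((![1, 3, 7, 11, 13] : Fin 5 → ZMod 40) i).val.Coprime 40 := by decide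
  have hc : ∀ j : Fin 5, ((![1, 3, 7, 11, 13] : Fin 5 → ZMod 40) j).val.Coprime 40 := by decide
  choose τ hτ using fun i : Fin 5 => exists_autExp_eq 40 _ (hu i)
  choose σ hσ using fun j : Fin 5 => exists_expOf_eq 40 K _ (hc j)
  let f : Fin 5 → (K →+* ℂ) → ℚ := fun i => translateInd Φ.1 (τ i)
  have hval : ∀ i j : Fin 5, f i (σ j) =
      if (![1, 3, 7, 11, 13] : Fin 5 → ZMod 40) i * (![1, 3, 7, 11, 13] : Fin 5 → ZMod 40) j ∈
        ({1, 3, 7, 9, 11, 19, 23, 27} : Finset (ZMod 40)) then (1 : ℚ) else 0 := by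
    intro i j
    show translateInd Φ.1 (τ i) (σ j) = _
    rw [translateInd_eq_ite₈, hτ, hσ, hΦ]
  have hli : LinearIndependent ℚ f := by
    rw [Fintype.linearIndependent_iff]
    intro g hg
    have heval : ∀ j : Fin 5, ∑ i, g i * f i (σ j) = 0 := fun j => by
      have := congrFun hg (σ j)
      simpa only [Finset.sum_apply, Pi.smul_apply, smul_eq_mul, Pi.zero_apply] using this
    have e0 := heval 0
    have e1 := heval 1
    have e2 := heval 2
    have e3 := heval 3
    have e4 := heval 4
    simp (config := { decide := true }) [Fin.sum_univ_succ, hval] at e0 e1 e2 e3 e4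
    intro i
    fin_cases i <;> simp <;> linarith
  have h1 : Module.finrank ℚ (Submodule.span ℚ (Set.range f)) = 5 := by
    rw [finrank_span_eq_card hli, Fintype.card_fin]
  have h2 : Submodule.span ℚ (Set.range f) ≤
      Submodule.span ℚ (Set.range fun g : ℂ ≃+* ℂ => translateInd Φ.1 g) :=
    Submodule.span_mono (by rintro _ ⟨i, rfl⟩; exact ⟨τ i, rfl⟩)
  have h3 := Submodule.finrank_mono h2
  rw [h1] at h3
  exact h3

/-- **`Rank(Φ) ≥ 5` for the type with residue set `{1, 3, 7, 9, 13, 17, 21, 29}`** (`I3`): the translates by the automorphisms of `ℂ` with cyclotomic characters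
`1, 3, 9, 11, 13`, read at the embeddings with exponents `1, 3, 9, 11, 13`, are linearly independent (the `5 × 5` minor of
`([u·c ∈ S])` has determinant `-2`). [cite: Kubota1965, §2 (p. 115)] [cite: GreenGriffithsKerr2012, (V.A.7)–(V.A.8)] -/
private theorem five_le_cmTypeRank_of_residueSet_eq_I3_forty (Φ : CMType K) (hΦ : residueSet 40 Φ = {1, 3, 7, 9, 13, 17, 21, 29}) :
    5 ≤ cmTypeRank Φ := by
  classical
  have hu : ∀ i : Fin 5, ((![1, 3, 9, 11, 13] : Fin 5 → ZMod 40) i).val.Coprime 40 := by decide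
  have hc : ∀ j : Fin 5, ((![1, 3, 9, 11, 13] : Fin 5 → ZMod 40) j).val.Coprime 40 := by decide
  choose τ hτ using fun i : Fin 5 => exists_autExp_eq 40 _ (hu i)
  choose σ hσ using fun j : Fin 5 => exists_expOf_eq 40 K _ (hc j)
  let f : Fin 5 → (K →+* ℂ) → ℚ := fun i => translateInd Φ.1 (τ i)
  have hval : ∀ i j : Fin 5, f i (σ j) =
      if (![1, 3, 9, 11, 13] : Fin 5 → ZMod 40) i * (![1, 3, 9, 11, 13] : Fin 5 → ZMod 40) j ∈
        ({1, 3, 7, 9, 13, 17, 21, 29} : Finset (ZMod 40)) then (1 : ℚ) else 0 := by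
    intro i j
    show translateInd Φ.1 (τ i) (σ j) = _
    rw [translateInd_eq_ite₈, hτ, hσ, hΦ]
  have hli : LinearIndependent ℚ f := by
    rw [Fintype.linearIndependent_iff]
    intro g hg
    have heval : ∀ j : Fin 5, ∑ i, g i * f i (σ j) = 0 := fun j => by
      have := congrFun hg (σ j)
      simpa only [Finset.sum_apply, Pi.smul_apply, smul_eq_mul, Pi.zero_apply] using this
    have e0 := heval 0
    have e1 := heval 1
    have e2 := heval 2
    have e3 := heval 3
    have e4 := heval 4
    simp (config := { decide := true }) [Fin.sum_univ_succ, hval] at e0 e1 e2 e3 e4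
    intro i
    fin_cases i <;> simp <;> linarith
  have h1 : Module.finrank ℚ (Submodule.span ℚ (Set.range f)) = 5 := by
    rw [finrank_span_eq_card hli, Fintype.card_fin]
  have h2 : Submodule.span ℚ (Set.range f) ≤
      Submodule.span ℚ (Set.range fun g : ℂ ≃+* ℂ => translateInd Φ.1 g) :=
    Submodule.span_mono (by rintro _ ⟨i, rfl⟩; exact ⟨τ i, rfl⟩)
  have h3 := Submodule.finrank_mono h2
  rw [h1] at h3
  exact h3

/-- **`Rank(Φ) ≥ 5` for the type with residue set `{1, 3, 7, 11, 13, 17, 21, 31}`** (`I4`): the translates by the automorphisms of `ℂ` with cyclotomic characters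
`1, 3, 7, 9, 11`, read at the embeddings with exponents `1, 3, 7, 9, 11`, are linearly independent (the `5 × 5` minor of
`([u·c ∈ S])` has determinant `2`). [cite: Kubota1965, §2 (p. 115)] [cite: GreenGriffithsKerr2012, (V.A.7)–(V.A.8)] -/
private theorem five_le_cmTypeRank_of_residueSet_eq_I4_forty (Φ : CMType K) (hΦ : residueSet 40 Φ = {1, 3, 7, 11, 13, 17, 21, 31}) :
    5 ≤ cmTypeRank Φ := by
  classical
  have hu : ∀ i : Fin 5, ((![1, 3, 7, 9, 11] : Fin 5 → ZMod 40) i).val.Coprime 40 := by decide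
  have hc : ∀ j : Fin 5, ((![1, 3, 7, 9, 11] : Fin 5 → ZMod 40) j).val.Coprime 40 := by decide
  choose τ hτ using fun i : Fin 5 => exists_autExp_eq 40 _ (hu i)
  choose σ hσ using fun j : Fin 5 => exists_expOf_eq 40 K _ (hc j)
  let f : Fin 5 → (K →+* ℂ) → ℚ := fun i => translateInd Φ.1 (τ i)
  have hval : ∀ i j : Fin 5, f i (σ j) =
      if (![1, 3, 7, 9, 11] : Fin 5 → ZMod 40) i * (![1, 3, 7, 9, 11] : Fin 5 → ZMod 40) j ∈
        ({1, 3, 7, 11, 13, 17, 21, 31} : Finset (ZMod 40)) then (1 : ℚ) else 0 := by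
    intro i j
    show translateInd Φ.1 (τ i) (σ j) = _
    rw [translateInd_eq_ite₈, hτ, hσ, hΦ]
  have hli : LinearIndependent ℚ f := by
    rw [Fintype.linearIndependent_iff]
    intro g hg
    have heval : ∀ j : Fin 5, ∑ i, g i * f i (σ j) = 0 := fun j => by
      have := congrFun hg (σ j)
      simpa only [Finset.sum_apply, Pi.smul_apply, smul_eq_mul, Pi.zero_apply] using this
    have e0 := heval 0
    have e1 := heval 1
    have e2 := heval 2
    have e3 := heval 3
    have e4 := heval 4
    simp (config := { decide := true }) [Fin.sum_univ_succ, hval] at e0 e1 e2 e3 e4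
    intro i
    fin_cases i <;> simp <;> linarith
  have h1 : Module.finrank ℚ (Submodule.span ℚ (Set.range f)) = 5 := by
    rw [finrank_span_eq_card hli, Fintype.card_fin]
  have h2 : Submodule.span ℚ (Set.range f) ≤
      Submodule.span ℚ (Set.range fun g : ℂ ≃+* ℂ => translateInd Φ.1 g) :=
    Submodule.span_mono (by rintro _ ⟨i, rfl⟩; exact ⟨τ i, rfl⟩)
  have h3 := Submodule.finrank_mono h2
  rw [h1] at h3
  exact h3

/-- **`Rank(Φ) ≥ 5` for the type with residue set `{1, 3, 7, 11, 21, 23, 27, 31}`** (`I5`): the translates by the automorphisms of `ℂ` with cyclotomic characters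
`1, 3, 7, 9, 11`, read at the embeddings with exponents `1, 3, 7, 9, 11`, are linearly independent (the `5 × 5` minor of
`([u·c ∈ S])` has determinant `2`). [cite: Kubota1965, §2 (p. 115)] [cite: GreenGriffithsKerr2012, (V.A.7)–(V.A.8)] -/
private theorem five_le_cmTypeRank_of_residueSet_eq_I5_forty (Φ : CMType K) (hΦ : residueSet 40 Φ = {1, 3, 7, 11, 21, 23, 27, 31}) :
    5 ≤ cmTypeRank Φ := by
  classical
  have hu : ∀ i : Fin 5, ((![1, 3, 7, 9, 11] : Fin 5 → ZMod 40) i).val.Coprime 40 := by decide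
  have hc : ∀ j : Fin 5, ((![1, 3, 7, 9, 11] : Fin 5 → ZMod 40) j).val.Coprime 40 := by decide
  choose τ hτ using fun i : Fin 5 => exists_autExp_eq 40 _ (hu i)
  choose σ hσ using fun j : Fin 5 => exists_expOf_eq 40 K _ (hc j)
  let f : Fin 5 → (K →+* ℂ) → ℚ := fun i => translateInd Φ.1 (τ i)
  have hval : ∀ i j : Fin 5, f i (σ j) =
      if (![1, 3, 7, 9, 11] : Fin 5 → ZMod 40) i * (![1, 3, 7, 9, 11] : Fin 5 → ZMod 40) j ∈
        ({1, 3, 7, 11, 21, 23, 27, 31} : Finset (ZMod 40)) then (1 : ℚ) else 0 := by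
    intro i j
    show translateInd Φ.1 (τ i) (σ j) = _
    rw [translateInd_eq_ite₈, hτ, hσ, hΦ]
  have hli : LinearIndependent ℚ f := by
    rw [Fintype.linearIndependent_iff]
    intro g hg
    have heval : ∀ j : Fin 5, ∑ i, g i * f i (σ j) = 0 := fun j => by
      have := congrFun hg (σ j)
      simpa only [Finset.sum_apply, Pi.smul_apply, smul_eq_mul, Pi.zero_apply] using this
    have e0 := heval 0
    have e1 := heval 1
    have e2 := heval 2
    have e3 := heval 3
    have e4 := heval 4
    simp (config := { decide := true }) [Fin.sum_univ_succ, hval] at e0 e1 e2 e3 e4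
    intro i
    fin_cases i <;> simp <;> linarith
  have h1 : Module.finrank ℚ (Submodule.span ℚ (Set.range f)) = 5 := by
    rw [finrank_span_eq_card hli, Fintype.card_fin]
  have h2 : Submodule.span ℚ (Set.range f) ≤
      Submodule.span ℚ (Set.range fun g : ℂ ≃+* ℂ => translateInd Φ.1 g) :=
    Submodule.span_mono (by rintro _ ⟨i, rfl⟩; exact ⟨τ i, rfl⟩)
  have h3 := Submodule.finrank_mono h2
  rw [h1] at h3
  exact h3

/-- **`Rank(Φ) ≥ 5` for the type with residue set `{1, 3, 9, 11, 13, 19, 23, 33}`** (`I6`): the translates by the automorphisms of `ℂ` with cyclotomic characters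
`1, 3, 7, 9, 13`, read at the embeddings with exponents `1, 3, 7, 9, 13`, are linearly independent (the `5 × 5` minor of
`([u·c ∈ S])` has determinant `-2`). [cite: Kubota1965, §2 (p. 115)] [cite: GreenGriffithsKerr2012, (V.A.7)–(V.A.8)] -/
private theorem five_le_cmTypeRank_of_residueSet_eq_I6_forty (Φ : CMType K) (hΦ : residueSet 40 Φ = {1, 3, 9, 11, 13, 19, 23, 33}) :
    5 ≤ cmTypeRank Φ := by
  classical
  have hu : ∀ i : Fin 5, ((![1, 3, 7, 9, 13] : Fin 5 → ZMod 40) i).val.Coprime 40 := by decide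
  have hc : ∀ j : Fin 5, ((![1, 3, 7, 9, 13] : Fin 5 → ZMod 40) j).val.Coprime 40 := by decide
  choose τ hτ using fun i : Fin 5 => exists_autExp_eq 40 _ (hu i)
  choose σ hσ using fun j : Fin 5 => exists_expOf_eq 40 K _ (hc j)
  let f : Fin 5 → (K →+* ℂ) → ℚ := fun i => translateInd Φ.1 (τ i)
  have hval : ∀ i j : Fin 5, f i (σ j) =
      if (![1, 3, 7, 9, 13] : Fin 5 → ZMod 40) i * (![1, 3, 7, 9, 13] : Fin 5 → ZMod 40) j ∈
        ({1, 3, 9, 11, 13, 19, 23, 33} : Finset (ZMod 40)) then (1 : ℚ) else 0 := by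
    intro i j
    show translateInd Φ.1 (τ i) (σ j) = _
    rw [translateInd_eq_ite₈, hτ, hσ, hΦ]
  have hli : LinearIndependent ℚ f := by
    rw [Fintype.linearIndependent_iff]
    intro g hg
    have heval : ∀ j : Fin 5, ∑ i, g i * f i (σ j) = 0 := fun j => by
      have := congrFun hg (σ j)
      simpa only [Finset.sum_apply, Pi.smul_apply, smul_eq_mul, Pi.zero_apply] using this
    have e0 := heval 0
    have e1 := heval 1
    have e2 := heval 2
    have e3 := heval 3
    have e4 := heval 4
    simp (config := { decide := true }) [Fin.sum_univ_succ, hval] at e0 e1 e2 e3 e4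
    intro i
    fin_cases i <;> simp <;> linarith
  have h1 : Module.finrank ℚ (Submodule.span ℚ (Set.range f)) = 5 := by
    rw [finrank_span_eq_card hli, Fintype.card_fin]
  have h2 : Submodule.span ℚ (Set.range f) ≤
      Submodule.span ℚ (Set.range fun g : ℂ ≃+* ℂ => translateInd Φ.1 g) :=
    Submodule.span_mono (by rintro _ ⟨i, rfl⟩; exact ⟨τ i, rfl⟩)
  have h3 := Submodule.finrank_mono h2
  rw [h1] at h3
  exact h3

/-- **`Rank = 9 = n + 1` for the types whose residue set is one of the eight NOT coset-balanced representatives** (Kubota's bound `Rank ≤ n + 1`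
and the `9 × 9` certificates). [cite: Kubota1965, §2 (p. 115)] [cite: Gordon1999HodgeAVSurvey, §9.4.1] -/
theorem cmTypeRank_eq_nine_of_residueSet_mem_forty (Φ : CMType K)
    (hΦ : residueSet 40 Φ ∈ ({{1, 3, 7, 9, 11, 13, 17, 21}, {1, 3, 7, 9, 11, 13, 19, 23}, {1, 3, 7, 9, 11, 17, 19, 27}, {1, 3, 7, 9, 11, 21, 23, 27}, {1, 3, 7, 9, 13, 17, 19, 29}, {1, 3, 7, 11, 13, 21, 23, 31}, {1, 3, 7, 11, 17, 21, 27, 31}, {1, 3, 7, 11, 19, 23, 27, 31}} : Finset (Finset (ZMod 40)))) :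
    cmTypeRank Φ = 9 := by
  haveI := isCMField₈ K
  refine le_antisymm ?_ ?_
  · have h := cmTypeRank_le Φ
    rw [finrank_eq_sixteen₈ K] at h
    exact h
  · simp only [Finset.mem_insert, Finset.mem_singleton] at hΦ
    rcases hΦ with h | h | h | h | h | h | h | h
    · exact nine_le_cmTypeRank_of_residueSet_eq_N1_forty Φ h
    · exact nine_le_cmTypeRank_of_residueSet_eq_N2_forty Φ h
    · exact nine_le_cmTypeRank_of_residueSet_eq_N3_forty Φ h
    · exact nine_le_cmTypeRank_of_residueSet_eq_N4_forty Φ h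
    · exact nine_le_cmTypeRank_of_residueSet_eq_N5_forty Φ h
    · exact nine_le_cmTypeRank_of_residueSet_eq_N6_forty Φ h
    · exact nine_le_cmTypeRank_of_residueSet_eq_N7_forty Φ h
    · exact nine_le_cmTypeRank_of_residueSet_eq_N8_forty Φ h

/-- **`Rank = 7` EXACTLY for the type with residue set `{1, 3, 7, 9, 11, 13, 21, 23}`** (`D1`): `≥ 7` by the certificate, `≤ 7` by Yanai's bound with
`W = {1, 9, 17, 33}` (`|W| · 2·2 = 16`: `Rank + 2 ≤ 9`). [cite: Gordon1999HodgeAVSurvey, 9.4.3 (Theorem [B.140])] -/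
theorem cmTypeRank_eq_of_residueSet_eq_D1_forty (Φ : CMType K) (hΦ : residueSet 40 Φ = {1, 3, 7, 9, 11, 13, 21, 23}) : cmTypeRank Φ = 7 := by
  obtain ⟨⟨hu0, h10, hm0, hn0, hc0⟩, ⟨hu1, h11, hm1, hn1, hc1⟩, ⟨hu2, h12, hm2, hn2, hc2⟩, ⟨hu3, h13, hm3, hn3, hc3⟩, ⟨hu4, h14, hm4, hn4, hc4⟩, ⟨hu5, h15, hm5, hn5, hc5⟩, ⟨hu6, h16, hm6, hn6, hc6⟩, ⟨hu7, h17, hm7, hn7, hc7⟩, ⟨hu8, h18, hm8, hn8, hc8⟩, ⟨hu9, h19, hm9, hn9, hc9⟩⟩ := subgroups_forty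
  obtain ⟨hb0, hb1, hb2, hb3, hb4, hb5, hb6, hb7, hb8, hb9, hb10, hb11⟩ := cosetBalanced_reps_forty
  refine le_antisymm ?_ (seven_le_cmTypeRank_of_residueSet_eq_D1_forty Φ hΦ)
  have h := cmTypeRank_add_le_of_cosetBalanced Φ hu6 h16 hm6 hn6 (by rw [hΦ]; exact hb2) (m := 2) (by rw [hc6]; decide +kernel)
  have h16 : Nat.totient 40 / 2 = 8 := by decide +kernel
  omega

/-- **`Rank = 7` EXACTLY for the type with residue set `{1, 3, 7, 9, 11, 17, 21, 27}`** (`D2`): `≥ 7` by the certificate, `≤ 7` by Yanai's bound with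
`W = {1, 9, 13, 37}` (`|W| · 2·2 = 16`: `Rank + 2 ≤ 9`). [cite: Gordon1999HodgeAVSurvey, 9.4.3 (Theorem [B.140])] -/
theorem cmTypeRank_eq_of_residueSet_eq_D2_forty (Φ : CMType K) (hΦ : residueSet 40 Φ = {1, 3, 7, 9, 11, 17, 21, 27}) : cmTypeRank Φ = 7 := by
  obtain ⟨⟨hu0, h10, hm0, hn0, hc0⟩, ⟨hu1, h11, hm1, hn1, hc1⟩, ⟨hu2, h12, hm2, hn2, hc2⟩, ⟨hu3, h13, hm3, hn3, hc3⟩, ⟨hu4, h14, hm4, hn4, hc4⟩, ⟨hu5, h15, hm5, hn5, hc5⟩, ⟨hu6, h16, hm6, hn6, hc6⟩, ⟨hu7, h17, hm7, hn7, hc7⟩, ⟨hu8, h18, hm8, hn8, hc8⟩, ⟨hu9, h19, hm9, hn9, hc9⟩⟩ := subgroups_forty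
  obtain ⟨hb0, hb1, hb2, hb3, hb4, hb5, hb6, hb7, hb8, hb9, hb10, hb11⟩ := cosetBalanced_reps_forty
  refine le_antisymm ?_ (seven_le_cmTypeRank_of_residueSet_eq_D2_forty Φ hΦ)
  have h := cmTypeRank_add_le_of_cosetBalanced Φ hu7 h17 hm7 hn7 (by rw [hΦ]; exact hb5) (m := 2) (by rw [hc7]; decide +kernel)
  have h16 : Nat.totient 40 / 2 = 8 := by decide +kernel
  omega

/-- **`Rank = 7` EXACTLY for the type with residue set `{1, 3, 7, 11, 13, 19, 23, 31}`** (`D3`): `≥ 7` by the certificate, `≤ 7` by Yanai's bound with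
`W = {1, 3, 9, 27}` (`|W| · 2·2 = 16`: `Rank + 2 ≤ 9`). [cite: Gordon1999HodgeAVSurvey, 9.4.3 (Theorem [B.140])] -/
theorem cmTypeRank_eq_of_residueSet_eq_D3_forty (Φ : CMType K) (hΦ : residueSet 40 Φ = {1, 3, 7, 11, 13, 19, 23, 31}) : cmTypeRank Φ = 7 := by
  obtain ⟨⟨hu0, h10, hm0, hn0, hc0⟩, ⟨hu1, h11, hm1, hn1, hc1⟩, ⟨hu2, h12, hm2, hn2, hc2⟩, ⟨hu3, h13, hm3, hn3, hc3⟩, ⟨hu4, h14, hm4, hn4, hc4⟩, ⟨hu5, h15, hm5, hn5, hc5⟩, ⟨hu6, h16, hm6, hn6, hc6⟩, ⟨hu7, h17, hm7, hn7, hc7⟩, ⟨hu8, h18, hm8, hn8, hc8⟩, ⟨hu9, h19, hm9, hn9, hc9⟩⟩ := subgroups_forty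
  obtain ⟨hb0, hb1, hb2, hb3, hb4, hb5, hb6, hb7, hb8, hb9, hb10, hb11⟩ := cosetBalanced_reps_forty
  refine le_antisymm ?_ (seven_le_cmTypeRank_of_residueSet_eq_D3_forty Φ hΦ)
  have h := cmTypeRank_add_le_of_cosetBalanced Φ hu8 h18 hm8 hn8 (by rw [hΦ]; exact hb8) (m := 2) (by rw [hc8]; decide +kernel)
  have h16 : Nat.totient 40 / 2 = 8 := by decide +kernel
  omega

/-- **`Rank = 7` EXACTLY for the type with residue set `{1, 3, 7, 11, 17, 19, 27, 31}`** (`D4`): `≥ 7` by the certificate, `≤ 7` by Yanai's bound with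
`W = {1, 7, 9, 23}` (`|W| · 2·2 = 16`: `Rank + 2 ≤ 9`). [cite: Gordon1999HodgeAVSurvey, 9.4.3 (Theorem [B.140])] -/
theorem cmTypeRank_eq_of_residueSet_eq_D4_forty (Φ : CMType K) (hΦ : residueSet 40 Φ = {1, 3, 7, 11, 17, 19, 27, 31}) : cmTypeRank Φ = 7 := by
  obtain ⟨⟨hu0, h10, hm0, hn0, hc0⟩, ⟨hu1, h11, hm1, hn1, hc1⟩, ⟨hu2, h12, hm2, hn2, hc2⟩, ⟨hu3, h13, hm3, hn3, hc3⟩, ⟨hu4, h14, hm4, hn4, hc4⟩, ⟨hu5, h15, hm5, hn5, hc5⟩, ⟨hu6, h16, hm6, hn6, hc6⟩, ⟨hu7, h17, hm7, hn7, hc7⟩, ⟨hu8, h18, hm8, hn8, hc8⟩, ⟨hu9, h19, hm9, hn9, hc9⟩⟩ := subgroups_forty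
  obtain ⟨hb0, hb1, hb2, hb3, hb4, hb5, hb6, hb7, hb8, hb9, hb10, hb11⟩ := cosetBalanced_reps_forty
  refine le_antisymm ?_ (seven_le_cmTypeRank_of_residueSet_eq_D4_forty Φ hΦ)
  have h := cmTypeRank_add_le_of_cosetBalanced Φ hu9 h19 hm9 hn9 (by rw [hΦ]; exact hb11) (m := 2) (by rw [hc9]; decide +kernel)
  have h16 : Nat.totient 40 / 2 = 8 := by decide +kernel
  omega

/-- **`Rank = 5` EXACTLY for the type with residue set `{1, 3, 7, 9, 11, 13, 17, 19}`** (`I1`, stabiliser `{1, 19}`: induced from a primitive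
NONDEGENERATE type of an octic CM subfield): `≥ 5` by the certificate, `≤ 5` by the induced-type bound.
[cite: Kubota1965, §2 (p. 115)] [cite: KoblitzRohrlich1978, §1 p. 1184] -/
theorem cmTypeRank_eq_of_residueSet_eq_I1_forty (Φ : CMType K) (hΦ : residueSet 40 Φ = {1, 3, 7, 9, 11, 13, 17, 19}) : cmTypeRank Φ = 5 := by
  obtain ⟨⟨hs0, hi0⟩, ⟨hs1, hi1⟩, ⟨hs2, hi2⟩, ⟨hs3, hi3⟩, ⟨hs4, hi4⟩, ⟨hs5, hi5⟩, ⟨hs6, hi6⟩, ⟨hs7, hi7⟩, ⟨hs8, hi8⟩, ⟨hs9, hi9⟩, ⟨hs10, hi10⟩, ⟨hs11, hi11⟩⟩ := stabilizer_reps_forty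
  refine le_antisymm ?_ (five_le_cmTypeRank_of_residueSet_eq_I1_forty Φ hΦ)
  exact cmTypeRank_le_succ_of_card_stabilizer_mul_eq (N := 40) (by norm_num) Φ (k := 4) (by rw [hΦ, hs0]; decide +kernel)

/-- **`Rank = 5` EXACTLY for the type with residue set `{1, 3, 7, 9, 11, 19, 23, 27}`** (`I2`, stabiliser `{1, 9}`: induced from a primitive
NONDEGENERATE type of an octic CM subfield): `≥ 5` by the certificate, `≤ 5` by the induced-type bound.
[cite: Kubota1965, §2 (p. 115)] [cite: KoblitzRohrlich1978, §1 p. 1184] -/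
theorem cmTypeRank_eq_of_residueSet_eq_I2_forty (Φ : CMType K) (hΦ : residueSet 40 Φ = {1, 3, 7, 9, 11, 19, 23, 27}) : cmTypeRank Φ = 5 := by
  obtain ⟨⟨hs0, hi0⟩, ⟨hs1, hi1⟩, ⟨hs2, hi2⟩, ⟨hs3, hi3⟩, ⟨hs4, hi4⟩, ⟨hs5, hi5⟩, ⟨hs6, hi6⟩, ⟨hs7, hi7⟩, ⟨hs8, hi8⟩, ⟨hs9, hi9⟩, ⟨hs10, hi10⟩, ⟨hs11, hi11⟩⟩ := stabilizer_reps_forty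
  refine le_antisymm ?_ (five_le_cmTypeRank_of_residueSet_eq_I2_forty Φ hΦ)
  exact cmTypeRank_le_succ_of_card_stabilizer_mul_eq (N := 40) (by norm_num) Φ (k := 4) (by rw [hΦ, hs1]; decide +kernel)

/-- **`Rank = 5` EXACTLY for the type with residue set `{1, 3, 7, 9, 13, 17, 21, 29}`** (`I3`, stabiliser `{1, 29}`: induced from a primitive
NONDEGENERATE type of an octic CM subfield): `≥ 5` by the certificate, `≤ 5` by the induced-type bound.
[cite: Kubota1965, §2 (p. 115)] [cite: KoblitzRohrlich1978, §1 p. 1184] -/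
theorem cmTypeRank_eq_of_residueSet_eq_I3_forty (Φ : CMType K) (hΦ : residueSet 40 Φ = {1, 3, 7, 9, 13, 17, 21, 29}) : cmTypeRank Φ = 5 := by
  obtain ⟨⟨hs0, hi0⟩, ⟨hs1, hi1⟩, ⟨hs2, hi2⟩, ⟨hs3, hi3⟩, ⟨hs4, hi4⟩, ⟨hs5, hi5⟩, ⟨hs6, hi6⟩, ⟨hs7, hi7⟩, ⟨hs8, hi8⟩, ⟨hs9, hi9⟩, ⟨hs10, hi10⟩, ⟨hs11, hi11⟩⟩ := stabilizer_reps_forty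
  refine le_antisymm ?_ (five_le_cmTypeRank_of_residueSet_eq_I3_forty Φ hΦ)
  exact cmTypeRank_le_succ_of_card_stabilizer_mul_eq (N := 40) (by norm_num) Φ (k := 4) (by rw [hΦ, hs2]; decide +kernel)

/-- **`Rank = 5` EXACTLY for the type with residue set `{1, 3, 7, 11, 13, 17, 21, 31}`** (`I4`, stabiliser `{1, 31}`: induced from a primitive
NONDEGENERATE type of an octic CM subfield): `≥ 5` by the certificate, `≤ 5` by the induced-type bound.
[cite: Kubota1965, §2 (p. 115)] [cite: KoblitzRohrlich1978, §1 p. 1184] -/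
theorem cmTypeRank_eq_of_residueSet_eq_I4_forty (Φ : CMType K) (hΦ : residueSet 40 Φ = {1, 3, 7, 11, 13, 17, 21, 31}) : cmTypeRank Φ = 5 := by
  obtain ⟨⟨hs0, hi0⟩, ⟨hs1, hi1⟩, ⟨hs2, hi2⟩, ⟨hs3, hi3⟩, ⟨hs4, hi4⟩, ⟨hs5, hi5⟩, ⟨hs6, hi6⟩, ⟨hs7, hi7⟩, ⟨hs8, hi8⟩, ⟨hs9, hi9⟩, ⟨hs10, hi10⟩, ⟨hs11, hi11⟩⟩ := stabilizer_reps_forty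
  refine le_antisymm ?_ (five_le_cmTypeRank_of_residueSet_eq_I4_forty Φ hΦ)
  exact cmTypeRank_le_succ_of_card_stabilizer_mul_eq (N := 40) (by norm_num) Φ (k := 4) (by rw [hΦ, hs3]; decide +kernel)

/-- **`Rank = 5` EXACTLY for the type with residue set `{1, 3, 7, 11, 21, 23, 27, 31}`** (`I5`, stabiliser `{1, 21}`: induced from a primitive
NONDEGENERATE type of an octic CM subfield): `≥ 5` by the certificate, `≤ 5` by the induced-type bound.
[cite: Kubota1965, §2 (p. 115)] [cite: KoblitzRohrlich1978, §1 p. 1184] -/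
theorem cmTypeRank_eq_of_residueSet_eq_I5_forty (Φ : CMType K) (hΦ : residueSet 40 Φ = {1, 3, 7, 11, 21, 23, 27, 31}) : cmTypeRank Φ = 5 := by
  obtain ⟨⟨hs0, hi0⟩, ⟨hs1, hi1⟩, ⟨hs2, hi2⟩, ⟨hs3, hi3⟩, ⟨hs4, hi4⟩, ⟨hs5, hi5⟩, ⟨hs6, hi6⟩, ⟨hs7, hi7⟩, ⟨hs8, hi8⟩, ⟨hs9, hi9⟩, ⟨hs10, hi10⟩, ⟨hs11, hi11⟩⟩ := stabilizer_reps_forty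
  refine le_antisymm ?_ (five_le_cmTypeRank_of_residueSet_eq_I5_forty Φ hΦ)
  exact cmTypeRank_le_succ_of_card_stabilizer_mul_eq (N := 40) (by norm_num) Φ (k := 4) (by rw [hΦ, hs4]; decide +kernel)

/-- **`Rank = 5` EXACTLY for the type with residue set `{1, 3, 9, 11, 13, 19, 23, 33}`** (`I6`, stabiliser `{1, 11}`: induced from a primitive
NONDEGENERATE type of an octic CM subfield): `≥ 5` by the certificate, `≤ 5` by the induced-type bound.
[cite: Kubota1965, §2 (p. 115)] [cite: KoblitzRohrlich1978, §1 p. 1184] -/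
theorem cmTypeRank_eq_of_residueSet_eq_I6_forty (Φ : CMType K) (hΦ : residueSet 40 Φ = {1, 3, 9, 11, 13, 19, 23, 33}) : cmTypeRank Φ = 5 := by
  obtain ⟨⟨hs0, hi0⟩, ⟨hs1, hi1⟩, ⟨hs2, hi2⟩, ⟨hs3, hi3⟩, ⟨hs4, hi4⟩, ⟨hs5, hi5⟩, ⟨hs6, hi6⟩, ⟨hs7, hi7⟩, ⟨hs8, hi8⟩, ⟨hs9, hi9⟩, ⟨hs10, hi10⟩, ⟨hs11, hi11⟩⟩ := stabilizer_reps_forty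
  refine le_antisymm ?_ (five_le_cmTypeRank_of_residueSet_eq_I6_forty Φ hΦ)
  exact cmTypeRank_le_succ_of_card_stabilizer_mul_eq (N := 40) (by norm_num) Φ (k := 4) (by rw [hΦ, hs5]; decide +kernel)

/-- **`Rank = 3` for the types of `ℚ(ζ₄₀)` with residue stabiliser of order `4`** (induced from a quartic CM subfield, `[K₁ : ℚ] = 2·2`).
[cite: Kubota1965, §2 (p. 115)] [cite: KoblitzRohrlich1978, §1 p. 1184] -/
theorem cmTypeRank_eq_three_of_card_stabilizer_eq_four_forty (Φ : CMType K) (hW : ((unitResidues 40).filter fun t => ∀ c ∈ unitResidues 40, (c * t ∈ residueSet 40 Φ ↔ c ∈ residueSet 40 Φ)).card = 4) :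
    cmTypeRank Φ = 3 :=
  cmTypeRank_eq_succ_of_card_stabilizer_mul_eq (N := 40) (by norm_num) Nat.prime_two Φ (by rw [hW]; decide +kernel)

/-- **`Rank = 2` for the types of `ℚ(ζ₄₀)` with residue stabiliser of order `8`** (induced from an imaginary quadratic subfield).
[cite: Kubota1965, §2 (p. 115)] -/
theorem cmTypeRank_eq_two_of_card_stabilizer_eq_eight_forty (Φ : CMType K) (hW : ((unitResidues 40).filter fun t => ∀ c ∈ unitResidues 40, (c * t ∈ residueSet 40 Φ ↔ c ∈ residueSet 40 Φ)).card = 8) :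
    cmTypeRank Φ = 2 :=
  cmTypeRank_eq_two_of_two_mul_card_filter_eq (N := 40) (by norm_num) Φ (by rw [hW]; decide +kernel)

/-- **`Rank ≤ 5` for the types of `ℚ(ζ₄₀)` with residue stabiliser of order `2`** (induced from an octic CM subfield).
[cite: Kubota1965, §2 (p. 115)] [cite: KoblitzRohrlich1978, §1 p. 1184] -/
theorem cmTypeRank_le_five_of_card_stabilizer_eq_two_forty (Φ : CMType K) (hW : ((unitResidues 40).filter fun t => ∀ c ∈ unitResidues 40, (c * t ∈ residueSet 40 Φ ↔ c ∈ residueSet 40 Φ)).card = 2) :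
    cmTypeRank Φ ≤ 5 :=
  cmTypeRank_le_succ_of_card_stabilizer_mul_eq (N := 40) (by norm_num) Φ (k := 4) (by rw [hW]; decide +kernel)

/-- **`Rank = 9` FOR EVERY TYPE OF `ℚ(ζ₄₀)` NOT COSET-BALANCED for any maximal `(−1)`-free subgroup** (it is the transform of one of the eight
representatives, and the rank is an invariant of the family). [cite: Gordon1999HodgeAVSurvey, §9.4.1] [cite: Shimura1998, §8.4 Example (1)] -/
theorem cmTypeRank_eq_nine_of_not_cosetBalanced_forty (Φ : CMType K)
    (h : ¬((∀ c ∈ unitResidues 40, ((({1, 11, 21, 31} : Finset (ZMod 40))).filter fun w => c * w ∈ residueSet 40 Φ).card = ((({1, 11, 21, 31} : Finset (ZMod 40))).filter fun w => c * w ∉ residueSet 40 Φ).card) ∨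
      (∀ c ∈ unitResidues 40, ((({1, 19, 29, 31} : Finset (ZMod 40))).filter fun w => c * w ∈ residueSet 40 Φ).card = ((({1, 19, 29, 31} : Finset (ZMod 40))).filter fun w => c * w ∉ residueSet 40 Φ).card) ∨
      (∀ c ∈ unitResidues 40, ((({1, 3, 7, 9, 21, 23, 27, 29} : Finset (ZMod 40))).filter fun w => c * w ∈ residueSet 40 Φ).card = ((({1, 3, 7, 9, 21, 23, 27, 29} : Finset (ZMod 40))).filter fun w => c * w ∉ residueSet 40 Φ).card) ∨
      (∀ c ∈ unitResidues 40, ((({1, 3, 9, 11, 17, 19, 27, 33} : Finset (ZMod 40))).filter fun w => c * w ∈ residueSet 40 Φ).card = ((({1, 3, 9, 11, 17, 19, 27, 33} : Finset (ZMod 40))).filter fun w => c * w ∉ residueSet 40 Φ).card) ∨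
      (∀ c ∈ unitResidues 40, ((({1, 7, 9, 11, 13, 19, 23, 37} : Finset (ZMod 40))).filter fun w => c * w ∈ residueSet 40 Φ).card = ((({1, 7, 9, 11, 13, 19, 23, 37} : Finset (ZMod 40))).filter fun w => c * w ∉ residueSet 40 Φ).card) ∨
      (∀ c ∈ unitResidues 40, ((({1, 9, 13, 17, 21, 29, 33, 37} : Finset (ZMod 40))).filter fun w => c * w ∈ residueSet 40 Φ).card = ((({1, 9, 13, 17, 21, 29, 33, 37} : Finset (ZMod 40))).filter fun w => c * w ∉ residueSet 40 Φ).card))) :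
    cmTypeRank Φ = 9 := by
  obtain ⟨φ₀⟩ : Nonempty (K →+* ℂ) := inferInstance
  obtain ⟨Ψ, hΨ, hT⟩ := (exists_isAutTransform_forty Φ φ₀).1 h
  rw [cmTypeRank_eq_of_isAutTransform hT]
  exact cmTypeRank_eq_nine_of_residueSet_mem_forty Ψ hΨ

/-- **`Rank ≤ 8` for every type COSET-BALANCED for some maximal `(−1)`-free subgroup** (Yanai: degenerate).
[cite: Gordon1999HodgeAVSurvey, 9.4.3 (Theorem [B.140])] -/
theorem cmTypeRank_le_eight_of_cosetBalanced_forty (Φ : CMType K)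
    (h : ((∀ c ∈ unitResidues 40, ((({1, 11, 21, 31} : Finset (ZMod 40))).filter fun w => c * w ∈ residueSet 40 Φ).card = ((({1, 11, 21, 31} : Finset (ZMod 40))).filter fun w => c * w ∉ residueSet 40 Φ).card) ∨
      (∀ c ∈ unitResidues 40, ((({1, 19, 29, 31} : Finset (ZMod 40))).filter fun w => c * w ∈ residueSet 40 Φ).card = ((({1, 19, 29, 31} : Finset (ZMod 40))).filter fun w => c * w ∉ residueSet 40 Φ).card) ∨
      (∀ c ∈ unitResidues 40, ((({1, 3, 7, 9, 21, 23, 27, 29} : Finset (ZMod 40))).filter fun w => c * w ∈ residueSet 40 Φ).card = ((({1, 3, 7, 9, 21, 23, 27, 29} : Finset (ZMod 40))).filter fun w => c * w ∉ residueSet 40 Φ).card) ∨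
      (∀ c ∈ unitResidues 40, ((({1, 3, 9, 11, 17, 19, 27, 33} : Finset (ZMod 40))).filter fun w => c * w ∈ residueSet 40 Φ).card = ((({1, 3, 9, 11, 17, 19, 27, 33} : Finset (ZMod 40))).filter fun w => c * w ∉ residueSet 40 Φ).card) ∨
      (∀ c ∈ unitResidues 40, ((({1, 7, 9, 11, 13, 19, 23, 37} : Finset (ZMod 40))).filter fun w => c * w ∈ residueSet 40 Φ).card = ((({1, 7, 9, 11, 13, 19, 23, 37} : Finset (ZMod 40))).filter fun w => c * w ∉ residueSet 40 Φ).card) ∨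
      (∀ c ∈ unitResidues 40, ((({1, 9, 13, 17, 21, 29, 33, 37} : Finset (ZMod 40))).filter fun w => c * w ∈ residueSet 40 Φ).card = ((({1, 9, 13, 17, 21, 29, 33, 37} : Finset (ZMod 40))).filter fun w => c * w ∉ residueSet 40 Φ).card))) :
    cmTypeRank Φ ≤ 8 := by
  obtain ⟨⟨hu0, h10, hm0, hn0, hc0⟩, ⟨hu1, h11, hm1, hn1, hc1⟩, ⟨hu2, h12, hm2, hn2, hc2⟩, ⟨hu3, h13, hm3, hn3, hc3⟩, ⟨hu4, h14, hm4, hn4, hc4⟩, ⟨hu5, h15, hm5, hn5, hc5⟩, ⟨hu6, h16, hm6, hn6, hc6⟩, ⟨hu7, h17, hm7, hn7, hc7⟩, ⟨hu8, h18, hm8, hn8, hc8⟩, ⟨hu9, h19, hm9, hn9, hc9⟩⟩ := subgroups_forty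
  rw [show (8 : ℕ) = Nat.totient 40 / 2 by decide +kernel]
  rcases h with h | h | h | h | h | h
  · exact cmTypeRank_le_of_cosetBalanced Φ hu0 h10 hm0 hn0 h
  · exact cmTypeRank_le_of_cosetBalanced Φ hu1 h11 hm1 hn1 h
  · exact cmTypeRank_le_of_cosetBalanced Φ hu2 h12 hm2 hn2 h
  · exact cmTypeRank_le_of_cosetBalanced Φ hu3 h13 hm3 hn3 h
  · exact cmTypeRank_le_of_cosetBalanced Φ hu4 h14 hm4 hn4 h
  · exact cmTypeRank_le_of_cosetBalanced Φ hu5 h15 hm5 hn5 h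

omit [IsCyclotomicExtension {40} ℚ K] in
/-- **NONDEGENERATE ⟺ NOT COSET-BALANCED for any maximal `(−1)`-free subgroup, for the CM types of `ℚ(ζ₄₀)`** — the residue form of
«nondegenerate ⟺ equidistributed over no odd character» for this abelian field of `2`-power degree. [cite: Gordon1999HodgeAVSurvey, §9.4.1 and 9.4.3]
[cite: Kubota1965, §4 Lemma 2] -/
theorem isNondegenerate_iff_not_cosetBalanced_forty (hK : IsCyclotomicExtension {40} ℚ K) (Φ : CMType K) :
    IsNondegenerate Φ ↔ ¬((∀ c ∈ unitResidues 40, ((({1, 11, 21, 31} : Finset (ZMod 40))).filter fun w => c * w ∈ residueSet 40 Φ).card = ((({1, 11, 21, 31} : Finset (ZMod 40))).filter fun w => c * w ∉ residueSet 40 Φ).card) ∨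
      (∀ c ∈ unitResidues 40, ((({1, 19, 29, 31} : Finset (ZMod 40))).filter fun w => c * w ∈ residueSet 40 Φ).card = ((({1, 19, 29, 31} : Finset (ZMod 40))).filter fun w => c * w ∉ residueSet 40 Φ).card) ∨
      (∀ c ∈ unitResidues 40, ((({1, 3, 7, 9, 21, 23, 27, 29} : Finset (ZMod 40))).filter fun w => c * w ∈ residueSet 40 Φ).card = ((({1, 3, 7, 9, 21, 23, 27, 29} : Finset (ZMod 40))).filter fun w => c * w ∉ residueSet 40 Φ).card) ∨
      (∀ c ∈ unitResidues 40, ((({1, 3, 9, 11, 17, 19, 27, 33} : Finset (ZMod 40))).filter fun w => c * w ∈ residueSet 40 Φ).card = ((({1, 3, 9, 11, 17, 19, 27, 33} : Finset (ZMod 40))).filter fun w => c * w ∉ residueSet 40 Φ).card) ∨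
      (∀ c ∈ unitResidues 40, ((({1, 7, 9, 11, 13, 19, 23, 37} : Finset (ZMod 40))).filter fun w => c * w ∈ residueSet 40 Φ).card = ((({1, 7, 9, 11, 13, 19, 23, 37} : Finset (ZMod 40))).filter fun w => c * w ∉ residueSet 40 Φ).card) ∨
      (∀ c ∈ unitResidues 40, ((({1, 9, 13, 17, 21, 29, 33, 37} : Finset (ZMod 40))).filter fun w => c * w ∈ residueSet 40 Φ).card = ((({1, 9, 13, 17, 21, 29, 33, 37} : Finset (ZMod 40))).filter fun w => c * w ∉ residueSet 40 Φ).card)) := by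
  haveI := isCMField₈ K
  rw [isNondegenerate_iff, finrank_eq_sixteen₈ K]
  constructor
  · intro h9 hb
    have h8 := cmTypeRank_le_eight_of_cosetBalanced_forty Φ hb
    omega
  · intro h
    exact cmTypeRank_eq_nine_of_not_cosetBalanced_forty Φ h

omit [IsCyclotomicExtension {40} ℚ K] in
/-- **Exactly `128` of the `256` CM types of `ℚ(ζ₄₀)` are nondegenerate** (eight free families of `16`). [cite: Gordon1999HodgeAVSurvey, §9.4.1]
[cite: Shimura1998, §8.4 Example (1)] -/
theorem ncard_isNondegenerate_forty (hK : IsCyclotomicExtension {40} ℚ K) : {Φ : CMType K | IsNondegenerate Φ}.ncard = 128 := by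
  obtain ⟨φ₀⟩ : Nonempty (K →+* ℂ) := inferInstance
  have h := (ncard_not_cosetBalanced_forty hK φ₀).1
  rw [← h]
  congr 1
  ext Φ
  exact isNondegenerate_iff_not_cosetBalanced_forty hK Φ

/-- The maximal `(−1)`-free subgroups over which the degenerate primitive representatives are NOT balanced (the complement of the census's
`cosetBalanced_reps_forty` within the maximal subgroups). [cite: Gordon1999HodgeAVSurvey, §9.4.1] -/
private theorem not_cosetBalanced_deg_reps_forty :
    ¬(∀ c ∈ unitResidues 40, ((({1, 11, 21, 31} : Finset (ZMod 40))).filter fun w => c * w ∈ ({1, 3, 7, 9, 11, 13, 21, 23} : Finset (ZMod 40))).card = ((({1, 11, 21, 31} : Finset (ZMod 40))).filter fun w => c * w ∉ ({1, 3, 7, 9, 11, 13, 21, 23} : Finset (ZMod 40))).card) ∧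
    ¬(∀ c ∈ unitResidues 40, ((({1, 19, 29, 31} : Finset (ZMod 40))).filter fun w => c * w ∈ ({1, 3, 7, 9, 11, 13, 21, 23} : Finset (ZMod 40))).card = ((({1, 19, 29, 31} : Finset (ZMod 40))).filter fun w => c * w ∉ ({1, 3, 7, 9, 11, 13, 21, 23} : Finset (ZMod 40))).card) ∧
    ¬(∀ c ∈ unitResidues 40, ((({1, 3, 7, 9, 21, 23, 27, 29} : Finset (ZMod 40))).filter fun w => c * w ∈ ({1, 3, 7, 9, 11, 13, 21, 23} : Finset (ZMod 40))).card = ((({1, 3, 7, 9, 21, 23, 27, 29} : Finset (ZMod 40))).filter fun w => c * w ∉ ({1, 3, 7, 9, 11, 13, 21, 23} : Finset (ZMod 40))).card) ∧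
    ¬(∀ c ∈ unitResidues 40, ((({1, 7, 9, 11, 13, 19, 23, 37} : Finset (ZMod 40))).filter fun w => c * w ∈ ({1, 3, 7, 9, 11, 13, 21, 23} : Finset (ZMod 40))).card = ((({1, 7, 9, 11, 13, 19, 23, 37} : Finset (ZMod 40))).filter fun w => c * w ∉ ({1, 3, 7, 9, 11, 13, 21, 23} : Finset (ZMod 40))).card) ∧
    ¬(∀ c ∈ unitResidues 40, ((({1, 11, 21, 31} : Finset (ZMod 40))).filter fun w => c * w ∈ ({1, 3, 7, 9, 11, 17, 21, 27} : Finset (ZMod 40))).card = ((({1, 11, 21, 31} : Finset (ZMod 40))).filter fun w => c * w ∉ ({1, 3, 7, 9, 11, 17, 21, 27} : Finset (ZMod 40))).card) ∧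
    ¬(∀ c ∈ unitResidues 40, ((({1, 19, 29, 31} : Finset (ZMod 40))).filter fun w => c * w ∈ ({1, 3, 7, 9, 11, 17, 21, 27} : Finset (ZMod 40))).card = ((({1, 19, 29, 31} : Finset (ZMod 40))).filter fun w => c * w ∉ ({1, 3, 7, 9, 11, 17, 21, 27} : Finset (ZMod 40))).card) ∧
    ¬(∀ c ∈ unitResidues 40, ((({1, 3, 7, 9, 21, 23, 27, 29} : Finset (ZMod 40))).filter fun w => c * w ∈ ({1, 3, 7, 9, 11, 17, 21, 27} : Finset (ZMod 40))).card = ((({1, 3, 7, 9, 21, 23, 27, 29} : Finset (ZMod 40))).filter fun w => c * w ∉ ({1, 3, 7, 9, 11, 17, 21, 27} : Finset (ZMod 40))).card) ∧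
    ¬(∀ c ∈ unitResidues 40, ((({1, 3, 9, 11, 17, 19, 27, 33} : Finset (ZMod 40))).filter fun w => c * w ∈ ({1, 3, 7, 9, 11, 17, 21, 27} : Finset (ZMod 40))).card = ((({1, 3, 9, 11, 17, 19, 27, 33} : Finset (ZMod 40))).filter fun w => c * w ∉ ({1, 3, 7, 9, 11, 17, 21, 27} : Finset (ZMod 40))).card) ∧
    ¬(∀ c ∈ unitResidues 40, ((({1, 11, 21, 31} : Finset (ZMod 40))).filter fun w => c * w ∈ ({1, 3, 7, 11, 13, 19, 23, 31} : Finset (ZMod 40))).card = ((({1, 11, 21, 31} : Finset (ZMod 40))).filter fun w => c * w ∉ ({1, 3, 7, 11, 13, 19, 23, 31} : Finset (ZMod 40))).card) ∧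
    ¬(∀ c ∈ unitResidues 40, ((({1, 19, 29, 31} : Finset (ZMod 40))).filter fun w => c * w ∈ ({1, 3, 7, 11, 13, 19, 23, 31} : Finset (ZMod 40))).card = ((({1, 19, 29, 31} : Finset (ZMod 40))).filter fun w => c * w ∉ ({1, 3, 7, 11, 13, 19, 23, 31} : Finset (ZMod 40))).card) ∧
    ¬(∀ c ∈ unitResidues 40, ((({1, 7, 9, 11, 13, 19, 23, 37} : Finset (ZMod 40))).filter fun w => c * w ∈ ({1, 3, 7, 11, 13, 19, 23, 31} : Finset (ZMod 40))).card = ((({1, 7, 9, 11, 13, 19, 23, 37} : Finset (ZMod 40))).filter fun w => c * w ∉ ({1, 3, 7, 11, 13, 19, 23, 31} : Finset (ZMod 40))).card) ∧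
    ¬(∀ c ∈ unitResidues 40, ((({1, 9, 13, 17, 21, 29, 33, 37} : Finset (ZMod 40))).filter fun w => c * w ∈ ({1, 3, 7, 11, 13, 19, 23, 31} : Finset (ZMod 40))).card = ((({1, 9, 13, 17, 21, 29, 33, 37} : Finset (ZMod 40))).filter fun w => c * w ∉ ({1, 3, 7, 11, 13, 19, 23, 31} : Finset (ZMod 40))).card) ∧
    ¬(∀ c ∈ unitResidues 40, ((({1, 11, 21, 31} : Finset (ZMod 40))).filter fun w => c * w ∈ ({1, 3, 7, 11, 17, 19, 27, 31} : Finset (ZMod 40))).card = ((({1, 11, 21, 31} : Finset (ZMod 40))).filter fun w => c * w ∉ ({1, 3, 7, 11, 17, 19, 27, 31} : Finset (ZMod 40))).card) ∧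
    ¬(∀ c ∈ unitResidues 40, ((({1, 19, 29, 31} : Finset (ZMod 40))).filter fun w => c * w ∈ ({1, 3, 7, 11, 17, 19, 27, 31} : Finset (ZMod 40))).card = ((({1, 19, 29, 31} : Finset (ZMod 40))).filter fun w => c * w ∉ ({1, 3, 7, 11, 17, 19, 27, 31} : Finset (ZMod 40))).card) ∧
    ¬(∀ c ∈ unitResidues 40, ((({1, 3, 9, 11, 17, 19, 27, 33} : Finset (ZMod 40))).filter fun w => c * w ∈ ({1, 3, 7, 11, 17, 19, 27, 31} : Finset (ZMod 40))).card = ((({1, 3, 9, 11, 17, 19, 27, 33} : Finset (ZMod 40))).filter fun w => c * w ∉ ({1, 3, 7, 11, 17, 19, 27, 31} : Finset (ZMod 40))).card) ∧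
    ¬(∀ c ∈ unitResidues 40, ((({1, 9, 13, 17, 21, 29, 33, 37} : Finset (ZMod 40))).filter fun w => c * w ∈ ({1, 3, 7, 11, 17, 19, 27, 31} : Finset (ZMod 40))).card = ((({1, 9, 13, 17, 21, 29, 33, 37} : Finset (ZMod 40))).filter fun w => c * w ∉ ({1, 3, 7, 11, 17, 19, 27, 31} : Finset (ZMod 40))).card) := by
  refine ⟨?_, ?_, ?_, ?_, ?_, ?_, ?_, ?_, ?_, ?_, ?_, ?_, ?_, ?_, ?_, ?_⟩ <;> decide +kernel

/-- **THE RANKS OF THE PRIMITIVE COSET-BALANCED TYPES OF `ℚ(ζ₄₀)`, by their balance profile over the maximal `(−1)`-free subgroups** (each is the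
transform of one of the 4 representatives; balance and rank are invariants of the family). [cite: Gordon1999HodgeAVSurvey, §9.4.2 and 9.4.3]
[cite: Shimura1998, §8.4 Example (1)] -/
theorem cmTypeRank_of_isPrimitive_of_cosetBalanced_forty (Φ : CMType K) (φ₀ : K →+* ℂ) (hp : IsPrimitive (ℂ ≃+* ℂ) Φ.1 φ₀)
    (hb : ((∀ c ∈ unitResidues 40, ((({1, 11, 21, 31} : Finset (ZMod 40))).filter fun w => c * w ∈ residueSet 40 Φ).card = ((({1, 11, 21, 31} : Finset (ZMod 40))).filter fun w => c * w ∉ residueSet 40 Φ).card) ∨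
      (∀ c ∈ unitResidues 40, ((({1, 19, 29, 31} : Finset (ZMod 40))).filter fun w => c * w ∈ residueSet 40 Φ).card = ((({1, 19, 29, 31} : Finset (ZMod 40))).filter fun w => c * w ∉ residueSet 40 Φ).card) ∨
      (∀ c ∈ unitResidues 40, ((({1, 3, 7, 9, 21, 23, 27, 29} : Finset (ZMod 40))).filter fun w => c * w ∈ residueSet 40 Φ).card = ((({1, 3, 7, 9, 21, 23, 27, 29} : Finset (ZMod 40))).filter fun w => c * w ∉ residueSet 40 Φ).card) ∨
      (∀ c ∈ unitResidues 40, ((({1, 3, 9, 11, 17, 19, 27, 33} : Finset (ZMod 40))).filter fun w => c * w ∈ residueSet 40 Φ).card = ((({1, 3, 9, 11, 17, 19, 27, 33} : Finset (ZMod 40))).filter fun w => c * w ∉ residueSet 40 Φ).card) ∨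
      (∀ c ∈ unitResidues 40, ((({1, 7, 9, 11, 13, 19, 23, 37} : Finset (ZMod 40))).filter fun w => c * w ∈ residueSet 40 Φ).card = ((({1, 7, 9, 11, 13, 19, 23, 37} : Finset (ZMod 40))).filter fun w => c * w ∉ residueSet 40 Φ).card) ∨
      (∀ c ∈ unitResidues 40, ((({1, 9, 13, 17, 21, 29, 33, 37} : Finset (ZMod 40))).filter fun w => c * w ∈ residueSet 40 Φ).card = ((({1, 9, 13, 17, 21, 29, 33, 37} : Finset (ZMod 40))).filter fun w => c * w ∉ residueSet 40 Φ).card))) :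
    ((¬(∀ c ∈ unitResidues 40, ((({1, 11, 21, 31} : Finset (ZMod 40))).filter fun w => c * w ∈ residueSet 40 Φ).card = ((({1, 11, 21, 31} : Finset (ZMod 40))).filter fun w => c * w ∉ residueSet 40 Φ).card) ∧
        ¬(∀ c ∈ unitResidues 40, ((({1, 19, 29, 31} : Finset (ZMod 40))).filter fun w => c * w ∈ residueSet 40 Φ).card = ((({1, 19, 29, 31} : Finset (ZMod 40))).filter fun w => c * w ∉ residueSet 40 Φ).card) ∧
        ¬(∀ c ∈ unitResidues 40, ((({1, 3, 7, 9, 21, 23, 27, 29} : Finset (ZMod 40))).filter fun w => c * w ∈ residueSet 40 Φ).card = ((({1, 3, 7, 9, 21, 23, 27, 29} : Finset (ZMod 40))).filter fun w => c * w ∉ residueSet 40 Φ).card) ∧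
        (∀ c ∈ unitResidues 40, ((({1, 3, 9, 11, 17, 19, 27, 33} : Finset (ZMod 40))).filter fun w => c * w ∈ residueSet 40 Φ).card = ((({1, 3, 9, 11, 17, 19, 27, 33} : Finset (ZMod 40))).filter fun w => c * w ∉ residueSet 40 Φ).card) ∧
        ¬(∀ c ∈ unitResidues 40, ((({1, 7, 9, 11, 13, 19, 23, 37} : Finset (ZMod 40))).filter fun w => c * w ∈ residueSet 40 Φ).card = ((({1, 7, 9, 11, 13, 19, 23, 37} : Finset (ZMod 40))).filter fun w => c * w ∉ residueSet 40 Φ).card) ∧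
        (∀ c ∈ unitResidues 40, ((({1, 9, 13, 17, 21, 29, 33, 37} : Finset (ZMod 40))).filter fun w => c * w ∈ residueSet 40 Φ).card = ((({1, 9, 13, 17, 21, 29, 33, 37} : Finset (ZMod 40))).filter fun w => c * w ∉ residueSet 40 Φ).card)) ∧ cmTypeRank Φ = 7) ∨
    ((¬(∀ c ∈ unitResidues 40, ((({1, 11, 21, 31} : Finset (ZMod 40))).filter fun w => c * w ∈ residueSet 40 Φ).card = ((({1, 11, 21, 31} : Finset (ZMod 40))).filter fun w => c * w ∉ residueSet 40 Φ).card) ∧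
        ¬(∀ c ∈ unitResidues 40, ((({1, 19, 29, 31} : Finset (ZMod 40))).filter fun w => c * w ∈ residueSet 40 Φ).card = ((({1, 19, 29, 31} : Finset (ZMod 40))).filter fun w => c * w ∉ residueSet 40 Φ).card) ∧
        ¬(∀ c ∈ unitResidues 40, ((({1, 3, 7, 9, 21, 23, 27, 29} : Finset (ZMod 40))).filter fun w => c * w ∈ residueSet 40 Φ).card = ((({1, 3, 7, 9, 21, 23, 27, 29} : Finset (ZMod 40))).filter fun w => c * w ∉ residueSet 40 Φ).card) ∧
        ¬(∀ c ∈ unitResidues 40, ((({1, 3, 9, 11, 17, 19, 27, 33} : Finset (ZMod 40))).filter fun w => c * w ∈ residueSet 40 Φ).card = ((({1, 3, 9, 11, 17, 19, 27, 33} : Finset (ZMod 40))).filter fun w => c * w ∉ residueSet 40 Φ).card) ∧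
        (∀ c ∈ unitResidues 40, ((({1, 7, 9, 11, 13, 19, 23, 37} : Finset (ZMod 40))).filter fun w => c * w ∈ residueSet 40 Φ).card = ((({1, 7, 9, 11, 13, 19, 23, 37} : Finset (ZMod 40))).filter fun w => c * w ∉ residueSet 40 Φ).card) ∧
        (∀ c ∈ unitResidues 40, ((({1, 9, 13, 17, 21, 29, 33, 37} : Finset (ZMod 40))).filter fun w => c * w ∈ residueSet 40 Φ).card = ((({1, 9, 13, 17, 21, 29, 33, 37} : Finset (ZMod 40))).filter fun w => c * w ∉ residueSet 40 Φ).card)) ∧ cmTypeRank Φ = 7) ∨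
    ((¬(∀ c ∈ unitResidues 40, ((({1, 11, 21, 31} : Finset (ZMod 40))).filter fun w => c * w ∈ residueSet 40 Φ).card = ((({1, 11, 21, 31} : Finset (ZMod 40))).filter fun w => c * w ∉ residueSet 40 Φ).card) ∧
        ¬(∀ c ∈ unitResidues 40, ((({1, 19, 29, 31} : Finset (ZMod 40))).filter fun w => c * w ∈ residueSet 40 Φ).card = ((({1, 19, 29, 31} : Finset (ZMod 40))).filter fun w => c * w ∉ residueSet 40 Φ).card) ∧
        (∀ c ∈ unitResidues 40, ((({1, 3, 7, 9, 21, 23, 27, 29} : Finset (ZMod 40))).filter fun w => c * w ∈ residueSet 40 Φ).card = ((({1, 3, 7, 9, 21, 23, 27, 29} : Finset (ZMod 40))).filter fun w => c * w ∉ residueSet 40 Φ).card) ∧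
        (∀ c ∈ unitResidues 40, ((({1, 3, 9, 11, 17, 19, 27, 33} : Finset (ZMod 40))).filter fun w => c * w ∈ residueSet 40 Φ).card = ((({1, 3, 9, 11, 17, 19, 27, 33} : Finset (ZMod 40))).filter fun w => c * w ∉ residueSet 40 Φ).card) ∧
        ¬(∀ c ∈ unitResidues 40, ((({1, 7, 9, 11, 13, 19, 23, 37} : Finset (ZMod 40))).filter fun w => c * w ∈ residueSet 40 Φ).card = ((({1, 7, 9, 11, 13, 19, 23, 37} : Finset (ZMod 40))).filter fun w => c * w ∉ residueSet 40 Φ).card) ∧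
        ¬(∀ c ∈ unitResidues 40, ((({1, 9, 13, 17, 21, 29, 33, 37} : Finset (ZMod 40))).filter fun w => c * w ∈ residueSet 40 Φ).card = ((({1, 9, 13, 17, 21, 29, 33, 37} : Finset (ZMod 40))).filter fun w => c * w ∉ residueSet 40 Φ).card)) ∧ cmTypeRank Φ = 7) ∨
    ((¬(∀ c ∈ unitResidues 40, ((({1, 11, 21, 31} : Finset (ZMod 40))).filter fun w => c * w ∈ residueSet 40 Φ).card = ((({1, 11, 21, 31} : Finset (ZMod 40))).filter fun w => c * w ∉ residueSet 40 Φ).card) ∧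
        ¬(∀ c ∈ unitResidues 40, ((({1, 19, 29, 31} : Finset (ZMod 40))).filter fun w => c * w ∈ residueSet 40 Φ).card = ((({1, 19, 29, 31} : Finset (ZMod 40))).filter fun w => c * w ∉ residueSet 40 Φ).card) ∧
        (∀ c ∈ unitResidues 40, ((({1, 3, 7, 9, 21, 23, 27, 29} : Finset (ZMod 40))).filter fun w => c * w ∈ residueSet 40 Φ).card = ((({1, 3, 7, 9, 21, 23, 27, 29} : Finset (ZMod 40))).filter fun w => c * w ∉ residueSet 40 Φ).card) ∧
        ¬(∀ c ∈ unitResidues 40, ((({1, 3, 9, 11, 17, 19, 27, 33} : Finset (ZMod 40))).filter fun w => c * w ∈ residueSet 40 Φ).card = ((({1, 3, 9, 11, 17, 19, 27, 33} : Finset (ZMod 40))).filter fun w => c * w ∉ residueSet 40 Φ).card) ∧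
        (∀ c ∈ unitResidues 40, ((({1, 7, 9, 11, 13, 19, 23, 37} : Finset (ZMod 40))).filter fun w => c * w ∈ residueSet 40 Φ).card = ((({1, 7, 9, 11, 13, 19, 23, 37} : Finset (ZMod 40))).filter fun w => c * w ∉ residueSet 40 Φ).card) ∧
        ¬(∀ c ∈ unitResidues 40, ((({1, 9, 13, 17, 21, 29, 33, 37} : Finset (ZMod 40))).filter fun w => c * w ∈ residueSet 40 Φ).card = ((({1, 9, 13, 17, 21, 29, 33, 37} : Finset (ZMod 40))).filter fun w => c * w ∉ residueSet 40 Φ).card)) ∧ cmTypeRank Φ = 7) := by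
  obtain ⟨⟨hu0, h10, hm0, hn0, hc0⟩, ⟨hu1, h11, hm1, hn1, hc1⟩, ⟨hu2, h12, hm2, hn2, hc2⟩, ⟨hu3, h13, hm3, hn3, hc3⟩, ⟨hu4, h14, hm4, hn4, hc4⟩, ⟨hu5, h15, hm5, hn5, hc5⟩, ⟨hu6, h16, hm6, hn6, hc6⟩, ⟨hu7, h17, hm7, hn7, hc7⟩, ⟨hu8, h18, hm8, hn8, hc8⟩, ⟨hu9, h19, hm9, hn9, hc9⟩⟩ := subgroups_forty
  obtain ⟨hb0, hb1, hb2, hb3, hb4, hb5, hb6, hb7, hb8, hb9, hb10, hb11⟩ := cosetBalanced_reps_forty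
  obtain ⟨hnb0, hnb1, hnb2, hnb3, hnb4, hnb5, hnb6, hnb7, hnb8, hnb9, hnb10, hnb11, hnb12, hnb13, hnb14, hnb15⟩ := not_cosetBalanced_deg_reps_forty
  obtain ⟨Ψ, hΨ, hT⟩ := (exists_isAutTransform_forty Φ φ₀).2.1 hp hb
  rw [cmTypeRank_eq_of_isAutTransform hT]
  -- balance transports along the family in both directions
  have fwd : ∀ {W : Finset (ZMod 40)}, W ⊆ unitResidues 40 →
      (∀ c ∈ unitResidues 40, (W.filter fun w => c * w ∈ residueSet 40 Ψ).card = (W.filter fun w => c * w ∉ residueSet 40 Ψ).card) →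
      (∀ c ∈ unitResidues 40, (W.filter fun w => c * w ∈ residueSet 40 Φ).card = (W.filter fun w => c * w ∉ residueSet 40 Φ).card) :=
    fun {W} hWu h ↦ cosetBalanced_of_isAutTransform hT hWu h
  have bwd : ∀ {W : Finset (ZMod 40)}, W ⊆ unitResidues 40 →
      ¬(∀ c ∈ unitResidues 40, (W.filter fun w => c * w ∈ residueSet 40 Ψ).card = (W.filter fun w => c * w ∉ residueSet 40 Ψ).card) →
      ¬(∀ c ∈ unitResidues 40, (W.filter fun w => c * w ∈ residueSet 40 Φ).card = (W.filter fun w => c * w ∉ residueSet 40 Φ).card) :=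
    fun {W} hWu h h' ↦ h (cosetBalanced_of_isAutTransform hT.symm hWu h')
  simp only [Finset.mem_insert, Finset.mem_singleton] at hΨ
  rcases hΨ with h | h | h | h
  · refine Or.inl ?_
    exact ⟨⟨bwd hu0 (by rw [h]; exact hnb0), bwd hu1 (by rw [h]; exact hnb1), bwd hu2 (by rw [h]; exact hnb2), fwd hu3 (by rw [h]; exact hb0), bwd hu4 (by rw [h]; exact hnb3), fwd hu5 (by rw [h]; exact hb1)⟩, cmTypeRank_eq_of_residueSet_eq_D1_forty Ψ h⟩
  · refine Or.inr (Or.inl ?_)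
    exact ⟨⟨bwd hu0 (by rw [h]; exact hnb4), bwd hu1 (by rw [h]; exact hnb5), bwd hu2 (by rw [h]; exact hnb6), bwd hu3 (by rw [h]; exact hnb7), fwd hu4 (by rw [h]; exact hb3), fwd hu5 (by rw [h]; exact hb4)⟩, cmTypeRank_eq_of_residueSet_eq_D2_forty Ψ h⟩
  · refine Or.inr (Or.inr (Or.inl ?_))
    exact ⟨⟨bwd hu0 (by rw [h]; exact hnb8), bwd hu1 (by rw [h]; exact hnb9), fwd hu2 (by rw [h]; exact hb6), fwd hu3 (by rw [h]; exact hb7), bwd hu4 (by rw [h]; exact hnb10), bwd hu5 (by rw [h]; exact hnb11)⟩, cmTypeRank_eq_of_residueSet_eq_D3_forty Ψ h⟩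
  · refine Or.inr (Or.inr (Or.inr (?_)))
    exact ⟨⟨bwd hu0 (by rw [h]; exact hnb12), bwd hu1 (by rw [h]; exact hnb13), fwd hu2 (by rw [h]; exact hb9), bwd hu3 (by rw [h]; exact hnb14), fwd hu4 (by rw [h]; exact hb10), bwd hu5 (by rw [h]; exact hnb15)⟩, cmTypeRank_eq_of_residueSet_eq_D4_forty Ψ h⟩

/-- **THE RANKS OF THE IMPRIMITIVE TYPES OF `ℚ(ζ₄₀)`: `5`, `3`, `2` according as the residue stabiliser has order `2`, `4`, `8`.**
[cite: Kubota1965, §2 (p. 115)] [cite: KoblitzRohrlich1978, §1 p. 1184] [cite: Shimura1998, §8.2 Prop. 26] -/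
theorem cmTypeRank_of_not_isPrimitive_forty (Φ : CMType K) (φ₀ : K →+* ℂ) (hΦ : ¬IsPrimitive (ℂ ≃+* ℂ) Φ.1 φ₀) :
    (((unitResidues 40).filter fun t => ∀ c ∈ unitResidues 40, (c * t ∈ residueSet 40 Φ ↔ c ∈ residueSet 40 Φ)).card = 2 ∧ cmTypeRank Φ = 5) ∨
    (((unitResidues 40).filter fun t => ∀ c ∈ unitResidues 40, (c * t ∈ residueSet 40 Φ ↔ c ∈ residueSet 40 Φ)).card = 4 ∧ cmTypeRank Φ = 3) ∨
    (((unitResidues 40).filter fun t => ∀ c ∈ unitResidues 40, (c * t ∈ residueSet 40 Φ ↔ c ∈ residueSet 40 Φ)).card = 8 ∧ cmTypeRank Φ = 2) := by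
  rcases card_stabilizer_of_not_isPrimitive_forty Φ φ₀ hΦ with h2 | h4 | h8
  · refine Or.inl ⟨h2, ?_⟩
    obtain ⟨Ψ, hΨ, hT⟩ := (exists_isAutTransform_forty Φ φ₀).2.2 hΦ
    obtain ⟨⟨hs0, hi0⟩, ⟨hs1, hi1⟩, ⟨hs2, hi2⟩, ⟨hs3, hi3⟩, ⟨hs4, hi4⟩, ⟨hs5, hi5⟩, ⟨hs6, hi6⟩, ⟨hs7, hi7⟩, ⟨hs8, hi8⟩, ⟨hs9, hi9⟩, ⟨hs10, hi10⟩, ⟨hs11, hi11⟩⟩ := stabilizer_reps_forty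
    have hstab := filter_stabilizer_eq_of_isAutTransform_forty hT
    rw [cmTypeRank_eq_of_isAutTransform hT]
    rw [hstab] at h2
    simp only [Finset.mem_insert, Finset.mem_singleton] at hΨ
    rcases hΨ with h | h | h | h | h | h | h | h | h | h | h | h
    · exact cmTypeRank_eq_of_residueSet_eq_I1_forty Ψ h
    · exact cmTypeRank_eq_of_residueSet_eq_I2_forty Ψ h
    · exact cmTypeRank_eq_of_residueSet_eq_I3_forty Ψ h
    · exact cmTypeRank_eq_of_residueSet_eq_I4_forty Ψ h
    · exact cmTypeRank_eq_of_residueSet_eq_I5_forty Ψ h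
    · exact cmTypeRank_eq_of_residueSet_eq_I6_forty Ψ h
    · exact absurd h2 (by rw [h, hs6]; decide +kernel)
    · exact absurd h2 (by rw [h, hs7]; decide +kernel)
    · exact absurd h2 (by rw [h, hs8]; decide +kernel)
    · exact absurd h2 (by rw [h, hs9]; decide +kernel)
    · exact absurd h2 (by rw [h, hs10]; decide +kernel)
    · exact absurd h2 (by rw [h, hs11]; decide +kernel)
  · exact Or.inr (Or.inl ⟨h4, cmTypeRank_eq_three_of_card_stabilizer_eq_four_forty Φ h4⟩)
  · exact Or.inr (Or.inr ⟨h8, cmTypeRank_eq_two_of_card_stabilizer_eq_eight_forty Φ h8⟩)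

omit [IsCyclotomicExtension {40} ℚ K] in
/-- **`Rank ∈ {9, 7, 5, 3, 2}` for every CM type of `ℚ(ζ₄₀)`.** [cite: Gordon1999HodgeAVSurvey, §9.4.1–9.4.3] [cite: Kubota1965, §2] -/
theorem cmTypeRank_mem_forty (hK : IsCyclotomicExtension {40} ℚ K) (Φ : CMType K) : cmTypeRank Φ = 9 ∨ cmTypeRank Φ = 7 ∨ cmTypeRank Φ = 5 ∨ cmTypeRank Φ = 3 ∨ cmTypeRank Φ = 2 := by
  obtain ⟨φ₀⟩ : Nonempty (K →+* ℂ) := inferInstance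
  by_cases hb : ((∀ c ∈ unitResidues 40, ((({1, 11, 21, 31} : Finset (ZMod 40))).filter fun w => c * w ∈ residueSet 40 Φ).card = ((({1, 11, 21, 31} : Finset (ZMod 40))).filter fun w => c * w ∉ residueSet 40 Φ).card) ∨
      (∀ c ∈ unitResidues 40, ((({1, 19, 29, 31} : Finset (ZMod 40))).filter fun w => c * w ∈ residueSet 40 Φ).card = ((({1, 19, 29, 31} : Finset (ZMod 40))).filter fun w => c * w ∉ residueSet 40 Φ).card) ∨
      (∀ c ∈ unitResidues 40, ((({1, 3, 7, 9, 21, 23, 27, 29} : Finset (ZMod 40))).filter fun w => c * w ∈ residueSet 40 Φ).card = ((({1, 3, 7, 9, 21, 23, 27, 29} : Finset (ZMod 40))).filter fun w => c * w ∉ residueSet 40 Φ).card) ∨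
      (∀ c ∈ unitResidues 40, ((({1, 3, 9, 11, 17, 19, 27, 33} : Finset (ZMod 40))).filter fun w => c * w ∈ residueSet 40 Φ).card = ((({1, 3, 9, 11, 17, 19, 27, 33} : Finset (ZMod 40))).filter fun w => c * w ∉ residueSet 40 Φ).card) ∨
      (∀ c ∈ unitResidues 40, ((({1, 7, 9, 11, 13, 19, 23, 37} : Finset (ZMod 40))).filter fun w => c * w ∈ residueSet 40 Φ).card = ((({1, 7, 9, 11, 13, 19, 23, 37} : Finset (ZMod 40))).filter fun w => c * w ∉ residueSet 40 Φ).card) ∨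
      (∀ c ∈ unitResidues 40, ((({1, 9, 13, 17, 21, 29, 33, 37} : Finset (ZMod 40))).filter fun w => c * w ∈ residueSet 40 Φ).card = ((({1, 9, 13, 17, 21, 29, 33, 37} : Finset (ZMod 40))).filter fun w => c * w ∉ residueSet 40 Φ).card))
  · by_cases hp : IsPrimitive (ℂ ≃+* ℂ) Φ.1 φ₀
    · rcases cmTypeRank_of_isPrimitive_of_cosetBalanced_forty Φ φ₀ hp hb with ⟨-, h⟩ | ⟨-, h⟩ | ⟨-, h⟩ | ⟨-, h⟩ <;> rw [h] <;> decide
    · rcases cmTypeRank_of_not_isPrimitive_forty Φ φ₀ hp with ⟨-, h⟩ | ⟨-, h⟩ | ⟨-, h⟩ <;> rw [h] <;> decide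
  · have h := cmTypeRank_eq_nine_of_not_cosetBalanced_forty Φ hb
    rw [h]; decide

omit [IsCyclotomicExtension {40} ℚ K] in
/-- **Primitive ⟺ `Rank ≥ 7`**, for the CM types of `ℚ(ζ₄₀)` (primitive ranks `9, 7`, imprimitive ranks `5, 3, 2`).
[cite: Shimura1998, §8.2 Prop. 26] [cite: Kubota1965, §2] -/
theorem isPrimitive_iff_seven_le_cmTypeRank_forty (hK : IsCyclotomicExtension {40} ℚ K) (Φ : CMType K) (φ₀ : K →+* ℂ) :
    IsPrimitive (ℂ ≃+* ℂ) Φ.1 φ₀ ↔ 7 ≤ cmTypeRank Φ := by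
  constructor
  · intro hp
    by_cases hb : ((∀ c ∈ unitResidues 40, ((({1, 11, 21, 31} : Finset (ZMod 40))).filter fun w => c * w ∈ residueSet 40 Φ).card = ((({1, 11, 21, 31} : Finset (ZMod 40))).filter fun w => c * w ∉ residueSet 40 Φ).card) ∨
      (∀ c ∈ unitResidues 40, ((({1, 19, 29, 31} : Finset (ZMod 40))).filter fun w => c * w ∈ residueSet 40 Φ).card = ((({1, 19, 29, 31} : Finset (ZMod 40))).filter fun w => c * w ∉ residueSet 40 Φ).card) ∨
      (∀ c ∈ unitResidues 40, ((({1, 3, 7, 9, 21, 23, 27, 29} : Finset (ZMod 40))).filter fun w => c * w ∈ residueSet 40 Φ).card = ((({1, 3, 7, 9, 21, 23, 27, 29} : Finset (ZMod 40))).filter fun w => c * w ∉ residueSet 40 Φ).card) ∨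
      (∀ c ∈ unitResidues 40, ((({1, 3, 9, 11, 17, 19, 27, 33} : Finset (ZMod 40))).filter fun w => c * w ∈ residueSet 40 Φ).card = ((({1, 3, 9, 11, 17, 19, 27, 33} : Finset (ZMod 40))).filter fun w => c * w ∉ residueSet 40 Φ).card) ∨
      (∀ c ∈ unitResidues 40, ((({1, 7, 9, 11, 13, 19, 23, 37} : Finset (ZMod 40))).filter fun w => c * w ∈ residueSet 40 Φ).card = ((({1, 7, 9, 11, 13, 19, 23, 37} : Finset (ZMod 40))).filter fun w => c * w ∉ residueSet 40 Φ).card) ∨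
      (∀ c ∈ unitResidues 40, ((({1, 9, 13, 17, 21, 29, 33, 37} : Finset (ZMod 40))).filter fun w => c * w ∈ residueSet 40 Φ).card = ((({1, 9, 13, 17, 21, 29, 33, 37} : Finset (ZMod 40))).filter fun w => c * w ∉ residueSet 40 Φ).card))
    · rcases cmTypeRank_of_isPrimitive_of_cosetBalanced_forty Φ φ₀ hp hb with ⟨-, h⟩ | ⟨-, h⟩ | ⟨-, h⟩ | ⟨-, h⟩ <;> omega
    · have h := cmTypeRank_eq_nine_of_not_cosetBalanced_forty Φ hb
      omega
  · intro h7
    by_contra hp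
    rcases cmTypeRank_of_not_isPrimitive_forty Φ φ₀ hp with ⟨-, h⟩ | ⟨-, h⟩ | ⟨-, h⟩ <;> omega

end Types

/-! ### §2 Abelian varieties with complex multiplication by `ℚ(ζ₄₀)` -/

section Varieties

variable {K : Type} [Field K] [NumberField K]
  {A : AbelianVariety ℂ} {ι : 𝓞 K →+* End A} {θ : K →+* Module.End ℂ (complexBetti A.X 1)}

/-- `dim A = 8` for a realisation of a CM type of `ℚ(ζ₄₀)`. [cite: Shimura1998, §6.2 Theorem 3] -/
theorem dim_eq_eight_of_isCMTypeRealisation_forty (hK : IsCyclotomicExtension {40} ℚ K) {Φ : CMType K} (hA : IsCMTypeRealisation Φ A ι θ) :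
    A.dim = 8 := by
  have h := Literature.AlgebraicGeometry.Motives.schemeDim_eq_holds hA.1
  rw [finrank_eq_sixteen₈ K] at h
  exact h

/-- **`Bᵐ(Aⁿ) ⊗ ℂ = Dᵐ(Aⁿ) ⊗ ℂ` FOR ALL `n, m`, FOR EVERY TYPE OF `ℚ(ζ₄₀)` THAT IS NOT A PRIMITIVE COSET-BALANCED ONE** (`192` of the `256` types:
nondegenerate, or imprimitive and then induced from a NONDEGENERATE type of an octic, quartic or quadratic CM subfield).
[cite: Gordon1999HodgeAVSurvey, Thm. 6.4 and §9.3] [cite: Kubota1965, §2] -/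
theorem hodgeClassSpan_pow_eq_divisorClassesSpan_of_forty (hK : IsCyclotomicExtension {40} ℚ K) (Φ : CMType K) (φ₀ : K →+* ℂ)
    (h : IsPrimitive (ℂ ≃+* ℂ) Φ.1 φ₀ →
      ¬((∀ c ∈ unitResidues 40, ((({1, 11, 21, 31} : Finset (ZMod 40))).filter fun w => c * w ∈ residueSet 40 Φ).card = ((({1, 11, 21, 31} : Finset (ZMod 40))).filter fun w => c * w ∉ residueSet 40 Φ).card) ∨
      (∀ c ∈ unitResidues 40, ((({1, 19, 29, 31} : Finset (ZMod 40))).filter fun w => c * w ∈ residueSet 40 Φ).card = ((({1, 19, 29, 31} : Finset (ZMod 40))).filter fun w => c * w ∉ residueSet 40 Φ).card) ∨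
      (∀ c ∈ unitResidues 40, ((({1, 3, 7, 9, 21, 23, 27, 29} : Finset (ZMod 40))).filter fun w => c * w ∈ residueSet 40 Φ).card = ((({1, 3, 7, 9, 21, 23, 27, 29} : Finset (ZMod 40))).filter fun w => c * w ∉ residueSet 40 Φ).card) ∨
      (∀ c ∈ unitResidues 40, ((({1, 3, 9, 11, 17, 19, 27, 33} : Finset (ZMod 40))).filter fun w => c * w ∈ residueSet 40 Φ).card = ((({1, 3, 9, 11, 17, 19, 27, 33} : Finset (ZMod 40))).filter fun w => c * w ∉ residueSet 40 Φ).card) ∨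
      (∀ c ∈ unitResidues 40, ((({1, 7, 9, 11, 13, 19, 23, 37} : Finset (ZMod 40))).filter fun w => c * w ∈ residueSet 40 Φ).card = ((({1, 7, 9, 11, 13, 19, 23, 37} : Finset (ZMod 40))).filter fun w => c * w ∉ residueSet 40 Φ).card) ∨
      (∀ c ∈ unitResidues 40, ((({1, 9, 13, 17, 21, 29, 33, 37} : Finset (ZMod 40))).filter fun w => c * w ∈ residueSet 40 Φ).card = ((({1, 9, 13, 17, 21, 29, 33, 37} : Finset (ZMod 40))).filter fun w => c * w ∉ residueSet 40 Φ).card)))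
    (hA : IsCMTypeRealisation Φ A ι θ) (n m : ℕ) :
    hodgeClassSpan (⨁ fun _ : Fin n => A).dim (⨁ fun _ : Fin n => A).X m =
      divisorClassesSpan (⨁ fun _ : Fin n => A).X (⨁ fun _ : Fin n => A).dim m := by
  haveI := isCMField₈ K
  by_cases hΦ : IsPrimitive (ℂ ≃+* ℂ) Φ.1 φ₀
  · exact ((isNondegenerate_iff_not_cosetBalanced_forty hK Φ).2 (h hΦ)).hodgeClassSpan_pow_eq_divisorClassesSpan hA n m
  · rcases cmTypeRank_of_not_isPrimitive_forty Φ φ₀ hΦ with ⟨hs, hr⟩ | ⟨hs, hr⟩ | ⟨hs, hr⟩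
    · exact hodgeClassSpan_pow_eq_divisorClassesSpan_of_card_stabilizer_mul_eq (N := 40) (by norm_num) Φ (k := 4)
        (by rw [hs]; decide +kernel) hr hA n m
    · exact hodgeClassSpan_pow_eq_divisorClassesSpan_of_card_stabilizer_mul_eq (N := 40) (by norm_num) Φ (k := 2)
        (by rw [hs]; decide +kernel) hr hA n m
    · exact hodgeClassSpan_pow_eq_divisorClassesSpan_of_card_stabilizer_mul_eq (N := 40) (by norm_num) Φ (k := 1)
        (by rw [hs]; decide +kernel) hr hA n m

/-- `Bᵐ ⊗ ℂ = Dᵐ ⊗ ℂ` for all `m` on an abelian variety gives the Hodge conjecture for it. [cite: Gordon1999HodgeAVSurvey, §9.3] -/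
private theorem hodgeConjectureFor_of_forall_hodgeClassSpan_eq₈ (B : AbelianVariety ℂ)
    (h : ∀ m : ℕ, hodgeClassSpan B.dim B.X m = divisorClassesSpan B.X B.dim m) : HodgeConjectureFor B.dim B.X :=
  ⟨Literature.AlgebraicGeometry.HodgeTheory.nonempty_hodgeModel_holds
      (Literature.AlgebraicGeometry.Motives.AbelianVariety.isSmoothProjective_holds (A := B)),
    fun m _ hc hmm ↦ Literature.AlgebraicGeometry.HodgeTheory.AbelianVariety.divisorClassesSpan_le_algebraicClasses B
      (fun b hb hb' ↦ Literature.AlgebraicGeometry.HodgeTheory.lefschetzOneOne_rational_holds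
        (Literature.AlgebraicGeometry.Motives.AbelianVariety.isSmoothProjective_holds (A := B)) b hb hb') m
      ((h m) ▸ Submodule.subset_span ⟨hc, hmm⟩)⟩

/-- **THE HODGE CONJECTURE FOR EVERY POWER OF EVERY ABELIAN VARIETY WITH COMPLEX MULTIPLICATION BY `ℚ(ζ₄₀)` WHOSE TYPE IS NOT A PRIMITIVE
COSET-BALANCED ONE** (`192` of the `256` types), unconditionally. [cite: Gordon1999HodgeAVSurvey, Thm. 6.4 and §9.3] -/
theorem hodgeConjectureFor_pow_of_forty (hK : IsCyclotomicExtension {40} ℚ K) (Φ : CMType K) (φ₀ : K →+* ℂ)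
    (h : IsPrimitive (ℂ ≃+* ℂ) Φ.1 φ₀ →
      ¬((∀ c ∈ unitResidues 40, ((({1, 11, 21, 31} : Finset (ZMod 40))).filter fun w => c * w ∈ residueSet 40 Φ).card = ((({1, 11, 21, 31} : Finset (ZMod 40))).filter fun w => c * w ∉ residueSet 40 Φ).card) ∨
      (∀ c ∈ unitResidues 40, ((({1, 19, 29, 31} : Finset (ZMod 40))).filter fun w => c * w ∈ residueSet 40 Φ).card = ((({1, 19, 29, 31} : Finset (ZMod 40))).filter fun w => c * w ∉ residueSet 40 Φ).card) ∨
      (∀ c ∈ unitResidues 40, ((({1, 3, 7, 9, 21, 23, 27, 29} : Finset (ZMod 40))).filter fun w => c * w ∈ residueSet 40 Φ).card = ((({1, 3, 7, 9, 21, 23, 27, 29} : Finset (ZMod 40))).filter fun w => c * w ∉ residueSet 40 Φ).card) ∨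
      (∀ c ∈ unitResidues 40, ((({1, 3, 9, 11, 17, 19, 27, 33} : Finset (ZMod 40))).filter fun w => c * w ∈ residueSet 40 Φ).card = ((({1, 3, 9, 11, 17, 19, 27, 33} : Finset (ZMod 40))).filter fun w => c * w ∉ residueSet 40 Φ).card) ∨
      (∀ c ∈ unitResidues 40, ((({1, 7, 9, 11, 13, 19, 23, 37} : Finset (ZMod 40))).filter fun w => c * w ∈ residueSet 40 Φ).card = ((({1, 7, 9, 11, 13, 19, 23, 37} : Finset (ZMod 40))).filter fun w => c * w ∉ residueSet 40 Φ).card) ∨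
      (∀ c ∈ unitResidues 40, ((({1, 9, 13, 17, 21, 29, 33, 37} : Finset (ZMod 40))).filter fun w => c * w ∈ residueSet 40 Φ).card = ((({1, 9, 13, 17, 21, 29, 33, 37} : Finset (ZMod 40))).filter fun w => c * w ∉ residueSet 40 Φ).card)))
    (hA : IsCMTypeRealisation Φ A ι θ) (n : ℕ) :
    HodgeConjectureFor (⨁ fun _ : Fin n => A).dim (⨁ fun _ : Fin n => A).X :=
  hodgeConjectureFor_of_forall_hodgeClassSpan_eq₈ _ (fun m ↦ hodgeClassSpan_pow_eq_divisorClassesSpan_of_forty hK Φ φ₀ h hA n m)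

/-- **EVERY REALISATION OF A PRIMITIVE TYPE OF `ℚ(ζ₄₀)` COSET-BALANCED FOR A MAXIMAL `(−1)`-FREE SUBGROUP OF ORDER `8` IS A SIMPLE ABELIAN `8`-FOLD
CARRYING RATIONAL `(4,4)`-CLASSES OUTSIDE `D⁴(A) ⊗ ℂ`** — the Weil classes of `(A, k)`, `k` the imaginary quadratic fixed field
(ℚ(√−5), ℚ(√−2), ℚ(√−10), ℚ(i)), acting with multiplicities `(4,4)`; `dim B⁴ − dim D⁴ ≥ 2`.
[cite: Gordon1999HodgeAVSurvey, 5.13 (ii) and 9.2.2] [cite: vanGeemen1994HodgeAV, Thm. 4.5 and 4.7] [cite: Pohlmann1968, §3] [cite: Shimura1998, §8.2 Prop. 26] -/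
theorem exists_exceptional_four_of_cosetBalanced_forty (hK : IsCyclotomicExtension {40} ℚ K) (Φ : CMType K) (φ₀ : K →+* ℂ)
    (hΦ : IsPrimitive (ℂ ≃+* ℂ) Φ.1 φ₀)
    (hbal : (∀ c ∈ unitResidues 40, ((({1, 3, 7, 9, 21, 23, 27, 29} : Finset (ZMod 40))).filter fun w => c * w ∈ residueSet 40 Φ).card = ((({1, 3, 7, 9, 21, 23, 27, 29} : Finset (ZMod 40))).filter fun w => c * w ∉ residueSet 40 Φ).card) ∨
      (∀ c ∈ unitResidues 40, ((({1, 3, 9, 11, 17, 19, 27, 33} : Finset (ZMod 40))).filter fun w => c * w ∈ residueSet 40 Φ).card = ((({1, 3, 9, 11, 17, 19, 27, 33} : Finset (ZMod 40))).filter fun w => c * w ∉ residueSet 40 Φ).card) ∨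
      (∀ c ∈ unitResidues 40, ((({1, 7, 9, 11, 13, 19, 23, 37} : Finset (ZMod 40))).filter fun w => c * w ∈ residueSet 40 Φ).card = ((({1, 7, 9, 11, 13, 19, 23, 37} : Finset (ZMod 40))).filter fun w => c * w ∉ residueSet 40 Φ).card) ∨
      (∀ c ∈ unitResidues 40, ((({1, 9, 13, 17, 21, 29, 33, 37} : Finset (ZMod 40))).filter fun w => c * w ∈ residueSet 40 Φ).card = ((({1, 9, 13, 17, 21, 29, 33, 37} : Finset (ZMod 40))).filter fun w => c * w ∉ residueSet 40 Φ).card))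
    (hA : IsCMTypeRealisation Φ A ι θ) :
    A.IsSimple ∧ A.dim = 8 ∧
      (∃ c : complexBetti A.X (2 * 4), IsRationalClass c ∧ IsOfHodgeType 8 A.X (2 * 4) 4 4 c ∧ c ∉ divisorClassesSpan A.X 8 4) ∧
      2 ≤ Module.finrank ℂ ↥(hodgeClassSpan 8 A.X 4) - Module.finrank ℂ ↥(divisorClassesSpan A.X 8 4) := by
  obtain ⟨⟨hu0, h10, hm0, hn0, hc0⟩, ⟨hu1, h11, hm1, hn1, hc1⟩, ⟨hu2, h12, hm2, hn2, hc2⟩, ⟨hu3, h13, hm3, hn3, hc3⟩, ⟨hu4, h14, hm4, hn4, hc4⟩, ⟨hu5, h15, hm5, hn5, hc5⟩, ⟨hu6, h16, hm6, hn6, hc6⟩, ⟨hu7, h17, hm7, hn7, hc7⟩, ⟨hu8, h18, hm8, hn8, hc8⟩, ⟨hu9, h19, hm9, hn9, hc9⟩⟩ := subgroups_forty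
  have hprim : HasTrivialStabilizer 40 (residueSet 40 Φ) := (isPrimitive_iff_hasTrivialStabilizer 40 Φ φ₀).1 hΦ
  have htot : Nat.totient 40 / 2 = 8 := by decide +kernel
  refine ⟨isSimple_of_isCMTypeRealisation_of_isPrimitive hA φ₀ hΦ, dim_eq_eight_of_isCMTypeRealisation_forty hK hA, ?_, ?_⟩
  · rcases hbal with hb | hb | hb | hb
    · obtain ⟨c, hcQ, hcH, hcD⟩ := exists_exceptional_of_cosetBalanced hu2 h12 hm2 hn2 hb hprim hc2 hA
      rw [htot] at hcH hcD
      exact ⟨c, hcQ, hcH, hcD⟩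
    · obtain ⟨c, hcQ, hcH, hcD⟩ := exists_exceptional_of_cosetBalanced hu3 h13 hm3 hn3 hb hprim hc3 hA
      rw [htot] at hcH hcD
      exact ⟨c, hcQ, hcH, hcD⟩
    · obtain ⟨c, hcQ, hcH, hcD⟩ := exists_exceptional_of_cosetBalanced hu4 h14 hm4 hn4 hb hprim hc4 hA
      rw [htot] at hcH hcD
      exact ⟨c, hcQ, hcH, hcD⟩
    · obtain ⟨c, hcQ, hcH, hcD⟩ := exists_exceptional_of_cosetBalanced hu5 h15 hm5 hn5 hb hprim hc5 hA
      rw [htot] at hcH hcD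
      exact ⟨c, hcQ, hcH, hcD⟩
  · rcases hbal with hb | hb | hb | hb
    · have h := two_le_finrank_hodgeClassSpan_sub_finrank_divisorClassesSpan_of_cosetBalanced hu2 h12 hm2 hn2 hb hprim hc2 hA
      rwa [htot] at h
    · have h := two_le_finrank_hodgeClassSpan_sub_finrank_divisorClassesSpan_of_cosetBalanced hu3 h13 hm3 hn3 hb hprim hc3 hA
      rwa [htot] at h
    · have h := two_le_finrank_hodgeClassSpan_sub_finrank_divisorClassesSpan_of_cosetBalanced hu4 h14 hm4 hn4 hb hprim hc4 hA
      rwa [htot] at h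
    · have h := two_le_finrank_hodgeClassSpan_sub_finrank_divisorClassesSpan_of_cosetBalanced hu5 h15 hm5 hn5 hb hprim hc5 hA
      rwa [htot] at h

/-- **EVERY REALISATION OF A PRIMITIVE TYPE OF `ℚ(ζ₄₀)` COSET-BALANCED FOR A `(−1)`-FREE SUBGROUP OF ORDER `4` IS A SIMPLE ABELIAN `8`-FOLD CARRYING
RATIONAL `(2,2)`-CLASSES OUTSIDE `D²(A) ⊗ ℂ`** — the generalised Weil classes of `(A, k)` for the quartic CM fixed field `k` of `W`, in `H⁴`;
`dim B² − dim D² ≥ 2`. [cite: Gordon1999HodgeAVSurvey, 5.13 (ii), 9.2.2 and 9.4.3] [cite: vanGeemen1994HodgeAV, Thm. 4.5 and 4.7] [cite: Pohlmann1968, §3] -/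
theorem exists_exceptional_two_of_cosetBalanced_forty (hK : IsCyclotomicExtension {40} ℚ K) (Φ : CMType K) (φ₀ : K →+* ℂ)
    (hΦ : IsPrimitive (ℂ ≃+* ℂ) Φ.1 φ₀)
    (hbal : (∀ c ∈ unitResidues 40, ((({1, 11, 21, 31} : Finset (ZMod 40))).filter fun w => c * w ∈ residueSet 40 Φ).card = ((({1, 11, 21, 31} : Finset (ZMod 40))).filter fun w => c * w ∉ residueSet 40 Φ).card) ∨
      (∀ c ∈ unitResidues 40, ((({1, 19, 29, 31} : Finset (ZMod 40))).filter fun w => c * w ∈ residueSet 40 Φ).card = ((({1, 19, 29, 31} : Finset (ZMod 40))).filter fun w => c * w ∉ residueSet 40 Φ).card) ∨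
      (∀ c ∈ unitResidues 40, ((({1, 9, 17, 33} : Finset (ZMod 40))).filter fun w => c * w ∈ residueSet 40 Φ).card = ((({1, 9, 17, 33} : Finset (ZMod 40))).filter fun w => c * w ∉ residueSet 40 Φ).card) ∨
      (∀ c ∈ unitResidues 40, ((({1, 9, 13, 37} : Finset (ZMod 40))).filter fun w => c * w ∈ residueSet 40 Φ).card = ((({1, 9, 13, 37} : Finset (ZMod 40))).filter fun w => c * w ∉ residueSet 40 Φ).card) ∨
      (∀ c ∈ unitResidues 40, ((({1, 3, 9, 27} : Finset (ZMod 40))).filter fun w => c * w ∈ residueSet 40 Φ).card = ((({1, 3, 9, 27} : Finset (ZMod 40))).filter fun w => c * w ∉ residueSet 40 Φ).card) ∨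
      (∀ c ∈ unitResidues 40, ((({1, 7, 9, 23} : Finset (ZMod 40))).filter fun w => c * w ∈ residueSet 40 Φ).card = ((({1, 7, 9, 23} : Finset (ZMod 40))).filter fun w => c * w ∉ residueSet 40 Φ).card))
    (hA : IsCMTypeRealisation Φ A ι θ) :
    A.IsSimple ∧ A.dim = 8 ∧
      (∃ c : complexBetti A.X (2 * 2), IsRationalClass c ∧ IsOfHodgeType 8 A.X (2 * 2) 2 2 c ∧ c ∉ divisorClassesSpan A.X 8 2) ∧
      2 ≤ Module.finrank ℂ ↥(hodgeClassSpan 8 A.X 2) - Module.finrank ℂ ↥(divisorClassesSpan A.X 8 2) := by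
  obtain ⟨⟨hu0, h10, hm0, hn0, hc0⟩, ⟨hu1, h11, hm1, hn1, hc1⟩, ⟨hu2, h12, hm2, hn2, hc2⟩, ⟨hu3, h13, hm3, hn3, hc3⟩, ⟨hu4, h14, hm4, hn4, hc4⟩, ⟨hu5, h15, hm5, hn5, hc5⟩, ⟨hu6, h16, hm6, hn6, hc6⟩, ⟨hu7, h17, hm7, hn7, hc7⟩, ⟨hu8, h18, hm8, hn8, hc8⟩, ⟨hu9, h19, hm9, hn9, hc9⟩⟩ := subgroups_forty
  have hprim : HasTrivialStabilizer 40 (residueSet 40 Φ) := (isPrimitive_iff_hasTrivialStabilizer 40 Φ φ₀).1 hΦ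
  have htot : Nat.totient 40 / 2 = 8 := by decide +kernel
  refine ⟨isSimple_of_isCMTypeRealisation_of_isPrimitive hA φ₀ hΦ, dim_eq_eight_of_isCMTypeRealisation_forty hK hA, ?_, ?_⟩
  · rcases hbal with hb | hb | hb | hb | hb | hb
    · obtain ⟨c, hcQ, hcH, hcD⟩ := exists_exceptional_of_cosetBalanced hu0 h10 hm0 hn0 hb hprim hc0 hA
      rw [htot] at hcH hcD
      exact ⟨c, hcQ, hcH, hcD⟩
    · obtain ⟨c, hcQ, hcH, hcD⟩ := exists_exceptional_of_cosetBalanced hu1 h11 hm1 hn1 hb hprim hc1 hA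
      rw [htot] at hcH hcD
      exact ⟨c, hcQ, hcH, hcD⟩
    · obtain ⟨c, hcQ, hcH, hcD⟩ := exists_exceptional_of_cosetBalanced hu6 h16 hm6 hn6 hb hprim hc6 hA
      rw [htot] at hcH hcD
      exact ⟨c, hcQ, hcH, hcD⟩
    · obtain ⟨c, hcQ, hcH, hcD⟩ := exists_exceptional_of_cosetBalanced hu7 h17 hm7 hn7 hb hprim hc7 hA
      rw [htot] at hcH hcD
      exact ⟨c, hcQ, hcH, hcD⟩
    · obtain ⟨c, hcQ, hcH, hcD⟩ := exists_exceptional_of_cosetBalanced hu8 h18 hm8 hn8 hb hprim hc8 hA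
      rw [htot] at hcH hcD
      exact ⟨c, hcQ, hcH, hcD⟩
    · obtain ⟨c, hcQ, hcH, hcD⟩ := exists_exceptional_of_cosetBalanced hu9 h19 hm9 hn9 hb hprim hc9 hA
      rw [htot] at hcH hcD
      exact ⟨c, hcQ, hcH, hcD⟩
  · rcases hbal with hb | hb | hb | hb | hb | hb
    · have h := two_le_finrank_hodgeClassSpan_sub_finrank_divisorClassesSpan_of_cosetBalanced hu0 h10 hm0 hn0 hb hprim hc0 hA
      rwa [htot] at h
    · have h := two_le_finrank_hodgeClassSpan_sub_finrank_divisorClassesSpan_of_cosetBalanced hu1 h11 hm1 hn1 hb hprim hc1 hA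
      rwa [htot] at h
    · have h := two_le_finrank_hodgeClassSpan_sub_finrank_divisorClassesSpan_of_cosetBalanced hu6 h16 hm6 hn6 hb hprim hc6 hA
      rwa [htot] at h
    · have h := two_le_finrank_hodgeClassSpan_sub_finrank_divisorClassesSpan_of_cosetBalanced hu7 h17 hm7 hn7 hb hprim hc7 hA
      rwa [htot] at h
    · have h := two_le_finrank_hodgeClassSpan_sub_finrank_divisorClassesSpan_of_cosetBalanced hu8 h18 hm8 hn8 hb hprim hc8 hA
      rwa [htot] at h
    · have h := two_le_finrank_hodgeClassSpan_sub_finrank_divisorClassesSpan_of_cosetBalanced hu9 h19 hm9 hn9 hb hprim hc9 hA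
      rwa [htot] at h

/-- **`B⁴ ≠ D⁴` or `B² ≠ D²` for every realisation of a primitive coset-balanced type of `ℚ(ζ₄₀)`** (balanced for an order-`8` maximal subgroup ⟹
`B⁴(A) ⊗ ℂ ≠ D⁴(A) ⊗ ℂ`; otherwise it is balanced for a `(−1)`-free subgroup of order `4` and `B²(A) ⊗ ℂ ≠ D²(A) ⊗ ℂ`).
[cite: Gordon1999HodgeAVSurvey, 5.13 (ii) and 9.4.3] -/
theorem hodgeClassSpan_ne_of_cosetBalanced_forty (hK : IsCyclotomicExtension {40} ℚ K) (Φ : CMType K) (φ₀ : K →+* ℂ)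
    (hΦ : IsPrimitive (ℂ ≃+* ℂ) Φ.1 φ₀)
    (hb : ((∀ c ∈ unitResidues 40, ((({1, 11, 21, 31} : Finset (ZMod 40))).filter fun w => c * w ∈ residueSet 40 Φ).card = ((({1, 11, 21, 31} : Finset (ZMod 40))).filter fun w => c * w ∉ residueSet 40 Φ).card) ∨
      (∀ c ∈ unitResidues 40, ((({1, 19, 29, 31} : Finset (ZMod 40))).filter fun w => c * w ∈ residueSet 40 Φ).card = ((({1, 19, 29, 31} : Finset (ZMod 40))).filter fun w => c * w ∉ residueSet 40 Φ).card) ∨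
      (∀ c ∈ unitResidues 40, ((({1, 3, 7, 9, 21, 23, 27, 29} : Finset (ZMod 40))).filter fun w => c * w ∈ residueSet 40 Φ).card = ((({1, 3, 7, 9, 21, 23, 27, 29} : Finset (ZMod 40))).filter fun w => c * w ∉ residueSet 40 Φ).card) ∨
      (∀ c ∈ unitResidues 40, ((({1, 3, 9, 11, 17, 19, 27, 33} : Finset (ZMod 40))).filter fun w => c * w ∈ residueSet 40 Φ).card = ((({1, 3, 9, 11, 17, 19, 27, 33} : Finset (ZMod 40))).filter fun w => c * w ∉ residueSet 40 Φ).card) ∨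
      (∀ c ∈ unitResidues 40, ((({1, 7, 9, 11, 13, 19, 23, 37} : Finset (ZMod 40))).filter fun w => c * w ∈ residueSet 40 Φ).card = ((({1, 7, 9, 11, 13, 19, 23, 37} : Finset (ZMod 40))).filter fun w => c * w ∉ residueSet 40 Φ).card) ∨
      (∀ c ∈ unitResidues 40, ((({1, 9, 13, 17, 21, 29, 33, 37} : Finset (ZMod 40))).filter fun w => c * w ∈ residueSet 40 Φ).card = ((({1, 9, 13, 17, 21, 29, 33, 37} : Finset (ZMod 40))).filter fun w => c * w ∉ residueSet 40 Φ).card)))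
    (hA : IsCMTypeRealisation Φ A ι θ) :
    (((∀ c ∈ unitResidues 40, ((({1, 3, 7, 9, 21, 23, 27, 29} : Finset (ZMod 40))).filter fun w => c * w ∈ residueSet 40 Φ).card = ((({1, 3, 7, 9, 21, 23, 27, 29} : Finset (ZMod 40))).filter fun w => c * w ∉ residueSet 40 Φ).card) ∨
      (∀ c ∈ unitResidues 40, ((({1, 3, 9, 11, 17, 19, 27, 33} : Finset (ZMod 40))).filter fun w => c * w ∈ residueSet 40 Φ).card = ((({1, 3, 9, 11, 17, 19, 27, 33} : Finset (ZMod 40))).filter fun w => c * w ∉ residueSet 40 Φ).card) ∨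
      (∀ c ∈ unitResidues 40, ((({1, 7, 9, 11, 13, 19, 23, 37} : Finset (ZMod 40))).filter fun w => c * w ∈ residueSet 40 Φ).card = ((({1, 7, 9, 11, 13, 19, 23, 37} : Finset (ZMod 40))).filter fun w => c * w ∉ residueSet 40 Φ).card) ∨
      (∀ c ∈ unitResidues 40, ((({1, 9, 13, 17, 21, 29, 33, 37} : Finset (ZMod 40))).filter fun w => c * w ∈ residueSet 40 Φ).card = ((({1, 9, 13, 17, 21, 29, 33, 37} : Finset (ZMod 40))).filter fun w => c * w ∉ residueSet 40 Φ).card)) ∧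
      hodgeClassSpan 8 A.X 4 ≠ divisorClassesSpan A.X 8 4) ∨
    (((∀ c ∈ unitResidues 40, ((({1, 11, 21, 31} : Finset (ZMod 40))).filter fun w => c * w ∈ residueSet 40 Φ).card = ((({1, 11, 21, 31} : Finset (ZMod 40))).filter fun w => c * w ∉ residueSet 40 Φ).card) ∨
      (∀ c ∈ unitResidues 40, ((({1, 19, 29, 31} : Finset (ZMod 40))).filter fun w => c * w ∈ residueSet 40 Φ).card = ((({1, 19, 29, 31} : Finset (ZMod 40))).filter fun w => c * w ∉ residueSet 40 Φ).card) ∨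
      (∀ c ∈ unitResidues 40, ((({1, 9, 17, 33} : Finset (ZMod 40))).filter fun w => c * w ∈ residueSet 40 Φ).card = ((({1, 9, 17, 33} : Finset (ZMod 40))).filter fun w => c * w ∉ residueSet 40 Φ).card) ∨
      (∀ c ∈ unitResidues 40, ((({1, 9, 13, 37} : Finset (ZMod 40))).filter fun w => c * w ∈ residueSet 40 Φ).card = ((({1, 9, 13, 37} : Finset (ZMod 40))).filter fun w => c * w ∉ residueSet 40 Φ).card) ∨
      (∀ c ∈ unitResidues 40, ((({1, 3, 9, 27} : Finset (ZMod 40))).filter fun w => c * w ∈ residueSet 40 Φ).card = ((({1, 3, 9, 27} : Finset (ZMod 40))).filter fun w => c * w ∉ residueSet 40 Φ).card) ∨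
      (∀ c ∈ unitResidues 40, ((({1, 7, 9, 23} : Finset (ZMod 40))).filter fun w => c * w ∈ residueSet 40 Φ).card = ((({1, 7, 9, 23} : Finset (ZMod 40))).filter fun w => c * w ∉ residueSet 40 Φ).card)) ∧
      hodgeClassSpan 8 A.X 2 ≠ divisorClassesSpan A.X 8 2) := by
  have h4 : ((∀ c ∈ unitResidues 40, ((({1, 3, 7, 9, 21, 23, 27, 29} : Finset (ZMod 40))).filter fun w => c * w ∈ residueSet 40 Φ).card = ((({1, 3, 7, 9, 21, 23, 27, 29} : Finset (ZMod 40))).filter fun w => c * w ∉ residueSet 40 Φ).card) ∨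
      (∀ c ∈ unitResidues 40, ((({1, 3, 9, 11, 17, 19, 27, 33} : Finset (ZMod 40))).filter fun w => c * w ∈ residueSet 40 Φ).card = ((({1, 3, 9, 11, 17, 19, 27, 33} : Finset (ZMod 40))).filter fun w => c * w ∉ residueSet 40 Φ).card) ∨
      (∀ c ∈ unitResidues 40, ((({1, 7, 9, 11, 13, 19, 23, 37} : Finset (ZMod 40))).filter fun w => c * w ∈ residueSet 40 Φ).card = ((({1, 7, 9, 11, 13, 19, 23, 37} : Finset (ZMod 40))).filter fun w => c * w ∉ residueSet 40 Φ).card) ∨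
      (∀ c ∈ unitResidues 40, ((({1, 9, 13, 17, 21, 29, 33, 37} : Finset (ZMod 40))).filter fun w => c * w ∈ residueSet 40 Φ).card = ((({1, 9, 13, 17, 21, 29, 33, 37} : Finset (ZMod 40))).filter fun w => c * w ∉ residueSet 40 Φ).card)) →
      hodgeClassSpan 8 A.X 4 ≠ divisorClassesSpan A.X 8 4 := fun hb8 h ↦ by
    obtain ⟨-, -, ⟨c, hcQ, hcH, hcD⟩, -⟩ := exists_exceptional_four_of_cosetBalanced_forty hK Φ φ₀ hΦ hb8 hA
    exact hcD (h ▸ Submodule.subset_span ⟨hcQ, hcH⟩)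
  have h2 : ((∀ c ∈ unitResidues 40, ((({1, 11, 21, 31} : Finset (ZMod 40))).filter fun w => c * w ∈ residueSet 40 Φ).card = ((({1, 11, 21, 31} : Finset (ZMod 40))).filter fun w => c * w ∉ residueSet 40 Φ).card) ∨
      (∀ c ∈ unitResidues 40, ((({1, 19, 29, 31} : Finset (ZMod 40))).filter fun w => c * w ∈ residueSet 40 Φ).card = ((({1, 19, 29, 31} : Finset (ZMod 40))).filter fun w => c * w ∉ residueSet 40 Φ).card) ∨
      (∀ c ∈ unitResidues 40, ((({1, 9, 17, 33} : Finset (ZMod 40))).filter fun w => c * w ∈ residueSet 40 Φ).card = ((({1, 9, 17, 33} : Finset (ZMod 40))).filter fun w => c * w ∉ residueSet 40 Φ).card) ∨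
      (∀ c ∈ unitResidues 40, ((({1, 9, 13, 37} : Finset (ZMod 40))).filter fun w => c * w ∈ residueSet 40 Φ).card = ((({1, 9, 13, 37} : Finset (ZMod 40))).filter fun w => c * w ∉ residueSet 40 Φ).card) ∨
      (∀ c ∈ unitResidues 40, ((({1, 3, 9, 27} : Finset (ZMod 40))).filter fun w => c * w ∈ residueSet 40 Φ).card = ((({1, 3, 9, 27} : Finset (ZMod 40))).filter fun w => c * w ∉ residueSet 40 Φ).card) ∨
      (∀ c ∈ unitResidues 40, ((({1, 7, 9, 23} : Finset (ZMod 40))).filter fun w => c * w ∈ residueSet 40 Φ).card = ((({1, 7, 9, 23} : Finset (ZMod 40))).filter fun w => c * w ∉ residueSet 40 Φ).card)) →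
      hodgeClassSpan 8 A.X 2 ≠ divisorClassesSpan A.X 8 2 := fun hb4 h ↦ by
    obtain ⟨-, -, ⟨c, hcQ, hcH, hcD⟩, -⟩ := exists_exceptional_two_of_cosetBalanced_forty hK Φ φ₀ hΦ hb4 hA
    exact hcD (h ▸ Submodule.subset_span ⟨hcQ, hcH⟩)
  rcases cmTypeRank_of_isPrimitive_of_cosetBalanced_forty Φ φ₀ hΦ hb with ⟨hpr, -⟩ | ⟨hpr, -⟩ | ⟨hpr, -⟩ | ⟨hpr, -⟩
  · exact Or.inl ⟨Or.inr (Or.inl hpr.2.2.2.1), h4 (Or.inr (Or.inl hpr.2.2.2.1))⟩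
  · exact Or.inl ⟨Or.inr (Or.inr (Or.inl hpr.2.2.2.2.1)), h4 (Or.inr (Or.inr (Or.inl hpr.2.2.2.2.1)))⟩
  · exact Or.inl ⟨Or.inl hpr.2.2.1, h4 (Or.inl hpr.2.2.1)⟩
  · exact Or.inl ⟨Or.inl hpr.2.2.1, h4 (Or.inl hpr.2.2.1)⟩

/-- **THE DICHOTOMY FOR THE CM ABELIAN VARIETIES OF `ℚ(ζ₄₀)`**: for every abelian variety `A` with complex multiplication by `ℚ(ζ₄₀)` (any type):
EITHER `B•(Aⁿ) ⊗ ℂ = D•(Aⁿ) ⊗ ℂ` for all `n` and the Hodge conjecture holds for every power of `A` (`192` types), OR the type is primitive and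
coset-balanced (`64` types) and `A` is a simple `8`-fold with `B⁴(A) ⊗ ℂ ≠ D⁴(A) ⊗ ℂ` or `B²(A) ⊗ ℂ ≠ D²(A) ⊗ ℂ`.
[cite: Gordon1999HodgeAVSurvey, Thm. 6.4, §9.3, 5.13 (ii), §9.4] -/
theorem hodgeConjectureFor_pow_or_exceptional_forty (hK : IsCyclotomicExtension {40} ℚ K) (Φ : CMType K) (φ₀ : K →+* ℂ)
    (hA : IsCMTypeRealisation Φ A ι θ) :
    ((∀ n m : ℕ, hodgeClassSpan (⨁ fun _ : Fin n => A).dim (⨁ fun _ : Fin n => A).X m =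
        divisorClassesSpan (⨁ fun _ : Fin n => A).X (⨁ fun _ : Fin n => A).dim m) ∧
      ∀ n : ℕ, HodgeConjectureFor (⨁ fun _ : Fin n => A).dim (⨁ fun _ : Fin n => A).X) ∨
    (IsPrimitive (ℂ ≃+* ℂ) Φ.1 φ₀ ∧
      ((∀ c ∈ unitResidues 40, ((({1, 11, 21, 31} : Finset (ZMod 40))).filter fun w => c * w ∈ residueSet 40 Φ).card = ((({1, 11, 21, 31} : Finset (ZMod 40))).filter fun w => c * w ∉ residueSet 40 Φ).card) ∨
      (∀ c ∈ unitResidues 40, ((({1, 19, 29, 31} : Finset (ZMod 40))).filter fun w => c * w ∈ residueSet 40 Φ).card = ((({1, 19, 29, 31} : Finset (ZMod 40))).filter fun w => c * w ∉ residueSet 40 Φ).card) ∨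
      (∀ c ∈ unitResidues 40, ((({1, 3, 7, 9, 21, 23, 27, 29} : Finset (ZMod 40))).filter fun w => c * w ∈ residueSet 40 Φ).card = ((({1, 3, 7, 9, 21, 23, 27, 29} : Finset (ZMod 40))).filter fun w => c * w ∉ residueSet 40 Φ).card) ∨
      (∀ c ∈ unitResidues 40, ((({1, 3, 9, 11, 17, 19, 27, 33} : Finset (ZMod 40))).filter fun w => c * w ∈ residueSet 40 Φ).card = ((({1, 3, 9, 11, 17, 19, 27, 33} : Finset (ZMod 40))).filter fun w => c * w ∉ residueSet 40 Φ).card) ∨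
      (∀ c ∈ unitResidues 40, ((({1, 7, 9, 11, 13, 19, 23, 37} : Finset (ZMod 40))).filter fun w => c * w ∈ residueSet 40 Φ).card = ((({1, 7, 9, 11, 13, 19, 23, 37} : Finset (ZMod 40))).filter fun w => c * w ∉ residueSet 40 Φ).card) ∨
      (∀ c ∈ unitResidues 40, ((({1, 9, 13, 17, 21, 29, 33, 37} : Finset (ZMod 40))).filter fun w => c * w ∈ residueSet 40 Φ).card = ((({1, 9, 13, 17, 21, 29, 33, 37} : Finset (ZMod 40))).filter fun w => c * w ∉ residueSet 40 Φ).card)) ∧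
      A.IsSimple ∧ A.dim = 8 ∧
      (hodgeClassSpan 8 A.X 4 ≠ divisorClassesSpan A.X 8 4 ∨ hodgeClassSpan 8 A.X 2 ≠ divisorClassesSpan A.X 8 2)) := by
  by_cases h : IsPrimitive (ℂ ≃+* ℂ) Φ.1 φ₀ ∧
      ((∀ c ∈ unitResidues 40, ((({1, 11, 21, 31} : Finset (ZMod 40))).filter fun w => c * w ∈ residueSet 40 Φ).card = ((({1, 11, 21, 31} : Finset (ZMod 40))).filter fun w => c * w ∉ residueSet 40 Φ).card) ∨
      (∀ c ∈ unitResidues 40, ((({1, 19, 29, 31} : Finset (ZMod 40))).filter fun w => c * w ∈ residueSet 40 Φ).card = ((({1, 19, 29, 31} : Finset (ZMod 40))).filter fun w => c * w ∉ residueSet 40 Φ).card) ∨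
      (∀ c ∈ unitResidues 40, ((({1, 3, 7, 9, 21, 23, 27, 29} : Finset (ZMod 40))).filter fun w => c * w ∈ residueSet 40 Φ).card = ((({1, 3, 7, 9, 21, 23, 27, 29} : Finset (ZMod 40))).filter fun w => c * w ∉ residueSet 40 Φ).card) ∨
      (∀ c ∈ unitResidues 40, ((({1, 3, 9, 11, 17, 19, 27, 33} : Finset (ZMod 40))).filter fun w => c * w ∈ residueSet 40 Φ).card = ((({1, 3, 9, 11, 17, 19, 27, 33} : Finset (ZMod 40))).filter fun w => c * w ∉ residueSet 40 Φ).card) ∨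
      (∀ c ∈ unitResidues 40, ((({1, 7, 9, 11, 13, 19, 23, 37} : Finset (ZMod 40))).filter fun w => c * w ∈ residueSet 40 Φ).card = ((({1, 7, 9, 11, 13, 19, 23, 37} : Finset (ZMod 40))).filter fun w => c * w ∉ residueSet 40 Φ).card) ∨
      (∀ c ∈ unitResidues 40, ((({1, 9, 13, 17, 21, 29, 33, 37} : Finset (ZMod 40))).filter fun w => c * w ∈ residueSet 40 Φ).card = ((({1, 9, 13, 17, 21, 29, 33, 37} : Finset (ZMod 40))).filter fun w => c * w ∉ residueSet 40 Φ).card))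
  · refine Or.inr ⟨h.1, h.2, isSimple_of_isCMTypeRealisation_of_isPrimitive hA φ₀ h.1, dim_eq_eight_of_isCMTypeRealisation_forty hK hA, ?_⟩
    rcases hodgeClassSpan_ne_of_cosetBalanced_forty hK Φ φ₀ h.1 h.2 hA with ⟨-, h4⟩ | ⟨-, h2⟩
    · exact Or.inl h4
    · exact Or.inr h2
  · have h' : IsPrimitive (ℂ ≃+* ℂ) Φ.1 φ₀ →
        ¬((∀ c ∈ unitResidues 40, ((({1, 11, 21, 31} : Finset (ZMod 40))).filter fun w => c * w ∈ residueSet 40 Φ).card = ((({1, 11, 21, 31} : Finset (ZMod 40))).filter fun w => c * w ∉ residueSet 40 Φ).card) ∨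
      (∀ c ∈ unitResidues 40, ((({1, 19, 29, 31} : Finset (ZMod 40))).filter fun w => c * w ∈ residueSet 40 Φ).card = ((({1, 19, 29, 31} : Finset (ZMod 40))).filter fun w => c * w ∉ residueSet 40 Φ).card) ∨
      (∀ c ∈ unitResidues 40, ((({1, 3, 7, 9, 21, 23, 27, 29} : Finset (ZMod 40))).filter fun w => c * w ∈ residueSet 40 Φ).card = ((({1, 3, 7, 9, 21, 23, 27, 29} : Finset (ZMod 40))).filter fun w => c * w ∉ residueSet 40 Φ).card) ∨
      (∀ c ∈ unitResidues 40, ((({1, 3, 9, 11, 17, 19, 27, 33} : Finset (ZMod 40))).filter fun w => c * w ∈ residueSet 40 Φ).card = ((({1, 3, 9, 11, 17, 19, 27, 33} : Finset (ZMod 40))).filter fun w => c * w ∉ residueSet 40 Φ).card) ∨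
      (∀ c ∈ unitResidues 40, ((({1, 7, 9, 11, 13, 19, 23, 37} : Finset (ZMod 40))).filter fun w => c * w ∈ residueSet 40 Φ).card = ((({1, 7, 9, 11, 13, 19, 23, 37} : Finset (ZMod 40))).filter fun w => c * w ∉ residueSet 40 Φ).card) ∨
      (∀ c ∈ unitResidues 40, ((({1, 9, 13, 17, 21, 29, 33, 37} : Finset (ZMod 40))).filter fun w => c * w ∈ residueSet 40 Φ).card = ((({1, 9, 13, 17, 21, 29, 33, 37} : Finset (ZMod 40))).filter fun w => c * w ∉ residueSet 40 Φ).card)) := fun hp hb ↦ h ⟨hp, hb⟩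
    exact Or.inl ⟨fun n m ↦ hodgeClassSpan_pow_eq_divisorClassesSpan_of_forty hK Φ φ₀ h' hA n m,
      fun n ↦ hodgeConjectureFor_pow_of_forty hK Φ φ₀ h' hA n⟩

variable (K) in
/-- **NON-VACUITY (Shimura §6.2 Thm. 3, tree `exists_isCMTypeRealisation`): there ARE simple abelian `8`-FOLDS with complex multiplication by
`𝓞_{ℚ(ζ₄₀)}` of primitive coset-balanced types — one with `B⁴ ≠ D⁴` (residue set `{1, 3, 7, 9, 11, 13, 21, 23}`), one with `B² ≠ D²`
(residue set `{1, 3, 7, 9, 11, 13, 21, 23}`) — and one of a nondegenerate type, all of whose powers satisfy the Hodge conjecture.**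
[cite: Shimura1998, §6.2 Thm. 3] [cite: Gordon1999HodgeAVSurvey, §9.4.2] -/
theorem exists_isSimple_exceptional_forty [hK : IsCyclotomicExtension {40} ℚ K] :
    (∃ (Φ : CMType K) (A : AbelianVariety ℂ) (ι' : 𝓞 K →+* End A) (θ' : K →+* Module.End ℂ (complexBetti A.X 1)),
      IsCMTypeRealisation Φ A ι' θ' ∧ A.IsSimple ∧ A.dim = 8 ∧ hodgeClassSpan 8 A.X 4 ≠ divisorClassesSpan A.X 8 4) ∧
    (∃ (Φ : CMType K) (A : AbelianVariety ℂ) (ι' : 𝓞 K →+* End A) (θ' : K →+* Module.End ℂ (complexBetti A.X 1)),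
      IsCMTypeRealisation Φ A ι' θ' ∧ A.IsSimple ∧ A.dim = 8 ∧ hodgeClassSpan 8 A.X 2 ≠ divisorClassesSpan A.X 8 2) ∧
    (∃ (Φ : CMType K) (A : AbelianVariety ℂ) (ι' : 𝓞 K →+* End A) (θ' : K →+* Module.End ℂ (complexBetti A.X 1)),
      IsCMTypeRealisation Φ A ι' θ' ∧ A.IsSimple ∧ A.dim = 8 ∧
        ∀ n : ℕ, HodgeConjectureFor (⨁ fun _ : Fin n => A).dim (⨁ fun _ : Fin n => A).X) := by
  haveI := isCMField₈ K
  obtain ⟨φ₀⟩ : Nonempty (K →+* ℂ) := inferInstance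
  obtain ⟨hrN0, hrN1, hrN2, hrN3, hrN4, hrN5, hrN6, hrN7, hrD0, hrD1, hrD2, hrD3, hrI0, hrI1, hrI2, hrI3, hrI4, hrI5, hrI6, hrI7, hrI8, hrI9, hrI10, hrI11⟩ := isCMResidueSet_reps_forty
  obtain ⟨hpN0, hpN1, hpN2, hpN3, hpN4, hpN5, hpN6, hpN7, hpD0, hpD1, hpD2, hpD3⟩ := hasTrivialStabilizer_reps_forty
  obtain ⟨hb0, hb1, hb2, hb3, hb4, hb5, hb6, hb7, hb8, hb9, hb10, hb11⟩ := cosetBalanced_reps_forty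
  have hp : ∀ {Φ : CMType K}, HasTrivialStabilizer 40 (residueSet 40 Φ) → IsPrimitive (ℂ ≃+* ℂ) Φ.1 φ₀ :=
    fun {Φ} h ↦ (isPrimitive_iff_hasTrivialStabilizer 40 Φ φ₀).2 h
  refine ⟨?_, ?_, ?_⟩
  · obtain ⟨Φ, hr⟩ := exists_residueSet_eq_forty (L := K) hrD0
    obtain ⟨A, ι', θ', hA⟩ := Literature.AlgebraicGeometry.ComplexMultiplication.exists_isCMTypeRealisation Φ
    have hpr : IsPrimitive (ℂ ≃+* ℂ) Φ.1 φ₀ := hp (by rw [hr]; exact hpD0)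
    have hbal : (∀ c ∈ unitResidues 40, ((({1, 3, 7, 9, 21, 23, 27, 29} : Finset (ZMod 40))).filter fun w => c * w ∈ residueSet 40 Φ).card = ((({1, 3, 7, 9, 21, 23, 27, 29} : Finset (ZMod 40))).filter fun w => c * w ∉ residueSet 40 Φ).card) ∨
      (∀ c ∈ unitResidues 40, ((({1, 3, 9, 11, 17, 19, 27, 33} : Finset (ZMod 40))).filter fun w => c * w ∈ residueSet 40 Φ).card = ((({1, 3, 9, 11, 17, 19, 27, 33} : Finset (ZMod 40))).filter fun w => c * w ∉ residueSet 40 Φ).card) ∨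
      (∀ c ∈ unitResidues 40, ((({1, 7, 9, 11, 13, 19, 23, 37} : Finset (ZMod 40))).filter fun w => c * w ∈ residueSet 40 Φ).card = ((({1, 7, 9, 11, 13, 19, 23, 37} : Finset (ZMod 40))).filter fun w => c * w ∉ residueSet 40 Φ).card) ∨
      (∀ c ∈ unitResidues 40, ((({1, 9, 13, 17, 21, 29, 33, 37} : Finset (ZMod 40))).filter fun w => c * w ∈ residueSet 40 Φ).card = ((({1, 9, 13, 17, 21, 29, 33, 37} : Finset (ZMod 40))).filter fun w => c * w ∉ residueSet 40 Φ).card) :=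
      Or.inr (Or.inl (by rw [hr]; exact hb0))
    obtain ⟨hS, hd, ⟨c, hcQ, hcH, hcD⟩, -⟩ := exists_exceptional_four_of_cosetBalanced_forty hK Φ φ₀ hpr hbal hA
    exact ⟨Φ, A, ι', θ', hA, hS, hd, fun h ↦ hcD (h ▸ Submodule.subset_span ⟨hcQ, hcH⟩)⟩
  · obtain ⟨Φ, hr⟩ := exists_residueSet_eq_forty (L := K) hrD0
    obtain ⟨A, ι', θ', hA⟩ := Literature.AlgebraicGeometry.ComplexMultiplication.exists_isCMTypeRealisation Φ
    have hpr : IsPrimitive (ℂ ≃+* ℂ) Φ.1 φ₀ := hp (by rw [hr]; exact hpD0)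
    have hbal : (∀ c ∈ unitResidues 40, ((({1, 11, 21, 31} : Finset (ZMod 40))).filter fun w => c * w ∈ residueSet 40 Φ).card = ((({1, 11, 21, 31} : Finset (ZMod 40))).filter fun w => c * w ∉ residueSet 40 Φ).card) ∨
      (∀ c ∈ unitResidues 40, ((({1, 19, 29, 31} : Finset (ZMod 40))).filter fun w => c * w ∈ residueSet 40 Φ).card = ((({1, 19, 29, 31} : Finset (ZMod 40))).filter fun w => c * w ∉ residueSet 40 Φ).card) ∨
      (∀ c ∈ unitResidues 40, ((({1, 9, 17, 33} : Finset (ZMod 40))).filter fun w => c * w ∈ residueSet 40 Φ).card = ((({1, 9, 17, 33} : Finset (ZMod 40))).filter fun w => c * w ∉ residueSet 40 Φ).card) ∨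
      (∀ c ∈ unitResidues 40, ((({1, 9, 13, 37} : Finset (ZMod 40))).filter fun w => c * w ∈ residueSet 40 Φ).card = ((({1, 9, 13, 37} : Finset (ZMod 40))).filter fun w => c * w ∉ residueSet 40 Φ).card) ∨
      (∀ c ∈ unitResidues 40, ((({1, 3, 9, 27} : Finset (ZMod 40))).filter fun w => c * w ∈ residueSet 40 Φ).card = ((({1, 3, 9, 27} : Finset (ZMod 40))).filter fun w => c * w ∉ residueSet 40 Φ).card) ∨
      (∀ c ∈ unitResidues 40, ((({1, 7, 9, 23} : Finset (ZMod 40))).filter fun w => c * w ∈ residueSet 40 Φ).card = ((({1, 7, 9, 23} : Finset (ZMod 40))).filter fun w => c * w ∉ residueSet 40 Φ).card) :=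
      Or.inr (Or.inr (Or.inl (by rw [hr]; exact hb2)))
    obtain ⟨hS, hd, ⟨c, hcQ, hcH, hcD⟩, -⟩ := exists_exceptional_two_of_cosetBalanced_forty hK Φ φ₀ hpr hbal hA
    exact ⟨Φ, A, ι', θ', hA, hS, hd, fun h ↦ hcD (h ▸ Submodule.subset_span ⟨hcQ, hcH⟩)⟩
  · obtain ⟨Φ, hr⟩ := exists_residueSet_eq_forty (L := K) hrN0
    obtain ⟨A, ι', θ', hA⟩ := Literature.AlgebraicGeometry.ComplexMultiplication.exists_isCMTypeRealisation Φ
    have hpr : IsPrimitive (ℂ ≃+* ℂ) Φ.1 φ₀ := hp (by rw [hr]; exact hpN0)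
    have hn : ¬((∀ c ∈ unitResidues 40, ((({1, 11, 21, 31} : Finset (ZMod 40))).filter fun w => c * w ∈ residueSet 40 Φ).card = ((({1, 11, 21, 31} : Finset (ZMod 40))).filter fun w => c * w ∉ residueSet 40 Φ).card) ∨
      (∀ c ∈ unitResidues 40, ((({1, 19, 29, 31} : Finset (ZMod 40))).filter fun w => c * w ∈ residueSet 40 Φ).card = ((({1, 19, 29, 31} : Finset (ZMod 40))).filter fun w => c * w ∉ residueSet 40 Φ).card) ∨
      (∀ c ∈ unitResidues 40, ((({1, 3, 7, 9, 21, 23, 27, 29} : Finset (ZMod 40))).filter fun w => c * w ∈ residueSet 40 Φ).card = ((({1, 3, 7, 9, 21, 23, 27, 29} : Finset (ZMod 40))).filter fun w => c * w ∉ residueSet 40 Φ).card) ∨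
      (∀ c ∈ unitResidues 40, ((({1, 3, 9, 11, 17, 19, 27, 33} : Finset (ZMod 40))).filter fun w => c * w ∈ residueSet 40 Φ).card = ((({1, 3, 9, 11, 17, 19, 27, 33} : Finset (ZMod 40))).filter fun w => c * w ∉ residueSet 40 Φ).card) ∨
      (∀ c ∈ unitResidues 40, ((({1, 7, 9, 11, 13, 19, 23, 37} : Finset (ZMod 40))).filter fun w => c * w ∈ residueSet 40 Φ).card = ((({1, 7, 9, 11, 13, 19, 23, 37} : Finset (ZMod 40))).filter fun w => c * w ∉ residueSet 40 Φ).card) ∨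
      (∀ c ∈ unitResidues 40, ((({1, 9, 13, 17, 21, 29, 33, 37} : Finset (ZMod 40))).filter fun w => c * w ∈ residueSet 40 Φ).card = ((({1, 9, 13, 17, 21, 29, 33, 37} : Finset (ZMod 40))).filter fun w => c * w ∉ residueSet 40 Φ).card)) := by
      rw [hr]; exact not_cosetBalanced_reps_forty.1
    exact ⟨Φ, A, ι', θ', hA, isSimple_of_isCMTypeRealisation_of_isPrimitive hA φ₀ hpr, dim_eq_eight_of_isCMTypeRealisation_forty hK hA,
      fun n ↦ hodgeConjectureFor_pow_of_forty hK Φ φ₀ (fun _ ↦ hn) hA n⟩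

end Varieties

/-! ### §3 Complex tori with an endomorphism of characteristic polynomial `Φ₄₀` -/

section Tori

variable {ι : Type} [Fintype ι] [DecidableEq ι] {E : Type} [NormedAddCommGroup E] [NormedSpace ℂ E]
  {P : (ι → ℝ) ≃L[ℝ] E}

set_option backward.isDefEq.respectTransparency false in -- Mathlib's instance
-- `IsCyclotomicExtension {40} ℚ (CyclotomicField 40 ℚ)` is keyed on `CyclotomicField.algebra`, the goal on `DivisionRing.toRatAlgebra`
/-- **`rank MT(X) ∈ {9, 7, 5, 3, 2}` FOR A COMPLEX TORUS WITH AN ENDOMORPHISM OF CHARACTERISTIC POLYNOMIAL `Φ₄₀`, and `X` is simple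
iff `rank MT(X) ≥ 7`**: `X ≅ ℂ⁸/Φ(𝔞)` (structure theorem), `rank MT(X) = Rank(Φ)` (§1). [cite: Shimura1998, §6.2 Thm. 3] [cite: Gordon1999HodgeAVSurvey, §9.4] -/
theorem mtRank_hodgeStructure_mem_and_isSimple_iff_forty [HodgeTensorFacts.{0, 0}] {A : Matrix ι ι ℤ} (hA : A ∈ endRingInt P)
    (hP : A.charpoly = cyclotomic 40 ℤ) :
    ((hodgeStructure P 1).mtRank = 9 ∨ (hodgeStructure P 1).mtRank = 7 ∨ (hodgeStructure P 1).mtRank = 5 ∨ (hodgeStructure P 1).mtRank = 3 ∨ (hodgeStructure P 1).mtRank = 2) ∧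
      (ComplexTorus.IsSimple P ↔ 7 ≤ (hodgeStructure P 1).mtRank) := by
  have hζ := IsCyclotomicExtension.zeta_spec 40 ℚ (CyclotomicField 40 ℚ)
  obtain ⟨Φ, I, e, he, he₂, -⟩ := exists_cmType_ideal_iso_of_charpoly_eq_cyclotomic hζ hA hP
  haveI : IsCMField (CyclotomicField 40 ℚ) := isCMField₈ (CyclotomicField 40 ℚ)
  obtain ⟨φ₀⟩ : Nonempty (CyclotomicField 40 ℚ →+* ℂ) := inferInstance
  have hXiso : IsIsomorphic P (periodIso Φ I) := ⟨e, he, he₂⟩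
  rw [IsIsomorphic.mtRank_hodgeStructure_eq P (periodIso Φ I) (k := 1) hXiso, mtRank_hodgeStructure_periodIso_eq_cmTypeRank Φ I,
    hXiso.isSimple_iff, isSimple_periodIso_iff_isPrimitive Φ I φ₀]
  exact ⟨cmTypeRank_mem_forty inferInstance Φ, isPrimitive_iff_seven_le_cmTypeRank_forty inferInstance Φ φ₀⟩

set_option backward.isDefEq.respectTransparency false in -- see above
/-- **FOR `X` WITH `P_u = Φ₄₀`: `Hdg(Xᵏ) = Div(Xᵏ)` FOR ALL `k` ⟺ (`X` simple → `rank MT(X) = 9`)** — simple: Hazama–Murty's criterion `rank = dim + 1`;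
non-simple: `X ≅ ℂ⁸/Φ(𝔞)` with `Φ` imprimitive, induced from a NONDEGENERATE type (§0–§1), so `Hdg = Div` on all powers.
[cite: Gordon1999HodgeAVSurvey, 7.5 and §9.3] [cite: MoonenZarhin1999LowDim, §2 Thm. (2.7)] [cite: Shimura1998, §6.2 Thm. 3] -/
theorem forall_divisorClasses_powPeriod_eq_hodgeClasses_iff_forty [HodgeTensorFacts.{0, 0}] {A : Matrix ι ι ℤ} (hA : A ∈ endRingInt P)
    (hP : A.charpoly = cyclotomic 40 ℤ) :
    (∀ k p : ℕ, divisorClasses (powPeriod P k) p = hodgeClasses (powPeriod P k) p) ↔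
      (ComplexTorus.IsSimple P → (hodgeStructure P 1).mtRank = 9) := by
  have hζ := IsCyclotomicExtension.zeta_spec 40 ℚ (CyclotomicField 40 ℚ)
  obtain ⟨Φ, I, e, he, he₂, -⟩ := exists_cmType_ideal_iso_of_charpoly_eq_cyclotomic hζ hA hP
  haveI : IsCMField (CyclotomicField 40 ℚ) := isCMField₈ (CyclotomicField 40 ℚ)
  obtain ⟨φ₀⟩ : Nonempty (CyclotomicField 40 ℚ →+* ℂ) := inferInstance
  have hXiso : IsIsomorphic P (periodIso Φ I) := ⟨e, he, he₂⟩
  have hcard : Fintype.card (basisIndex I) = 16 := by rw [card_basisIndex_eq_finrank, finrank_eq_sixteen₈ (CyclotomicField 40 ℚ)]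
  haveI : Nonempty (basisIndex I) := Fintype.card_pos_iff.1 (by omega)
  have hY := isAbelianVariety_periodIso Φ I
  rw [hXiso.isIsogenous.forall_powPeriod_divisorClasses_eq_hodgeClasses_iff, hXiso.isSimple_iff,
    IsIsomorphic.mtRank_hodgeStructure_eq P (periodIso Φ I) (k := 1) hXiso]
  by_cases hS : ComplexTorus.IsSimple (periodIso Φ I)
  · rw [hY.forall_powPeriod_divisorClasses_eq_hodgeClasses_iff_mtRank_eq_card_of_isSimple_of_isTorusSubgroup_mumfordTateGroupC hS
        (isTorusSubgroup_mumfordTateGroupC_periodIso Φ I), hcard]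
    simp only [hS, forall_true_left]
  · simp only [hS, false_implies, iff_true]
    have hnp : ¬IsPrimitive (ℂ ≃+* ℂ) Φ.1 φ₀ := fun h ↦ hS ((isSimple_periodIso_iff_isPrimitive Φ I φ₀).2 h)
    rcases cmTypeRank_of_not_isPrimitive_forty Φ φ₀ hnp with ⟨hs, hr⟩ | ⟨hs, hr⟩ | ⟨hs, hr⟩
    · exact divisorClasses_powPeriod_periodIso_eq_hodgeClasses_of_card_stabilizer_mul_eq (N := 40) (by norm_num) Φ (k := 4)
        (by rw [hs]; decide +kernel) hr I
    · exact divisorClasses_powPeriod_periodIso_eq_hodgeClasses_of_card_stabilizer_mul_eq (N := 40) (by norm_num) Φ (k := 2)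
        (by rw [hs]; decide +kernel) hr I
    · exact divisorClasses_powPeriod_periodIso_eq_hodgeClasses_of_card_stabilizer_mul_eq (N := 40) (by norm_num) Φ (k := 1)
        (by rw [hs]; decide +kernel) hr I

/-- **`Hdg(Xᵏ) = Div(Xᵏ)` for all `k` when `X` is not simple or `rank MT(X) = 9`.** [cite: Gordon1999HodgeAVSurvey, 7.5] [cite: MoonenZarhin1999LowDim, §2 (2.7)] -/
theorem divisorClasses_powPeriod_eq_hodgeClasses_of_forty [HodgeTensorFacts.{0, 0}] {A : Matrix ι ι ℤ} (hA : A ∈ endRingInt P)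
    (hP : A.charpoly = cyclotomic 40 ℤ) (h : ComplexTorus.IsSimple P → (hodgeStructure P 1).mtRank = 9) (k p : ℕ) :
    divisorClasses (powPeriod P k) p = hodgeClasses (powPeriod P k) p :=
  (forall_divisorClasses_powPeriod_eq_hodgeClasses_iff_forty hA hP).2 h k p

set_option backward.isDefEq.respectTransparency false in -- see above
/-- **EACH PRIMITIVE RANK OCCURS AMONG SIMPLE ABELIAN `8`-FOLDS WITH `u = ζ₄₀`**: for a type `Φ` whose residue set is a representative of rank
`9, 7` and any ideal `𝔞`, the torus `ℂ⁸/Φ(𝔞)` is a simple abelian variety with the endomorphism `ζ₄₀` and `rank MT = Rank(Φ)`; only for rank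
`9` is `Hdg = Div` on all powers. [cite: Shimura1998, §6.2 Thm. 3] [cite: Gordon1999HodgeAVSurvey, 7.5 and §9.4.2] -/
theorem exists_isSimple_mtRank_eq_forty [HodgeTensorFacts.{0, 0}] :
    (∃ Φ : CMType (CyclotomicField 40 ℚ), ∀ I : (FractionalIdeal (𝓞 (CyclotomicField 40 ℚ))⁰ (CyclotomicField 40 ℚ))ˣ,
      ComplexTorus.IsSimple (periodIso Φ I) ∧ IsAbelianVariety (periodIso Φ I) ∧
      (∃ A ∈ endRingInt (periodIso Φ I), A.charpoly = cyclotomic 40 ℤ) ∧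
      (hodgeStructure (periodIso Φ I) 1).mtRank = 9) ∧
    (∃ Φ : CMType (CyclotomicField 40 ℚ), ∀ I : (FractionalIdeal (𝓞 (CyclotomicField 40 ℚ))⁰ (CyclotomicField 40 ℚ))ˣ,
      ComplexTorus.IsSimple (periodIso Φ I) ∧ IsAbelianVariety (periodIso Φ I) ∧
      (∃ A ∈ endRingInt (periodIso Φ I), A.charpoly = cyclotomic 40 ℤ) ∧
      (hodgeStructure (periodIso Φ I) 1).mtRank = 7) := by
  have hζ := IsCyclotomicExtension.zeta_spec 40 ℚ (CyclotomicField 40 ℚ)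
  haveI : IsCMField (CyclotomicField 40 ℚ) := isCMField₈ (CyclotomicField 40 ℚ)
  obtain ⟨φ₀⟩ : Nonempty (CyclotomicField 40 ℚ →+* ℂ) := inferInstance
  obtain ⟨hrN0, hrN1, hrN2, hrN3, hrN4, hrN5, hrN6, hrN7, hrD0, hrD1, hrD2, hrD3, hrI0, hrI1, hrI2, hrI3, hrI4, hrI5, hrI6, hrI7, hrI8, hrI9, hrI10, hrI11⟩ := isCMResidueSet_reps_forty
  obtain ⟨hpN0, hpN1, hpN2, hpN3, hpN4, hpN5, hpN6, hpN7, hpD0, hpD1, hpD2, hpD3⟩ := hasTrivialStabilizer_reps_forty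
  have hend : ∀ (Φ : CMType (CyclotomicField 40 ℚ)) (I : (FractionalIdeal (𝓞 (CyclotomicField 40 ℚ))⁰ (CyclotomicField 40 ℚ))ˣ),
      ∃ A ∈ endRingInt (periodIso Φ I), A.charpoly = cyclotomic 40 ℤ :=
    fun Φ I ↦ ⟨Literature.NumberTheory.ComplexMultiplication.CMTypeLattice.mulMatrix I hζ.toInteger,
      mulMatrix_toInteger_mem_endRingInt hζ Φ I, charpoly_mulMatrix_toInteger hζ I⟩
  have hsimple : ∀ {Φ : CMType (CyclotomicField 40 ℚ)}, HasTrivialStabilizer 40 (residueSet 40 Φ) →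
      ∀ I, ComplexTorus.IsSimple (periodIso Φ I) := fun {Φ} hΦ I ↦
    (isSimple_periodIso_iff_isPrimitive Φ I φ₀).2 ((isPrimitive_iff_hasTrivialStabilizer 40 Φ φ₀).2 hΦ)
  refine ⟨?_, ?_⟩
  · obtain ⟨Φ, hr⟩ := exists_residueSet_eq_forty (L := CyclotomicField 40 ℚ) hrN0
    refine ⟨Φ, fun I ↦ ⟨hsimple (by rw [hr]; exact hpN0) I, isAbelianVariety_periodIso Φ I, hend Φ I, ?_⟩⟩
    rw [mtRank_hodgeStructure_periodIso_eq_cmTypeRank Φ I]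
    exact cmTypeRank_eq_nine_of_residueSet_mem_forty Φ (by rw [hr]; simp)
  · obtain ⟨Φ, hr⟩ := exists_residueSet_eq_forty (L := CyclotomicField 40 ℚ) hrD0
    refine ⟨Φ, fun I ↦ ⟨hsimple (by rw [hr]; exact hpD0) I, isAbelianVariety_periodIso Φ I, hend Φ I, ?_⟩⟩
    rw [mtRank_hodgeStructure_periodIso_eq_cmTypeRank Φ I]
    exact cmTypeRank_eq_of_residueSet_eq_D1_forty Φ hr

end Tori

end ComplexTorus

end Literature.Geometry.Kaehler

end
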